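import Summits.Ventures.HSemireg.Pad4TowerXresFamilies
import Summits.Ventures.HSemireg.Pad4TowerLineLetters

/-!
# H2 door PAD-4 · lens «control» (g8, v6) — THE LINE INERTIA THEOREM: on the LINE alphabet `α + c = h`, a RULE-D-closed,
# `X+`-closed, phase-shift-closed support has NO multiply charged cell (every `h`, no (H1), no capacity, no Hall, no LP) — and the
# PHASE-MIXING DICHOTOMY (§9, §11, kernel, EVERY h ≥ 8): without the phase shifts, `G₁ = ⟨Δ⟩ × S₄`-closed static-closed LINE-h
# supports carrying the fully charged `[(h−2)I+ℓ_u]⁴` exist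

HONEST FRAMING. Crux workfile of `stmt-HodgeConjecture-18881` (`EightfoldBlochSeeds.BlochSeedDiscOne` = `HasHyperbolicBlochSeed 4 1`,
skeleton `Cruxes/BlochSeedDiscOne/Lines/birth.lean` 814a6a70c14e831a, T3 PLAN-ONLY), written by the LENSES-v3 «control» ideator
(director-hodge req-36: «find the controlling quantity … conjecture its law in h … type the h-uniform statement»). It is a theorem ABOUT
THE CELL'S TYPED STATIC RULES — `Pad4TowerRuleDMu4.RuleDMu4Closed` (RULE D on 𝔅(μ₄), encoder families of record, FLAG H-1∕F-1∕F-2 of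
that file) and `Pad4TowerXresFamilies.XPlusClosed` (the `X+` family = xres2s `X` clauses on the dual world) — restricted to configurations
whose letters all lie on the LINE `α + c = h` (`Pad4TowerLineLetters.lineLetter h c k = (α, β) = (h − c, c·conj(i^k))`, i.e. the letter
`(h−2c)·I + c·ℓ` of the lineage's `tI + cℓ` naming; effective: `2c ≤ h`).
NOTHING HERE PROVES OR REFUTES HC ∕ HC_CM ∕ HC_AV ∕ H2 ∕ 18881; no variety, sheaf, cycle or abelian variety occurs; the research route is
conditional on HC_CM as a displayed binder only. No `sorry`, no `instance`, no notation, axioms standard.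

CONTENT (all PROVED, h-uniform unless marked probe).
* §1 `IsLL h x` (effective LINE letter), `LSupport h C`; letter facts; `isLL_of_lineCell` (glue from `LineCell` + `Effective`).
* §2 **`up_classify`** — the ray classification on the LINE: a LINE letter `d ≥ 1` null steps above the LINE letter `(c,k)` in direction
  `r` has `r = k+2`, charge `c − d`, and the same phase unless it is the apex (64 cases, `omega`); `of_dual_ray`, `dual_lineLetter`
  (transport through the `X+` dual `dualPt 0`).
* §3 RULE D ON THE LINE, closed forms: **`p_up_server`** (RD-P: a RULE-D `P`-cell is served above along each charged letter's own ray: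
  `P(g ↦ (c′,k))`, `c′ < c`, is a present `N`-cell); **`n_down_server`** (RD-N≥2: an `N`-cell with two charged letters is served below
  along their own rays: `Z(g ↦ (c′,k))`, `c < c′ ≤ h∕2`, present — so a top-charge letter next to another charged letter is fatal = the
  ROUND-1 LAW (T1) of CAPFREE-U-g7 §6); **`n_hub_alternative`** (RD-N1: charged letter on `g`, apex on `j`: own-ray service of `g`, or a
  `P`-cell `Z(j ↦ (d,p))` with `p ≠ k′`, or the cover — for every direction `k′`).
* §4 **`xplus_fires`** (X⁺-LINE): the apex-demand `X+` clause FIRES on a present `P`-cell with a charged letter `(c,k)` on `σ`, an apex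
  letter on `f`, its hub `P(σ ↦ hI)` present with no shallower own-ray `N`-cell, and a present sibling `P(σ ↦ (e,k″))`, `k″ ≠ k`, with no
  companion `N`-cell `P(σ ↦ (e′,k″))`, `e′ < e` ((H-e′) letterwise; (H-b), `W_f = ∅` vacuous at an apex factor).
* §5 **`line_inertia`** — THE LINE INERTIA THEOREM: `LSupport h C → RuleDMu4Closed C → XPlusClosed C → SibClosed h C → no cell of C is
  multiply charged` (proof: the multiply charged cell of lowest `α` — the CONTROLLING QUANTITY `lowA` — is a `P`-cell; its second letter is
  hub-served; the phase-advanced sibling is present; §4 fires); `shift2Closed_sibClosed` (invariance under the two-factor `Σ ≡ 0` phase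
  shifts suffices); **`top_layer`** — THE TOP-LAYER LAW with NO symmetry (`h = 2n ≥ 2`): no `N`-cell carries a charge-`n` letter, and a
  `P`-cell carrying one is `P(n ∣ apex³)`.
* §6 `prod_betaG_eq_zero`, **`wch_eWord_eq_zero`**: on such a support `Π_f β_f = 0` on every cell, so the `eeee`-coefficient (`μ`) of
  `MConfig.wch` vanishes for EVERY integer weighting — no class screen (H1), capacity, Hall or multiplicity hypothesis.
* §7 probes (`decide`, `h = 6`): the three closed forms and the `X+` blockers compute as stated on 3–7-cell configurations.
* §8 **`xminus_vacuous`, `a2iMinus_vacuous`, `a2iPlus_vacuous`**: on a LINE support the families `X−`, `A2I−`, `A2I+` never fire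
  (partners below a LINE letter lie on its own ray `k+2`; the encoder direction `k` leaves the LINE), so `XresFourClosed ↔ XPlusClosed`
  (`xresFour_iff_xplus`); **`xplus_of_phasePure`** ∕ **`xplus_of_cellwisePure`**: a LINE support whose charged letters have ONE phase
  (globally; resp. per cell, with the bare hub `N(apex⁴)` absent) is `X+`-closed.
* §9 TWO SEPARATING CONFIGURATIONS (kernel): **`Sep6`** (LINE-6, 5 cells) is RULE-D-closed and four-family-closed and carries the multiply
  charged `P(1₀,1₀∣apex²)` — `SibClosed` cannot be dropped from `line_inertia`; **`FC8`** (LINE-8, 59 cells, one phase) = the RULE-D closure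
  of the FULLY CHARGED `[6I+ℓ]⁴` is RULE-D-closed (59 `decide`s) and four-family-closed (§8) — `fc8_static`, `fc8_separates`; its
  `⟨Δ⟩ × S₄`-orbit union **`FC8G1`** (236 cells) is `G₁`-CLOSED (`fc8G1_deltaClosed`, `fc8G1_permClosed`), RULE-D-closed and
  four-family-closed (`fc8G1_static`) and contains all four diagonal unit cells `[6I+ℓ_u]⁴` (`fc8G1_separates`). DICHOTOMY: the static
  kill of fully charged cells on the LINE is ENTIRELY a phase-mixing phenomenon — with the `Σ ≡ 0` shifts none survives (all `h`,
  `line_inertia`); with only `G₁` (which never mixes phases inside a cell) `[6I+ℓ_u]⁴` survives inside a 236-cell `G₁`-closed static-closed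
  support: the LINE-side twin of bc5-plan's ◇₈-`G₁` census (W) j310554 «H₁-static FC survivors are the diagonal unit cells `[ℓ_u]⁴`,
  `[6I+ℓ_u]⁴`» (FAMCORE j305149).
* §10 THE STATIC LINE SKELETON (critic idea-crit-6 g13's Q-crit, cell INBOX l.8975: «is the sibling-closed static class apex-only?» — NO):
  **`xplus_of_companions`** (h-uniform: if every charged `P`-letter has charge `≥ 2` and the charge-1 `N`-cell of its phase below it is
  present, `X+` is closed — the companion breaks (H-d)); `sibClosed_of_advance`; **`Skel6`** (66 cells) ∕ **`Skel8`** (98 cells) =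
  `{N(c∣apex³) : c ≤ n−1} ∪ {P(c∣apex³) : c = 0 or 2 ≤ c ≤ n}`, all phases and factors, are RULE-D-closed (`decide`), four-family-closed,
  SIBLING-CLOSED and carry charged letters (`skel6_answer`, `skel8_answer`) — kernel twins of check-static-1 batch 59 (Q1a) rows 472a–d
  (hull fixed point S∞(h) = these 2n classes, 66 ∕ 98 ∕ 130 ∕ 162 cells at h = 6 ∕ 8 ∕ 10 ∕ 12, machine ×2). So the class of `line_inertia`
  is non-trivial and «no MULTIPLY charged cell» is its sharp content.
* §11 TRANSLATION INVARIANCE OF RULE D (h-uniform, structural): `ruleDMu4N_trans`, `ruleDMu4P_trans`, `ruleDMu4Closed_trans`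
  (translating every cell along the apex axis `α ↦ α + t` preserves `RuleDMu4Closed`: coordinates shift together, frames, partners,
  covers translate), `lsupport_trans`, `cellwise_trans`; hence **`fcLine_uniform`**: for EVERY `h ≥ 8`, `FCLine h := FC8G1 + (h−8)·I`
  is an effective LINE-`h` support, `G₁`-closed, RULE-D-closed, four-family-closed, contains the four fully charged `[(h−2)I+ℓ_u]⁴`, and
  is not sibling-closed — THE h-UNIFORM `G₁` SEPARATION: at every height the H₁-statics under `G₁` leave the ceiling-line diagonal unit
  cells alive (prediction for the ◇₁₀-`G₁` census j308425 and beyond, on the ceiling line); only the `Σ ≡ 0` shifts kill them.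
* §12 THE FC THRESHOLD (no symmetry, structural): `no_fc_line6` — a RULE-D-closed, `X+`-closed effective LINE-6 support contains NO
  fully charged cell (chain `1 → 2 → 3` into the TOP-LAYER LAW; kernel twin of check-static-1 b59 «LINE-6 FC UNSAT»); with §11,
  `fc_threshold`: the least height at which the H₁-statics admit a fully charged LINE cell is exactly `8`.
* §13 Ψ₁ ON THE LINE: `ruleDMu4Closed_delta` (RULE D is `Δ`-COVARIANT, structural); `psiQ_line` (Ψ of a LINE cell = product of
  its charges), `fcN_of_fcP_psi` ∕ `psiClause_of_fc` (on a LINE support Ψ₁ ⟺ FC cells on both levels or on neither);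
  **`no_fc_psi_line8`** — at `h = 8`, RULE D + `X+` + Ψ₁ exclude fully charged cells with NO symmetry (climb `2 → 3 → 4`; kernel twin
  of check-static-1 b59 «LINE-8 FC + Ψ₁ UNSAT»); the LAYERED SIMPLEX `Simp10` (`N`: total charge 3–4, `P`: 4–5; RULE D by `decide`),
  its `G₁`-orbit union `Simp10G1` (584 cells; structural) and **`simpLine_uniform`**: for EVERY `h ≥ 10` a `G₁`-closed, static-closed,
  Ψ₁-balanced effective LINE-`h` support with fully charged cells on both levels; `fc_psi_threshold`: the Ψ₁ threshold is exactly 10.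

WHAT THIS EXPLAINS ∕ SUPERSEDES (census rows; see `LINE-INERTIA-g8.md`). The STATIC-LAZY verdict table of CAPFREE-U-g7.md §6 STEP 2
(h = 6 … 22, G-invariant `X+`-closed LINE supports: «(H1)+capacity(+Hall) ⇒ μ′ = 0», chaincert.py 0036a33c, critic Φ₅ ×2 cell INBOX l.8817,
check-static-1 LEDGER-static rows 431∕432∕448–453∕471 ×2, file sha16 5074b8b92a89c2d4) is the G-invariant SHADOW of `line_inertia`: control's
`G = S₄ × (Σ ≡ 0 phase shifts) × conj` implies `SibClosed`, so those supports carry no multiply charged cell at all and μ = 0 identically,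
for every `h`, with no LP. `top_layer` is the symmetric-free form of the memo's (T1)∕(T2)∕(S1) premise («S ⊆ L_{h−2} ∪ {P(n∣apex³)}»).

WHAT IS NOT CLAIMED. (i) For supports that are not sibling-closed NOTHING is excluded below the top layer — and §9 shows nothing can be:
`Sep6`∕`FC8`∕`FC8G1` are static-closed with multiply ∕ fully charged cells (the hub of level `m < n` is served by the tower `P(n ∣ apex³)`;
one phase per cell and no bare hub `N(apex⁴)` keep `X+` quiet), `FC8G1` even `G₁ = ⟨Δ⟩ × S₄`-closed: the dividing line is exactly the
`Σ ≡ 0` phase-shift symmetry (sibling closure), not `G₁`. (ii) The DIAMOND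
alphabet ◇_h (nodes `2I, 4I, …`, towers) — the bc5-plan censuses ◇₈ r3 j305149 ∕ ◇₁₀ G₁ j308425 live there and DO carry static-alive
multiply charged designs; this file is about the ceiling LINE only. (iii) `line_inertia` assumes only `X+` (weaker than
StaticFour-closed); by §8 the other three families are vacuous on the LINE anyway. (iv) The typed rules are the encoder families of record
(FLAG H-1∕F-1∕F-2), ×2 against xres2s by j310554 and `Pad4TowerXresFamilies.xcSamples_xres` — a theorem about THEM, not about any other
reading of the statics. (v) Object level: nothing (no sheaf, no seed, no HC_CM instance).

SOURCES (sha16 ∕ ids). Tree: `Pad4TowerRuleDMu4` (RULE D, engine §4), `Pad4TowerRuleDMu4Dual` (`dualPt`, `MConfig.dual`, `mem_dual_upper`),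
`Pad4TowerXStaticSafe2` (`HeOkP`, `HbOkP`, `WfEmpty`, `NullBelow`), `Pad4TowerXresFamilies` (`XresXFires`, `XPlusClosed`), `Pad4TowerCrossPhase`
(`MCell`, `MConfig`, `ray`, `UPartner`, `Sibling`, `NoCompanion`, `mcellOf`), `Pad4TowerLineLetters` 4995da7df9b33f6b (`lineLetter`, `LineCell`,
`betaG`, `ch_eWord`), `Pad4TowerPsiSubA1` (`MConfig.wch`, `eWord`). Lineage: CAPFREE-U-g7.md v1.14 (crux dir, commit c55f46b67c71), CapFreeU.lean
a41f533f9e3bf191; bc5-plan g8 card (◇₈ r3 j305149, ◇₁₀ G₁ j308425, encoder ×2 j310554, LINE 4 j310053); gs-eng-2 g53 certs j309715 ∕ peel j309861;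
check-static-1 LEDGER-static 5074b8b92a89c2d4 (rows 431, 432, 448–453, 471). Director-hodge req-36 (ladder-directors/REQUESTS.md 2026-08-28T15:04:06Z).
-/

set_option linter.dupNamespace false

namespace Summit.HodgeConjecture.HodgeConjecture.Cruxes.BlochSeedDiscOne.LineInertia

open Finset Summit.Ventures.HSemireg.Pad4Tower Summit.Ventures.HSemireg.LinePhaseTorus

/-! ## §1 Effective LINE letters and LINE supports -/

/-- `x` is an EFFECTIVE LINE-`h` LETTER: `x = lineLetter h c k = ((h − c)·I + c·ℓ_{i^k})` with `2c ≤ h` (effective from `O`). -/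
abbrev IsLL (h : ℤ) (x : BPoint) : Prop := ∃ c : ℕ, ∃ k : Fin 4, 2 * (c : ℤ) ≤ h ∧ x = lineLetter h c k

/-- an EFFECTIVE LINE-`h` SUPPORT: every letter of every cell, on both levels, is an effective LINE-`h` letter. -/
abbrev LSupport (h : ℤ) (C : MConfig) : Prop :=
  (∀ Z ∈ C.lower, ∀ f, IsLL h (Z f)) ∧ (∀ P ∈ C.upper, ∀ f, IsLL h (P f))

/-- the charge-`0` letter is the apex `hI`, whatever the phase tag. -/
theorem lineLetter_zero (h : ℤ) (k : Fin 4) : lineLetter h 0 k = (h, 0, 0) := by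
  simp [lineLetter]

/-- a LINE letter is an apex point iff its charge is `0`. -/
theorem isApex_lineLetter_iff (h : ℤ) (c : ℕ) (k : Fin 4) : isApex (lineLetter h c k) ↔ c = 0 := by
  fin_cases k <;> simp [lineLetter, isApex]

/-- a LINE letter of phase `k` is adapted to its own direction `k` and to the antipode `k + 2`. -/
theorem adapted_lineLetter (h : ℤ) (c : ℕ) (k : Fin 4) :
    Adapted (lineLetter h c k) k ∧ Adapted (lineLetter h c k) (k + 2) := by
  fin_cases k <;> simp [lineLetter, Adapted]

/-- its own coordinate is `h`, its antipodal coordinate is `h − 2c`. -/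
theorem coord_lineLetter (h : ℤ) (c : ℕ) (k : Fin 4) :
    coord (lineLetter h c k) k = h ∧ coord (lineLetter h c k) (k + 2) = h - 2 * c := by
  fin_cases k <;> simp [lineLetter, coord] <;> ring

/-- the `α`-part of a LINE letter. -/
theorem lineLetter_fst (h : ℤ) (c : ℕ) (k : Fin 4) : (lineLetter h c k).1 = h - c := by
  simp [lineLetter]

/-- from the tree's hypotheses: a LINE cell (`LinePhaseTorus.LineCell`) with letters effective from `O` has effective LINE letters. -/
theorem isLL_of_lineCell {h : ℤ} {Z : MCell} (hZ : LineCell h Z) (heff : ∀ f, Effective (Z f)) (f : Fin 4) : IsLL h (Z f) := by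
  obtain ⟨c, k, e⟩ := hZ f
  refine ⟨c, k, ?_, e⟩
  have h1 := heff f
  rw [e] at h1
  rcases h1 with ⟨h0, h2⟩
  have hc0 : (0 : ℤ) ≤ c := by exact_mod_cast Nat.zero_le c
  fin_cases k <;> simp [lineLetter] at h0 h2 <;> nlinarith

/-! ## §2 The ray classification on the LINE (letter algebra) -/

/-- THE RAY CLASSIFICATION: if the LINE letter `(c′, k′)` lies `d ≥ 1` null steps above the LINE letter `(c, k)` in direction `r`, then
`r` is the antipode `k + 2` of the lower letter's phase, the charge drops by exactly `d`, and the phase is kept unless the apex is reached.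
(So: up from a charged LINE letter only along its own ray towards `hI`; down from `hI` in all four directions; down from a charged
letter only along its own ray.) [64 cases, `omega`] -/
theorem up_classify {h : ℤ} {c c' : ℕ} {k k' r : Fin 4} {d : ℤ} (hd : 1 ≤ d)
    (e : lineLetter h c' k' = ray (lineLetter h c k) r d) : r = k + 2 ∧ (c : ℤ) = c' + d ∧ (c' = 0 ∨ k' = k) := by
  fin_cases k <;> fin_cases k' <;> fin_cases r <;> simp [lineLetter, ray, Prod.ext_iff] at e ⊢ <;> omega

/-- transport through the `X+` dual (`dualPt 0`: letters negated): `−y = (−x) + d·n_r` iff `x = y + d·n_r`. -/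
theorem of_dual_ray {x y : BPoint} {r : Fin 4} {d : ℤ} (e : dualPt 0 y = ray (dualPt 0 x) r d) : x = ray y r d := by
  obtain ⟨a, b, c⟩ := x
  obtain ⟨a', b', c'⟩ := y
  fin_cases r <;> simp [dualPt, ray, Prod.ext_iff] at e ⊢ <;> omega

/-- the negated LINE letter `(c, k)` is `c` null steps above the negated apex in direction `k + 2`. -/
theorem dual_lineLetter (h : ℤ) (c : ℕ) (k : Fin 4) :
    dualPt 0 (lineLetter h c k) = ray (dualPt 0 (h, 0, 0)) (k + 2) c := by
  fin_cases k <;> simp [dualPt, lineLetter, ray, Prod.ext_iff] <;> ring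

/-- in `Fin 4`: `k + 2 ≠ k`. -/
theorem add_two_ne (k : Fin 4) : k + 2 ≠ k := by
  fin_cases k <;> decide

/-- in `Fin 4`: `k + 1 ≠ k`. -/
theorem add_one_ne (k : Fin 4) : k + 1 ≠ k := by
  fin_cases k <;> decide

/-! ## §3 RULE D on the LINE: the three closed forms -/

/-- **(RD-P) a RULE-D `P`-cell is served above along each charged letter's own ray**: if `P g` is the charged LINE letter `(c, k)`,
some present `N`-cell is `P(g ↦ (c′, k))` with `c′ < c` (`c′ = 0` = the apex). -/
theorem p_up_server {h : ℤ} {C : MConfig} (hlow : ∀ N ∈ C.lower, ∀ f, IsLL h (N f)) {P : MCell} (hPL : ∀ f, IsLL h (P f))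
    (hD : RuleDMu4P C P) {g : Fin 4} {c : ℕ} {k : Fin 4} (hg : P g = lineLetter h c k) (hc : 1 ≤ c) :
    ∃ N ∈ C.lower, ∃ c' : ℕ, c' < c ∧ N = Function.update P g (lineLetter h c' k) := by
  have hjg : g ≠ g + 1 := (add_one_ne g).symm
  obtain ⟨cj, kj, -, hj⟩ := hPL (g + 1)
  have had1 : Adapted (P g) (k + 2) := by rw [hg]; exact (adapted_lineLetter h c k).2
  have had2 : Adapted (P (g + 1)) kj := by rw [hj]; exact (adapted_lineLetter h cj kj).1
  have hne : coord (P g) (k + 2) ≠ coord (P (g + 1)) kj := by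
    rw [hg, hj, (coord_lineLetter h c k).2, (coord_lineLetter h cj kj).1]
    have : (1 : ℤ) ≤ c := by exact_mod_cast hc
    omega
  rcases hD g (g + 1) hjg (k + 2) kj had1 had2 hne with h1 | h2 | h3
  · obtain ⟨r, -, N, hN, hagree, hlt, hray⟩ := h1
    obtain ⟨c', k', -, hNg⟩ := hlow N hN g
    rw [hNg, hg] at hray hlt
    rw [lineLetter_fst, lineLetter_fst] at hlt
    have hd : (1 : ℤ) ≤ (lineLetter h c' k').1 - (lineLetter h c k).1 := by
      rw [lineLetter_fst, lineLetter_fst]; omega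
    obtain ⟨-, -, hk⟩ := up_classify hd hray
    refine ⟨N, hN, c', by omega, ?_⟩
    funext f
    by_cases hf : f = g
    · subst hf
      rw [Function.update_self, hNg]
      rcases hk with h0 | hk
      · subst h0; rw [lineLetter_zero, lineLetter_zero]
      · rw [hk]
    · rw [Function.update_of_ne hf]; exact (hagree f hf).symm
  · obtain ⟨r, hr, N, hN, -, hlt, hray⟩ := h2
    obtain ⟨c', k', -, hNj⟩ := hlow N hN (g + 1)
    rw [hNj, hj] at hray hlt
    have hd : (1 : ℤ) ≤ (lineLetter h c' k').1 - (lineLetter h cj kj).1 := by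
      rw [lineLetter_fst, lineLetter_fst] at hlt ⊢; omega
    obtain ⟨hrk, -, -⟩ := up_classify hd hray
    exact absurd hrk hr
  · obtain ⟨a, b, -, hb, N, hN, -, -, -, hlt, hray⟩ := h3
    obtain ⟨c', k', -, hNj⟩ := hlow N hN (g + 1)
    rw [hNj, hj] at hray hlt
    have hd : (1 : ℤ) ≤ (lineLetter h c' k').1 - (lineLetter h cj kj).1 := by
      rw [lineLetter_fst, lineLetter_fst] at hlt ⊢; omega
    obtain ⟨hbk, -, -⟩ := up_classify hd hray
    rcases hb with hb | ⟨-, hb⟩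
    · exact (add_two_ne kj (hbk ▸ hb)).elim
    · exact (hb hbk).elim

/-- **(RD-N≥2) a RULE-D `N`-cell with two charged letters is served below along each of their own rays**: if `Z g = (c, k)` and `Z j`
are charged (`g ≠ j`), some present `P`-cell is `Z(g ↦ (c′, k))` with `c < c′` (and `2c′ ≤ h`). In particular (T1): `2c = h` is impossible. -/
theorem n_down_server {h : ℤ} {C : MConfig} (hup : ∀ P ∈ C.upper, ∀ f, IsLL h (P f)) {Z : MCell}
    (hD : RuleDMu4N C Z) {g j : Fin 4} (hgj : g ≠ j) {c cj : ℕ} {k kj : Fin 4}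
    (hg : Z g = lineLetter h c k) (hc : 1 ≤ c) (hj : Z j = lineLetter h cj kj) (hcj : 1 ≤ cj) :
    ∃ P ∈ C.upper, ∃ c' : ℕ, c < c' ∧ 2 * (c' : ℤ) ≤ h ∧ P = Function.update Z g (lineLetter h c' k) := by
  have had1 : Adapted (Z g) (k + 2) := by rw [hg]; exact (adapted_lineLetter h c k).2
  have had2 : Adapted (Z j) kj := by rw [hj]; exact (adapted_lineLetter h cj kj).1
  have hne : coord (Z g) (k + 2) ≠ coord (Z j) kj := by
    rw [hg, hj, (coord_lineLetter h c k).2, (coord_lineLetter h cj kj).1]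
    have : (1 : ℤ) ≤ c := by exact_mod_cast hc
    omega
  rcases hD g j hgj (k + 2) kj had1 had2 hne with h1 | h2 | h3
  · obtain ⟨r, -, P, hP, hagree, hlt, hray⟩ := h1
    obtain ⟨c', k', hb, hPg⟩ := hup P hP g
    rw [hPg, hg] at hray hlt
    have hd : (1 : ℤ) ≤ (lineLetter h c k).1 - (lineLetter h c' k').1 := by
      rw [lineLetter_fst, lineLetter_fst] at hlt ⊢; omega
    obtain ⟨-, -, hk⟩ := up_classify hd hray
    rw [lineLetter_fst, lineLetter_fst] at hlt
    refine ⟨P, hP, c', by omega, hb, ?_⟩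
    funext f
    by_cases hf : f = g
    · subst hf
      rw [Function.update_self, hPg]
      rcases hk with h0 | hk
      · omega
      · rw [hk]
    · rw [Function.update_of_ne hf]; exact hagree f hf
  · obtain ⟨r, hr, P, hP, -, hlt, hray⟩ := h2
    obtain ⟨c', k', -, hPj⟩ := hup P hP j
    rw [hPj, hj] at hray hlt
    have hd : (1 : ℤ) ≤ (lineLetter h cj kj).1 - (lineLetter h c' k').1 := by
      rw [lineLetter_fst, lineLetter_fst] at hlt ⊢; omega
    obtain ⟨hrk, -, hk⟩ := up_classify hd hray
    rcases hk with h0 | hk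
    · omega
    · exact (hr (hk ▸ hrk)).elim
  · obtain ⟨a, b, -, hb, P, hP, -, -, -, hlt, hray⟩ := h3
    obtain ⟨c', k', -, hPj⟩ := hup P hP j
    rw [hPj, hj] at hray hlt
    have hd : (1 : ℤ) ≤ (lineLetter h cj kj).1 - (lineLetter h c' k').1 := by
      rw [lineLetter_fst, lineLetter_fst] at hlt ⊢; omega
    obtain ⟨hbk, -, hk⟩ := up_classify hd hray
    have hkk : kj = k' := by
      rcases hk with h0 | hk
      · omega
      · exact hk
    subst hkk
    rcases hb with hb | ⟨-, hb⟩
    · exact (add_two_ne kj (hbk ▸ hb)).elim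
    · exact (hb hbk).elim

/-- **(RD-N1) a RULE-D `N`-cell with a charged letter `(c, k)` on `g` and an apex letter on `j`**, for every direction `k′`: either it is
served below along the own ray of `g`, or some present `P`-cell is `Z(j ↦ (d, p))` with `d ≥ 1` and phase `p ≠ k′`, or some present
`P`-cell is the cover `Z(g ↦ (c′, k), j ↦ (d, p))`, `c < c′`, `d ≥ 1`, `p ≠ k′`. -/
theorem n_hub_alternative {h : ℤ} {C : MConfig} (hup : ∀ P ∈ C.upper, ∀ f, IsLL h (P f)) {Z : MCell} (hZL : ∀ f, IsLL h (Z f))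
    (hD : RuleDMu4N C Z) {g j : Fin 4} (hgj : g ≠ j) {c : ℕ} {k : Fin 4}
    (hg : Z g = lineLetter h c k) (hc : 1 ≤ c) (hja : isApex (Z j)) (k' : Fin 4) :
    (∃ P ∈ C.upper, ∃ c' : ℕ, c < c' ∧ 2 * (c' : ℤ) ≤ h ∧ P = Function.update Z g (lineLetter h c' k)) ∨
    (∃ P ∈ C.upper, ∃ d : ℕ, ∃ p : Fin 4, 1 ≤ d ∧ p ≠ k' ∧ P = Function.update Z j (lineLetter h d p)) ∨
    (∃ P ∈ C.upper, ∃ c' d : ℕ, ∃ p : Fin 4, c < c' ∧ 2 * (c' : ℤ) ≤ h ∧ 1 ≤ d ∧ p ≠ k' ∧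
        P = Function.update (Function.update Z g (lineLetter h c' k)) j (lineLetter h d p)) := by
  obtain ⟨cj, kj, -, hj⟩ := hZL j
  have hcj : cj = 0 := (isApex_lineLetter_iff h cj kj).1 (hj ▸ hja)
  subst hcj
  have had1 : Adapted (Z g) (k + 2) := by rw [hg]; exact (adapted_lineLetter h c k).2
  have had2 : Adapted (Z j) k' := by rw [hj, lineLetter_zero]; fin_cases k' <;> simp [Adapted]
  have hne : coord (Z g) (k + 2) ≠ coord (Z j) k' := by
    rw [hg, hj, (coord_lineLetter h c k).2, lineLetter_zero]
    have : (1 : ℤ) ≤ c := by exact_mod_cast hc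
    have hco : coord ((h, 0, 0) : BPoint) k' = h := by fin_cases k' <;> simp [coord]
    rw [hco]; omega
  rcases hD g j hgj (k + 2) k' had1 had2 hne with h1 | h2 | h3
  · left
    obtain ⟨r, -, P, hP, hagree, hlt, hray⟩ := h1
    obtain ⟨c', k'', hb, hPg⟩ := hup P hP g
    rw [hPg, hg] at hray hlt
    have hd : (1 : ℤ) ≤ (lineLetter h c k).1 - (lineLetter h c' k'').1 := by
      rw [lineLetter_fst, lineLetter_fst] at hlt ⊢; omega
    obtain ⟨-, -, hk⟩ := up_classify hd hray
    rw [lineLetter_fst, lineLetter_fst] at hlt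
    refine ⟨P, hP, c', by omega, hb, ?_⟩
    funext f
    by_cases hf : f = g
    · subst hf
      rw [Function.update_self, hPg]
      rcases hk with h0 | hk
      · omega
      · rw [hk]
    · rw [Function.update_of_ne hf]; exact hagree f hf
  · right; left
    obtain ⟨r, hr, P, hP, hagree, hlt, hray⟩ := h2
    obtain ⟨c', k'', -, hPj⟩ := hup P hP j
    rw [hPj, hj] at hray hlt
    have hd : (1 : ℤ) ≤ (lineLetter h 0 kj).1 - (lineLetter h c' k'').1 := by
      rw [lineLetter_fst, lineLetter_fst] at hlt ⊢; omega
    obtain ⟨hrk, hcc, -⟩ := up_classify hd hray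
    rw [lineLetter_fst, lineLetter_fst] at hlt
    refine ⟨P, hP, c', k'', by omega, ?_, ?_⟩
    · rintro rfl; exact hr hrk
    · funext f
      by_cases hf : f = j
      · subst hf; rw [Function.update_self, hPj]
      · rw [Function.update_of_ne hf]; exact hagree f hf
  · right; right
    obtain ⟨a, b, -, hb, P, hP, hag2, hltg, hrayg, hltj, hrayj⟩ := h3
    obtain ⟨c', kg, hbd, hPg⟩ := hup P hP g
    obtain ⟨d, p, -, hPj⟩ := hup P hP j
    rw [hPg, hg] at hrayg hltg
    rw [hPj, hj] at hrayj hltj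
    have hdg : (1 : ℤ) ≤ (lineLetter h c k).1 - (lineLetter h c' kg).1 := by
      rw [lineLetter_fst, lineLetter_fst] at hltg ⊢; omega
    have hdj : (1 : ℤ) ≤ (lineLetter h 0 kj).1 - (lineLetter h d p).1 := by
      rw [lineLetter_fst, lineLetter_fst] at hltj ⊢; omega
    obtain ⟨-, -, hk⟩ := up_classify hdg hrayg
    obtain ⟨hbp, -, -⟩ := up_classify hdj hrayj
    rw [lineLetter_fst, lineLetter_fst] at hltg hltj
    have hkk : k = kg := by
      rcases hk with h0 | hk
      · omega
      · exact hk
    subst hkk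
    refine ⟨P, hP, c', d, p, by omega, hbd, by omega, ?_, ?_⟩
    · rintro rfl
      rcases hb with hb | ⟨-, hb⟩
      · exact add_two_ne p (hbp ▸ hb)
      · exact hb hbp
    · funext f
      by_cases hfj : f = j
      · subst hfj; rw [Function.update_self, hPj]
      · rw [Function.update_of_ne hfj]
        by_cases hfg : f = g
        · subst hfg; rw [Function.update_self, hPg]
        · rw [Function.update_of_ne hfg]; exact hag2 f hfg hfj

/-! ## §4 `X+` on the LINE: the apex-demand clause fires -/

/-- the negated letters of an `N`-cell of `C`, read back: `P′ g = −(N′ g)` with `N′ = dualCell 0 P′`. -/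
theorem eq_dualPt_dualCell (P' : MCell) (g : Fin 4) : P' g = dualPt 0 (dualCell 0 P' g) :=
  (dualPt_dualPt 0 (P' g)).symm

/-- **(X⁺-LINE) the apex-demand clause FIRES**: a present `P`-cell `P` with charged letter `(c, k)` on `σ` and an apex letter on `f ≠ σ`,
whose hub partner `P(σ ↦ hI)` is a present `N`-cell with no shallower present `N`-cell `P(σ ↦ (c′, k))`, `1 ≤ c′ < c`, on the own ray,
and which has a present SIBLING `P(σ ↦ (e, k″))` of another phase `k″ ≠ k` with no present companion `N`-cell `P(σ ↦ (e′, k″))`,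
`1 ≤ e′ < e`, violates `X+` (the dual-world `X` clause with `u = k + 2`, `w = k″ + 2`: (H-e′) holds letterwise on the LINE, (H-b) and
`W_f = ∅` are vacuous at an apex demand factor). All `N`-letters effective LINE letters. -/
theorem xplus_fires {h : ℤ} {C : MConfig} (hlow : ∀ N ∈ C.lower, ∀ f, IsLL h (N f)) {P : MCell} (hP : P ∈ C.upper)
    {σ f : Fin 4} (hfσ : f ≠ σ) {c : ℕ} {k : Fin 4} (hσ : P σ = lineLetter h c k) (hc : 1 ≤ c) (hPf : P f = (h, 0, 0))
    (hN₀ : Function.update P σ (h, 0, 0) ∈ C.lower)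
    (htop : ∀ c' : ℕ, 1 ≤ c' → c' < c → Function.update P σ (lineLetter h c' k) ∉ C.lower)
    {e : ℕ} {k'' : Fin 4} (hk'' : k'' ≠ k) (he : 1 ≤ e) (hsib : Function.update P σ (lineLetter h e k'') ∈ C.upper)
    (hcomp : ∀ e' : ℕ, 1 ≤ e' → e' < e → Function.update P σ (lineLetter h e' k'') ∉ C.lower) :
    ¬ XPlusClosed C := by
  intro hX
  have hc1 : (1 : ℤ) ≤ c := by exact_mod_cast hc
  have he1 : (1 : ℤ) ≤ e := by exact_mod_cast he
  -- the three cells of the clause, in the dual world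
  have hZσ : dualCell 0 P σ = dualPt 0 (lineLetter h c k) := by simp only [dualCell, hσ]
  have hZf : dualCell 0 P f = dualPt 0 (h, 0, 0) := by simp only [dualCell, hPf]
  have hqσ : dualCell 0 (Function.update P σ ((h, 0, 0) : BPoint)) σ = dualPt 0 (h, 0, 0) := by
    simp only [dualCell, Function.update_self]
  have hqg : ∀ g, g ≠ σ → dualCell 0 (Function.update P σ ((h, 0, 0) : BPoint)) g = dualCell 0 P g := fun g hg => by
    simp only [dualCell, Function.update_of_ne hg]
  have hnσ : dualCell 0 (Function.update P σ (lineLetter h e k'')) σ = dualPt 0 (lineLetter h e k'') := by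
    simp only [dualCell, Function.update_self]
  have hng : ∀ g, g ≠ σ → dualCell 0 (Function.update P σ (lineLetter h e k'')) g = dualCell 0 P g := fun g hg => by
    simp only [dualCell, Function.update_of_ne hg]
  -- a present dual `P`-cell is the negative of a present `N`-cell; if it agrees with `−P` off `σ` it is `−P(σ ↦ its σ-letter)`
  have hback : ∀ P' ∈ (C.dual 0).upper, (∀ g, g ≠ σ → P' g = dualCell 0 P g) →
      ∀ {x : BPoint}, dualCell 0 P' σ = x → Function.update P σ x ∈ C.lower := by
    intro P' hP' hag x hx
    have hmem := mem_dual_upper.mp hP'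
    have : dualCell 0 P' = Function.update P σ x := by
      funext g
      by_cases hg : g = σ
      · subst hg; rw [Function.update_self, hx]
      · rw [Function.update_of_ne hg]
        show dualPt 0 (P' g) = P g
        rw [hag g hg]
        exact dualPt_dualPt 0 (P g)
    rwa [this] at hmem
  apply hX (dualCell 0 P) (dualCell_mem_dual_lower hP) (dualCell 0 (Function.update P σ ((h, 0, 0) : BPoint)))
    (dualCell_mem_dual_upper hN₀) (dualCell 0 (Function.update P σ (lineLetter h e k''))) (dualCell_mem_dual_lower hsib)
    σ (k + 2) (k'' + 2) f
  refine ⟨?_, hfσ, ⟨fun g hg => hqg g hg, ?_, ?_⟩, ?_, fun hkk => hk'' (add_right_cancel hkk), ⟨fun g hg => ?_, ?_, ?_⟩,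
    ?_, ?_, ?_, ?_⟩
  · -- head letter charged
    rw [hZσ]; fin_cases k <;> simp [lineLetter, isApex] <;> omega
  · rw [hqσ, hZσ]; simp [lineLetter]; omega
  · rw [hqσ, hZσ]
    have : (dualPt 0 (lineLetter h c k)).1 - (dualPt 0 ((h, 0, 0) : BPoint)).1 = c := by simp [lineLetter]
    rw [this]; exact dual_lineLetter h c k
  · -- topmost: a present partner strictly between is a shallower own-ray `N`-cell
    intro P' hP' ⟨hag, hlt, hray⟩
    obtain ⟨c', k₁, -, hN'σ⟩ := hlow _ (mem_dual_upper.mp hP') σ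
    have hP'σ : P' σ = dualPt 0 (lineLetter h c' k₁) := by rw [eq_dualPt_dualCell P' σ, hN'σ]
    rw [hP'σ, hqσ]
    rw [hP'σ, hZσ] at hlt hray
    have hD : (dualPt 0 (lineLetter h c k)).1 - (dualPt 0 (lineLetter h c' k₁)).1 = c - c' := by simp [lineLetter]
    rw [hD] at hray
    simp only [lineLetter] at hlt
    have hlt' : (c' : ℤ) < c := by linarith
    obtain ⟨-, -, hk⟩ := up_classify (d := (c : ℤ) - c') (by linarith) (of_dual_ray hray)
    rcases Nat.eq_zero_or_pos c' with h0 | h0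
    · subst h0; simp [lineLetter]
    · exfalso
      rcases hk with h00 | hk
      · omega
      · subst hk
        exact htop c' h0 (by exact_mod_cast hlt') (hback P' hP' (fun g hg => by rw [hag g hg]) hN'σ)
  · rw [hng g hg, hqg g hg]
  · rw [hqσ, hnσ]; simp [lineLetter]; omega
  · rw [hqσ, hnσ]
    have : (dualPt 0 (lineLetter h e k'')).1 - (dualPt 0 ((h, 0, 0) : BPoint)).1 = e := by simp [lineLetter]
    rw [this]; exact dual_lineLetter h e k''
  · -- no companion: a present `w`-companion strictly between is a shallower `N`-cell on the sibling's ray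
    intro P' hP' hag h1 h2 hray
    obtain ⟨c', k₁, -, hN'σ⟩ := hlow _ (mem_dual_upper.mp hP') σ
    have hP'σ : P' σ = dualPt 0 (lineLetter h c' k₁) := by rw [eq_dualPt_dualCell P' σ, hN'σ]
    rw [hP'σ, hqσ] at h1 hray
    rw [hP'σ, hnσ] at h2
    have hD : (dualPt 0 (lineLetter h c' k₁)).1 - (dualPt 0 ((h, 0, 0) : BPoint)).1 = c' := by simp [lineLetter]
    rw [hD, ← lineLetter_zero h 0] at hray
    simp only [lineLetter] at h1 h2
    have h1' : (1 : ℤ) ≤ c' := by linarith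
    have h2' : (c' : ℤ) < e := by linarith
    obtain ⟨hr, -, -⟩ := up_classify h1' (of_dual_ray hray)
    have hk₁ : k₁ = k'' := (add_right_cancel hr).symm
    subst hk₁
    exact hcomp c' (by exact_mod_cast h1') (by exact_mod_cast h2')
      (hback P' hP' (fun g hg => by rw [hag g hg, hqg g hg]) hN'σ)
  · -- (H-e′): letterwise on the LINE
    intro P' hP' _ _ _ _
    obtain ⟨c', k₁, -, hN'σ⟩ := hlow _ (mem_dual_upper.mp hP') σ
    have hP'σ : P' σ = dualPt 0 (lineLetter h c' k₁) := by rw [eq_dualPt_dualCell P' σ, hN'σ]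
    rw [hP'σ, hqσ]
    have h0 : (0 : ℤ) ≤ c' := by exact_mod_cast Nat.zero_le c'
    fin_cases k₁ <;> simp [lineLetter, Effective]
  · -- (H-b): vacuous, nothing lies strictly null-below the negated apex
    intro P' hP' _ hnull _
    exfalso
    obtain ⟨cf, kf, -, hN'f⟩ := hlow _ (mem_dual_upper.mp hP') f
    have hP'f : P' f = dualPt 0 (lineLetter h cf kf) := by rw [eq_dualPt_dualCell P' f, hN'f]
    have := hnull.1
    rw [hP'f, hZf] at this
    simp [lineLetter] at this
    have h0 : (0 : ℤ) ≤ cf := by exact_mod_cast Nat.zero_le cf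
    linarith
  · -- `W_f = ∅`: vacuous likewise
    intro P' hP' hnull
    exfalso
    obtain ⟨cf, kf, -, hN'f⟩ := hlow _ (mem_dual_upper.mp hP') f
    have hP'f : P' f = dualPt 0 (lineLetter h cf kf) := by rw [eq_dualPt_dualCell P' f, hN'f]
    have := hnull.1
    rw [hP'f, hZf] at this
    simp [lineLetter] at this
    have h0 : (0 : ℤ) ≤ cf := by exact_mod_cast Nat.zero_le cf
    linarith

/-! ## §5 The LINE INERTIA THEOREM (sibling-closed supports) and the TOP-LAYER LAW (all supports) -/

/-- a cell is MULTIPLY CHARGED: two distinct factors carry charged (non-apex) letters. -/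
abbrev MultCharged (X : MCell) : Prop := ∃ g j : Fin 4, g ≠ j ∧ ¬ isApex (X g) ∧ ¬ isApex (X j)

/-- **SIBLING-CLOSED** (the only symmetry used): whenever a present `P`-cell has a charged LINE letter `(c, k)` on `σ` and an apex
letter on another factor, the `P`-cell with that letter's phase advanced by one (`(c, k+1)` on `σ`, the rest unchanged) is present.
Implied by invariance under the factorwise phase shifts with `Σ ≡ 0 (mod 4)` (shift `+1` at `σ`, `−1` at the apex factor: the apex
is phase-blind) — control's `G = S₄ × (Σ ≡ 0 shifts) × conj`, the Σ-phase orbit keys of the xres2s orbit stage — and by the full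
phase torus `μ₄⁴`; NOT implied by the diagonal `Δ = (i,i,i,i)` and `S₄` alone. -/
abbrev SibClosed (h : ℤ) (C : MConfig) : Prop :=
  ∀ P ∈ C.upper, ∀ σ f : Fin 4, f ≠ σ → isApex (P f) → ∀ c : ℕ, ∀ k : Fin 4, 1 ≤ c → P σ = lineLetter h c k →
    Function.update P σ (lineLetter h c (k + 1)) ∈ C.upper

/-- **TWO-FACTOR PHASE-SHIFT CLOSED** (`Σ ≡ 0 (mod 4)` shifts, the part used): with every present `P`-cell, the `P`-cell whose `σ`-letter
has its phase advanced by one and whose `f`-letter has its phase retarded by one (charges kept) is present. -/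
abbrev Shift2Closed (h : ℤ) (C : MConfig) : Prop :=
  ∀ P ∈ C.upper, ∀ σ f : Fin 4, f ≠ σ → ∀ cσ cf : ℕ, ∀ kσ kf : Fin 4, P σ = lineLetter h cσ kσ → P f = lineLetter h cf kf →
    Function.update (Function.update P σ (lineLetter h cσ (kσ + 1))) f (lineLetter h cf (kf + 3)) ∈ C.upper

/-- two-factor phase-shift closure implies sibling closure (the apex letter is phase-blind). -/
theorem shift2Closed_sibClosed {h : ℤ} {C : MConfig} (hC : LSupport h C) (h2 : Shift2Closed h C) : SibClosed h C := by
  intro P hP σ f hfσ hfa c k _ hPσ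
  obtain ⟨cf, kf, -, hPf⟩ := hC.2 P hP f
  have hcf : cf = 0 := (isApex_lineLetter_iff h cf kf).1 (hPf ▸ hfa)
  subst hcf
  have := h2 P hP σ f hfσ c 0 k kf hPσ hPf
  have heq : Function.update (Function.update P σ (lineLetter h c (k + 1))) f (lineLetter h 0 (kf + 3)) =
      Function.update P σ (lineLetter h c (k + 1)) := by
    rw [lineLetter_zero, ← lineLetter_zero h kf, ← hPf]
    exact Function.update_eq_self_iff.mpr (by rw [Function.update_of_ne hfσ])
  rwa [heq] at this

/-- the lowest `α` among the four letters of a cell (on the LINE: `h −` its largest charge) — the CONTROLLING QUANTITY. -/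
def lowA (X : MCell) : ℤ := Finset.univ.inf' Finset.univ_nonempty fun f => (X f).1

theorem lowA_le (X : MCell) (f : Fin 4) : lowA X ≤ (X f).1 :=
  Finset.inf'_le (fun f => (X f).1) (Finset.mem_univ f)

theorem exists_lowA_eq (X : MCell) : ∃ s : Fin 4, lowA X = (X s).1 := by
  obtain ⟨s, -, hs⟩ := Finset.exists_mem_eq_inf' Finset.univ_nonempty (fun f => (X f).1)
  exact ⟨s, hs⟩

/-- any two factors leave a third. -/
theorem exists_third (s g : Fin 4) : ∃ f : Fin 4, f ≠ s ∧ f ≠ g := by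
  revert s g; decide

/-- the minimal-`α` factor of a multiply charged LINE cell carries a charged letter, and another factor is charged too. -/
theorem lowA_slot {h : ℤ} {X : MCell} (hXL : ∀ f, IsLL h (X f)) (hm : MultCharged X) :
    ∃ s g : Fin 4, ∃ a b : ℕ, ∃ u κ : Fin 4, g ≠ s ∧ lowA X = (X s).1 ∧ X s = lineLetter h a u ∧ 1 ≤ a ∧
      X g = lineLetter h b κ ∧ 1 ≤ b := by
  obtain ⟨s, hs⟩ := exists_lowA_eq X
  obtain ⟨g₁, g₂, h12, hg₁, hg₂⟩ := hm
  -- a charged factor other than `s`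
  obtain ⟨g, hgs, hg⟩ : ∃ g : Fin 4, g ≠ s ∧ ¬ isApex (X g) := by
    by_cases h1 : g₁ = s
    · exact ⟨g₂, fun e => h12 (h1.trans e.symm), hg₂⟩
    · exact ⟨g₁, h1, hg₁⟩
  obtain ⟨a, u, -, hXs⟩ := hXL s
  obtain ⟨b, κ, -, hXg⟩ := hXL g
  have hb : 1 ≤ b := by
    rcases Nat.eq_zero_or_pos b with h0 | h0
    · subst h0; exact absurd ((isApex_lineLetter_iff h 0 κ).2 rfl) (hXg ▸ hg)
    · exact h0
  have ha : 1 ≤ a := by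
    rcases Nat.eq_zero_or_pos a with h0 | h0
    · exfalso
      subst h0
      have h1 := lowA_le X g
      rw [hs, hXs, hXg, lineLetter_fst, lineLetter_fst] at h1
      have : (1 : ℤ) ≤ b := by exact_mod_cast hb
      push_cast at h1; linarith
    · exact h0
  exact ⟨s, g, a, b, u, κ, hgs, hs, hXs, ha, hXg, hb⟩

/-- **THE LINE INERTIA THEOREM.** In a RULE-D-closed, `X+`-closed, sibling-closed configuration of effective LINE-`h` cells NO CELL IS
MULTIPLY CHARGED: every cell, on both levels, has at most one charged letter. (All `h`; no (H1), no capacity, no Hall condition, no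
multiplicities.) Proof: a multiply charged cell of lowest `α` is a `P`-cell (an `N`-cell is served strictly below along its lowest letter's
own ray by (RD-N≥2)); its other charged letter is served above by (RD-P), necessarily by the hub `P(g ↦ hI)` (anything shallower is a
multiply charged `N`-cell at the same `α`); the phase-rotated sibling is present; the apex-demand `X+` clause fires (§4). -/
theorem line_inertia {h : ℤ} {C : MConfig} (hC : LSupport h C) (hD : RuleDMu4Closed C) (hX : XPlusClosed C)
    (hS : SibClosed h C) : ∀ X ∈ C.lower ∪ C.upper, ¬ MultCharged X := by
  classical
  by_contra hcon
  push Not at hcon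
  set M := (C.lower ∪ C.upper).filter fun X => MultCharged X with hM
  have hMne : M.Nonempty := by
    obtain ⟨X, hXm, hm⟩ := hcon
    exact ⟨X, Finset.mem_filter.mpr ⟨hXm, hm⟩⟩
  obtain ⟨X, hXM, hmin⟩ := M.exists_min_image lowA hMne
  obtain ⟨hXC, hXm⟩ := Finset.mem_filter.mp hXM
  -- (K) below every multiply charged `N`-cell lies a multiply charged `P`-cell of smaller `α`
  have K : ∀ Y ∈ C.lower, MultCharged Y → ∃ P' ∈ C.upper, MultCharged P' ∧ lowA P' < lowA Y := by
    intro Y hY hYm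
    obtain ⟨s, g, a, b, u, κ, hgs, hs, hYs, ha, hYg, hb⟩ := lowA_slot (hC.1 Y hY) hYm
    obtain ⟨P', hP', c', hac, -, hP'eq⟩ := n_down_server hC.2 (hD.1 Y hY) hgs.symm hYs ha hYg hb
    refine ⟨P', hP', ⟨s, g, hgs.symm, ?_, ?_⟩, ?_⟩
    · rw [hP'eq, Function.update_self, isApex_lineLetter_iff]; omega
    · rw [hP'eq, Function.update_of_ne hgs, hYg, isApex_lineLetter_iff]; omega
    · have h1 := lowA_le P' s
      have hP's : (P' s).1 = h - c' := by rw [hP'eq, Function.update_self, lineLetter_fst]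
      rw [hP's] at h1
      rw [hs, hYs, lineLetter_fst]
      have : (a : ℤ) < c' := by exact_mod_cast hac
      linarith
  -- (**) hence every multiply charged `N`-cell has `α` strictly above the minimum, and the minimiser is a `P`-cell
  have hNC : ∀ Y ∈ C.lower, MultCharged Y → lowA X < lowA Y := by
    intro Y hY hYm
    obtain ⟨P', hP', hP'm, hlt⟩ := K Y hY hYm
    exact lt_of_le_of_lt (hmin P' (Finset.mem_filter.mpr ⟨Finset.mem_union_right _ hP', hP'm⟩)) hlt
  have hXP : X ∈ C.upper := by
    rcases Finset.mem_union.mp hXC with hl | hu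
    · exact absurd (hNC X hl hXm) (lt_irrefl _)
    · exact hu
  -- the minimiser `P = X`: lowest letter `(a, u)` on `s`, another charged letter `(b, κ)` on `g`
  obtain ⟨s, g, a, b, u, κ, hgs, hs, hPs, ha, hPg, hb⟩ := lowA_slot (hC.2 X hXP) hXm
  -- no `N`-cell `X(g ↦ charged)` is present (it would be multiply charged at the same `α`)
  have hnoN : ∀ c' : ℕ, ∀ κ' : Fin 4, 1 ≤ c' → Function.update X g (lineLetter h c' κ') ∉ C.lower := by
    intro c' κ' hc' hmem
    have hm' : MultCharged (Function.update X g (lineLetter h c' κ')) := by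
      refine ⟨s, g, hgs.symm, ?_, ?_⟩
      · rw [Function.update_of_ne hgs.symm, hPs, isApex_lineLetter_iff]; omega
      · rw [Function.update_self, isApex_lineLetter_iff]; omega
    have h1 := hNC _ hmem hm'
    have h2 := lowA_le (Function.update X g (lineLetter h c' κ')) s
    rw [Function.update_of_ne hgs.symm] at h2
    rw [hs] at h1
    exact absurd (lt_of_lt_of_le h1 h2) (lt_irrefl _)
  -- (RD-P) on `g`: the up-server is the hub `X(g ↦ hI)`
  obtain ⟨N, hN, b', hb', hNeq⟩ := p_up_server hC.1 (hC.2 X hXP) (hD.2 X hXP) hPg hb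
  have hb'0 : b' = 0 := by
    rcases Nat.eq_zero_or_pos b' with h0 | h0
    · exact h0
    · exact absurd (hNeq ▸ hN) (hnoN b' κ h0)
  subst hb'0
  rw [lineLetter_zero] at hNeq
  have hN₀ : Function.update X g ((h, 0, 0) : BPoint) ∈ C.lower := hNeq ▸ hN
  -- every other factor of `X` is an apex letter (else the hub is multiply charged at the same `α`)
  have hapex : ∀ f, f ≠ s → f ≠ g → isApex (X f) := by
    intro f hfs hfg
    by_contra hf
    have hm' : MultCharged (Function.update X g ((h, 0, 0) : BPoint)) := by
      refine ⟨s, f, fun e => hfs e.symm, ?_, ?_⟩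
      · rw [Function.update_of_ne hgs.symm, hPs, isApex_lineLetter_iff]; omega
      · rw [Function.update_of_ne hfg]; exact hf
    have h1 := hNC _ hN₀ hm'
    have h2 := lowA_le (Function.update X g ((h, 0, 0) : BPoint)) s
    rw [Function.update_of_ne hgs.symm] at h2
    rw [hs] at h1
    exact absurd (lt_of_lt_of_le h1 h2) (lt_irrefl _)
  obtain ⟨f, hfs, hfg⟩ := exists_third s g
  have hXf : X f = (h, 0, 0) := by
    obtain ⟨cf, kf, -, e1⟩ := hC.2 X hXP f
    have := (isApex_lineLetter_iff h cf kf).1 (e1 ▸ hapex f hfs hfg)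
    subst this; rw [e1, lineLetter_zero]
  -- the sibling of the advanced phase is present; the apex-demand clause fires
  have hsib := hS X hXP g f hfg (hapex f hfs hfg) b κ hb hPg
  exact xplus_fires hC.1 hXP hfg hPg hb hXf hN₀ (fun c' hc' _ => hnoN c' κ hc') (add_one_ne κ) hb hsib
    (fun e' he' _ => hnoN e' (κ + 1) he') hX

/-- **THE TOP-LAYER LAW** (no symmetry assumed; `h = 2n`, `n ≥ 1`). In a RULE-D-closed, `X+`-closed configuration of effective LINE-`2n`
cells: (b) a `P`-cell carrying a letter of the top charge `n` (a pure ray `n·ℓ_u`) has apex letters on all other factors, and (a) NO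
`N`-cell carries a letter of charge `n` at all. ((RD-N≥2) forbids a second charged letter next to a top letter on an `N`-cell — the memo's
ROUND-1 LAW (T1); a top-charged `P`-cell's second letter is hub-served by (RD-P), the hub is served only through (RD-N1)'s middle
alternative — two phases below the apex factor — and then the apex-demand `X+` clause fires on one of them.) -/
theorem top_layer {n : ℕ} (hn : 1 ≤ n) {C : MConfig} (hC : LSupport (2 * n) C) (hD : RuleDMu4Closed C) (hX : XPlusClosed C) :
    (∀ Z ∈ C.lower, ∀ s u : Fin 4, Z s ≠ lineLetter (2 * n) n u) ∧
    (∀ P ∈ C.upper, ∀ s g u : Fin 4, g ≠ s → P s = lineLetter (2 * n) n u → isApex (P g)) := by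
  -- Step A: an `N`-cell with a top letter has no other charged letter
  have stepA : ∀ Z ∈ C.lower, ∀ s g u : Fin 4, g ≠ s → Z s = lineLetter (2 * n) n u → isApex (Z g) := by
    intro Z hZ s g u hgs hZs
    by_contra hga
    obtain ⟨b, κ, -, hZg⟩ := hC.1 Z hZ g
    have hb : 1 ≤ b := by
      rcases Nat.eq_zero_or_pos b with h0 | h0
      · subst h0; exact absurd ((isApex_lineLetter_iff _ 0 κ).2 rfl) (hZg ▸ hga)
      · exact h0
    obtain ⟨P', -, c', hc', hbd, -⟩ := n_down_server hC.2 (hD.1 Z hZ) hgs.symm hZs hn hZg hb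
    omega
  -- Step B: a `P`-cell with a top letter has no other charged letter
  have stepB : ∀ P ∈ C.upper, ∀ s g u : Fin 4, g ≠ s → P s = lineLetter (2 * n) n u → isApex (P g) := by
    intro P hP s g u hgs hPs
    by_contra hga
    obtain ⟨b, κ, -, hPg⟩ := hC.2 P hP g
    have hb : 1 ≤ b := by
      rcases Nat.eq_zero_or_pos b with h0 | h0
      · subst h0; exact absurd ((isApex_lineLetter_iff _ 0 κ).2 rfl) (hPg ▸ hga)
      · exact h0
    -- no `N`-cell `P(g ↦ charged)` (Step A)
    have hnoN : ∀ c' : ℕ, ∀ κ' : Fin 4, 1 ≤ c' → Function.update P g (lineLetter (2 * n) c' κ') ∉ C.lower := by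
      intro c' κ' hc' hmem
      have := stepA _ hmem s g u hgs (by rw [Function.update_of_ne hgs.symm, hPs])
      rw [Function.update_self, isApex_lineLetter_iff] at this
      omega
    obtain ⟨N, hN, b', hb', hNeq⟩ := p_up_server hC.1 (hC.2 P hP) (hD.2 P hP) hPg hb
    have hb'0 : b' = 0 := by
      rcases Nat.eq_zero_or_pos b' with h0 | h0
      · exact h0
      · exact absurd (hNeq ▸ hN) (hnoN b' κ h0)
    subst hb'0
    rw [lineLetter_zero] at hNeq
    have hN₀ : Function.update P g (((2 * n : ℕ) : ℤ), 0, 0) ∈ C.lower := by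
      have : ((2 * n : ℕ) : ℤ) = 2 * (n : ℤ) := by push_cast; ring
      rw [this]; exact hNeq ▸ hN
    have hN₀' : Function.update P g ((2 * (n : ℤ)), 0, 0) ∈ C.lower := hNeq ▸ hN
    have hapex : ∀ f, f ≠ s → f ≠ g → isApex (P f) := by
      intro f hfs hfg
      have := stepA _ hN₀' s f u hfs (by rw [Function.update_of_ne hgs.symm, hPs])
      rwa [Function.update_of_ne hfg] at this
    obtain ⟨f, hfs, hfg⟩ := exists_third s g
    have hPf : P f = (2 * (n : ℤ), 0, 0) := by
      obtain ⟨cf, kf, -, e1⟩ := hC.2 P hP f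
      have := (isApex_lineLetter_iff _ cf kf).1 (e1 ▸ hapex f hfs hfg)
      subst this; rw [e1, lineLetter_zero]
    -- the hub's RULE D: only the middle alternative is available
    have hZL : ∀ f', IsLL (2 * (n : ℤ)) (Function.update P g ((2 * (n : ℤ)), 0, 0) f') := hC.1 _ hN₀'
    rcases n_hub_alternative hC.2 hZL (hD.1 _ hN₀') hgs.symm (c := n) (k := u)
        (by rw [Function.update_of_ne hgs.symm, hPs]) hn (by rw [Function.update_self]; exact ⟨rfl, rfl⟩) κ with
      ⟨P', -, c', hc', hbd, -⟩ | ⟨P₂, hP₂, d, p, hd, hp, hP₂eq⟩ | ⟨P', -, c', d, p, hc', hbd, -, -, -⟩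
    · omega
    · rw [Function.update_idem] at hP₂eq
      exact xplus_fires hC.1 hP hfg hPg hb hPf hN₀' (fun c' hc' _ => hnoN c' κ hc') hp hd (hP₂eq ▸ hP₂)
        (fun e' he' _ => hnoN e' p he') hX
    · omega
  refine ⟨?_, stepB⟩
  -- Step C: an `N`-cell with a top letter is a hub, served only by a top-charged `P`-cell with a second charged letter — excluded by Step B
  intro Z hZ s u hZs
  obtain ⟨g, hgs, -⟩ := exists_third s s
  have hZL : ∀ f, IsLL (2 * (n : ℤ)) (Z f) := hC.1 Z hZ
  rcases n_hub_alternative hC.2 hZL (hD.1 Z hZ) hgs.symm hZs hn (stepA Z hZ s g u hgs hZs) 0 with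
    ⟨P', -, c', hc', hbd, -⟩ | ⟨P₂, hP₂, d, p, hd, -, hP₂eq⟩ | ⟨P', -, c', d, p, hc', hbd, -, -, -⟩
  · omega
  · have := stepB P₂ hP₂ s g u hgs (by rw [hP₂eq, Function.update_of_ne hgs.symm, hZs])
    rw [hP₂eq, Function.update_self, isApex_lineLetter_iff] at this
    omega
  · omega

/-! ## §6 Consequences: `Π_f β_f = 0` on every cell, so the `eeee`-coefficient `μ` of every weighted design vanishes -/

/-- a cell that is not multiply charged has an apex letter, so `Π_f β_f = 0`. -/
theorem prod_betaG_eq_zero {X : MCell} (hX : ¬ MultCharged X) : ∏ f, betaG X f = 0 := by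
  have h01 : isApex (X 0) ∨ isApex (X 1) := by
    by_contra hno
    push Not at hno
    exact hX ⟨0, 1, by decide, hno.1, hno.2⟩
  obtain ⟨f₀, hf₀⟩ : ∃ f₀ : Fin 4, isApex (X f₀) := by
    rcases h01 with h0 | h1
    · exact ⟨0, h0⟩
    · exact ⟨1, h1⟩
  apply Finset.prod_eq_zero (Finset.mem_univ f₀)
  rw [betaG, hf₀.1, hf₀.2]; rfl

/-- **μ = 0 FOR EVERY DESIGN on an inert LINE support**: the `eeee`-coefficient of the weighted class tensor
(`Pad4TowerPsiSubA1.MConfig.wch`, any integer multiplicities) vanishes. -/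
theorem wch_eWord_eq_zero {h : ℤ} {C : MConfig} (hC : LSupport h C) (hD : RuleDMu4Closed C) (hX : XPlusClosed C)
    (hS : SibClosed h C) (mN mP : MCell → ℤ) : C.wch mN mP eWord = 0 := by
  have hin := line_inertia hC hD hX hS
  have hl : ∀ Z ∈ C.lower, (mN Z • Z.ch) eWord = 0 := fun Z hZ => by
    rw [Pi.smul_apply, ch_eWord, prod_betaG_eq_zero (hin Z (Finset.mem_union_left _ hZ)), smul_zero]
  have hu : ∀ P ∈ C.upper, (mP P • P.ch) eWord = 0 := fun P hP => by
    rw [Pi.smul_apply, ch_eWord, prod_betaG_eq_zero (hin P (Finset.mem_union_right _ hP)), smul_zero]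
  simp only [MConfig.wch, Pi.sub_apply, Finset.sum_apply, Finset.sum_eq_zero hl, Finset.sum_eq_zero hu, sub_zero]

/-! ## §8 The other three families are VACUOUS on the LINE; phase-pure LINE supports are `X+`-closed -/

/-- the encoder charge of a LINE letter is its charge. -/
theorem cabs_lineLetter (h : ℤ) (c : ℕ) (k : Fin 4) : cabs (lineLetter h c k) = c := by
  have hc : |(c : ℤ)| = c := abs_of_nonneg (by positivity)
  fin_cases k <;> simp [lineLetter, cabs, hc]

/-- the encoder direction of an effective charged LINE letter `(c, k)` is `k` (its own ray from the node). -/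
theorem encDir_lineLetter {h : ℤ} {c : ℕ} {k u : Fin 4} (hch : 2 * (c : ℤ) ≤ h) (hc : 1 ≤ c)
    (hE : EncDir (lineLetter h c k) u) : u = k := by
  have hcab := cabs_lineLetter h c k
  rcases hE with ⟨-, e⟩ | ⟨hneg, -⟩
  · rw [hcab] at e
    fin_cases k <;> fin_cases u <;> simp [lineLetter, ray, Prod.ext_iff] at e ⊢ <;> omega
  · simp [lineLetter] at hneg; omega

/-- … and of its `X+`-dual (negated) letter it is `k` as well (the dual branch of `EncDir`). -/
theorem encDir_dual_lineLetter {h : ℤ} {c : ℕ} {k u : Fin 4} (hch : 2 * (c : ℤ) ≤ h) (hc : 1 ≤ c)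
    (hE : EncDir (dualPt 0 (lineLetter h c k)) u) : u = k := by
  have hcab : cabs (dualPt 0 (lineLetter h c k)) = c := by
    have hc' : |(c : ℤ)| = c := abs_of_nonneg (by positivity)
    fin_cases k <;> simp [lineLetter, cabs, hc']
  rcases hE with ⟨h0, -⟩ | ⟨-, e⟩
  · simp [lineLetter] at h0; omega
  · rw [hcab] at e
    fin_cases k <;> fin_cases u <;> simp [lineLetter, ray, dualPt, Prod.ext_iff] at e ⊢ <;> omega

/-- **`X−` IS VACUOUS ON THE LINE**: below a LINE letter every partner lies on its own ray, so a topmost partner has no sibling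
direction `w ≠ u` — no `X−` clause fires on a LINE support (no RULE D needed). -/
theorem xminus_vacuous {h : ℤ} {C : MConfig} (hC : LSupport h C) : XMinusClosed C := by
  intro Z hZ q hq n hn σ u w f hF
  obtain ⟨-, -, ⟨-, hlt, hray⟩, -, hwu, ⟨-, hlt', hray'⟩, -⟩ := hF
  obtain ⟨cZ, kZ, -, hZσ⟩ := hC.1 Z hZ σ
  obtain ⟨cq, kq, -, hqσ⟩ := hC.2 q hq σ
  obtain ⟨cn, kn, -, hnσ⟩ := hC.1 n hn σ
  rw [hZσ, hqσ] at hray hlt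
  rw [hnσ, hqσ] at hray' hlt'
  have h1 := (up_classify (by omega) hray).1
  have h2 := (up_classify (by omega) hray').1
  exact hwu (h2.trans h1.symm)

/-- **`A2I−` IS VACUOUS ON THE LINE**: the encoder direction of a charged LINE letter is its own ray `k`, along which the letters
below it are NOT on the LINE (they run into the diamond towards the node); its LINE partners lie in direction `k + 2`. -/
theorem a2iMinus_vacuous {h : ℤ} {C : MConfig} (hC : LSupport h C) : A2IMinusClosed C := by
  intro Z hZ q hq N' hN' σ u f' v hF
  obtain ⟨hna, hE, ⟨-, hlt, hray⟩, -⟩ := hF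
  obtain ⟨cZ, kZ, hcZ, hZσ⟩ := hC.1 Z hZ σ
  obtain ⟨cq, kq, -, hqσ⟩ := hC.2 q hq σ
  have hc : 1 ≤ cZ := by
    by_contra h0
    exact hna (hZσ ▸ (isApex_lineLetter_iff h cZ kZ).2 (by omega))
  rw [hZσ] at hE hray hlt
  rw [hqσ] at hray hlt
  have hu := encDir_lineLetter hcZ hc hE
  obtain ⟨h1, -, h3⟩ := up_classify (by omega) hray
  rcases h3 with h3 | h3
  · omega
  · rw [hu, h3] at h1; exact add_two_ne kq h1.symm

/-- **`A2I+` IS VACUOUS ON THE LINE**: dually, above a charged LINE letter along its own ray `k` there is nothing effective. -/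
theorem a2iPlus_vacuous {h : ℤ} {C : MConfig} (hC : LSupport h C) : A2IPlusClosed C := by
  intro Z hZ q hq N' hN' σ u f' v hF
  obtain ⟨hna, hE, hZq, -⟩ := hF
  have hP : dualCell 0 Z ∈ C.upper := mem_dual_lower.mp hZ
  have hN : dualCell 0 q ∈ C.lower := mem_dual_upper.mp hq
  obtain ⟨cP, kP, hcP, hPσ⟩ := hC.2 _ hP σ
  obtain ⟨cN, kN, -, hNσ⟩ := hC.1 _ hN σ
  have hZσ : Z σ = dualPt 0 (lineLetter h cP kP) := by rw [← hPσ]; exact eq_dualPt_dualCell Z σ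
  have hc : 1 ≤ cP := by
    by_contra h0
    exact hna (hZσ ▸ (isApex_dual 0 _).2 ((isApex_lineLetter_iff h cP kP).2 (by omega)))
  rw [hZσ] at hE
  have hu := encDir_dual_lineLetter hcP hc hE
  rw [← dualCell_dualCell 0 Z, ← dualCell_dualCell 0 q] at hZq
  obtain ⟨-, hlt, hray⟩ := (uPartner_dual 0 _ _ σ u).mp hZq
  simp only [dualCell] at hlt hray
  change (dualCell 0 Z σ).1 < (dualCell 0 q σ).1 at hlt
  change dualCell 0 q σ = ray (dualCell 0 Z σ) u ((dualCell 0 q σ).1 - (dualCell 0 Z σ).1) at hray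
  rw [hPσ, hNσ] at hlt hray
  have h1 := (up_classify (by omega) hray).1
  rw [hu] at h1
  exact add_two_ne kP h1.symm

/-- hence ON THE LINE the four instance families reduce to `X+` alone. -/
theorem xresFour_iff_xplus {h : ℤ} {C : MConfig} (hC : LSupport h C) : XresFourClosed C ↔ XPlusClosed C :=
  ⟨fun h4 => h4.2.1, fun hx => ⟨xminus_vacuous hC, hx, a2iMinus_vacuous hC, a2iPlus_vacuous hC⟩⟩

/-- **PHASE-PURE LINE SUPPORTS ARE `X+`-CLOSED** (no RULE D needed): an `X+` clause needs, over one `N`-letter, a head `(c, k)` and a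
sibling head `(e, k″)` with `k″ ≠ k` — two phases. -/
theorem xplus_of_phasePure {h : ℤ} {C : MConfig} (hC : LSupport h C) {k₀ : Fin 4}
    (hpure : ∀ X ∈ C.lower ∪ C.upper, ∀ f, ∀ c : ℕ, ∀ k : Fin 4, X f = lineLetter h c k → 1 ≤ c → k = k₀) :
    XPlusClosed C := by
  intro Z hZ q hq n hn σ u w f hF
  obtain ⟨hna, -, hZq, -, hwu, hsib, -⟩ := hF
  have hP : dualCell 0 Z ∈ C.upper := mem_dual_lower.mp hZ
  have hN : dualCell 0 q ∈ C.lower := mem_dual_upper.mp hq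
  have hP' : dualCell 0 n ∈ C.upper := mem_dual_lower.mp hn
  obtain ⟨cP, kP, hcP, hPσ⟩ := hC.2 _ hP σ
  obtain ⟨cN, kN, -, hNσ⟩ := hC.1 _ hN σ
  obtain ⟨cP', kP', hcP', hP'σ⟩ := hC.2 _ hP' σ
  have hZσ : Z σ = dualPt 0 (lineLetter h cP kP) := by rw [← hPσ]; exact eq_dualPt_dualCell Z σ
  have hc : 1 ≤ cP := by
    by_contra h0
    exact hna (hZσ ▸ (isApex_dual 0 _).2 ((isApex_lineLetter_iff h cP kP).2 (by omega)))
  -- the partner: `N σ = P σ + d·n_u`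
  rw [← dualCell_dualCell 0 Z, ← dualCell_dualCell 0 q] at hZq
  obtain ⟨-, hlt, hray⟩ := (uPartner_dual 0 _ _ σ u).mp hZq
  simp only [dualCell] at hlt hray
  change (dualCell 0 Z σ).1 < (dualCell 0 q σ).1 at hlt
  change dualCell 0 q σ = ray (dualCell 0 Z σ) u ((dualCell 0 q σ).1 - (dualCell 0 Z σ).1) at hray
  rw [hPσ, hNσ] at hlt hray
  obtain ⟨hu, -, h3⟩ := up_classify (by omega) hray
  have hkP : kP = k₀ := hpure _ (Finset.mem_union_right _ hP) σ cP kP hPσ hc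
  -- the sibling: `N σ = P′ σ + e·n_w`
  obtain ⟨-, hlt', hray'⟩ := hsib
  have hqσ : q σ = dualPt 0 (lineLetter h cN kN) := by rw [← hNσ]; exact eq_dualPt_dualCell q σ
  have hnσ : n σ = dualPt 0 (lineLetter h cP' kP') := by rw [← hP'σ]; exact eq_dualPt_dualCell n σ
  rw [hqσ, hnσ] at hlt' hray'
  obtain ⟨hlt'', hray''⟩ := (ray_dual_iff 0 (lineLetter h cN kN) (lineLetter h cP' kP') w).mp ⟨hlt', hray'⟩
  obtain ⟨hw, h2', -⟩ := up_classify (by omega) hray''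
  have hc' : 1 ≤ cP' := by omega
  have hkP' : kP' = k₀ := hpure _ (Finset.mem_union_right _ hP') σ cP' kP' hP'σ hc'
  apply hwu; rw [hw, hu, hkP, hkP']

/-- **CELLWISE PHASE-PURE LINE SUPPORTS WITHOUT THE BARE HUB ARE `X+`-CLOSED**: if every cell's charged letters share one phase (the
phase may vary from cell to cell) and the all-apex `N`-cell `N(apex⁴)` is absent, no `X+` clause fires — the two heads of a fork share the
hub's other three letters, so a charged one among them forces equal phases, and otherwise the hub is `N(apex⁴)`. -/
theorem xplus_of_cellwisePure {h : ℤ} {C : MConfig} (hC : LSupport h C)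
    (hcw : ∀ X ∈ C.lower ∪ C.upper, ∀ f g : Fin 4, ∀ c c' : ℕ, ∀ k k' : Fin 4,
      X f = lineLetter h c k → X g = lineLetter h c' k' → 1 ≤ c → 1 ≤ c' → k = k')
    (hbare : ∀ N ∈ C.lower, ∃ f, ¬ isApex (N f)) : XPlusClosed C := by
  intro Z hZ q hq n hn σ u w f hF
  obtain ⟨hna, -, hZq, -, hwu, hsib, -⟩ := hF
  have hP : dualCell 0 Z ∈ C.upper := mem_dual_lower.mp hZ
  have hN : dualCell 0 q ∈ C.lower := mem_dual_upper.mp hq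
  have hP' : dualCell 0 n ∈ C.upper := mem_dual_lower.mp hn
  obtain ⟨cP, kP, hcP, hPσ⟩ := hC.2 _ hP σ
  obtain ⟨cN, kN, -, hNσ⟩ := hC.1 _ hN σ
  obtain ⟨cP', kP', hcP', hP'σ⟩ := hC.2 _ hP' σ
  have hZσ : Z σ = dualPt 0 (lineLetter h cP kP) := by rw [← hPσ]; exact eq_dualPt_dualCell Z σ
  have hc : 1 ≤ cP := by
    by_contra h0
    exact hna (hZσ ▸ (isApex_dual 0 _).2 ((isApex_lineLetter_iff h cP kP).2 (by omega)))
  rw [← dualCell_dualCell 0 Z, ← dualCell_dualCell 0 q] at hZq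
  obtain ⟨hagP, hlt, hray⟩ := (uPartner_dual 0 _ _ σ u).mp hZq
  simp only [dualCell] at hlt hray
  change (dualCell 0 Z σ).1 < (dualCell 0 q σ).1 at hlt
  change dualCell 0 q σ = ray (dualCell 0 Z σ) u ((dualCell 0 q σ).1 - (dualCell 0 Z σ).1) at hray
  rw [hPσ, hNσ] at hlt hray
  obtain ⟨hu, -, h3⟩ := up_classify (by omega) hray
  obtain ⟨hagn, hlt', hray'⟩ := hsib
  have hqσ : q σ = dualPt 0 (lineLetter h cN kN) := by rw [← hNσ]; exact eq_dualPt_dualCell q σ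
  have hnσ : n σ = dualPt 0 (lineLetter h cP' kP') := by rw [← hP'σ]; exact eq_dualPt_dualCell n σ
  rw [hqσ, hnσ] at hlt' hray'
  obtain ⟨hlt'', hray''⟩ := (ray_dual_iff 0 (lineLetter h cN kN) (lineLetter h cP' kP') w).mp ⟨hlt', hray'⟩
  obtain ⟨hw, h2', h3'⟩ := up_classify (by omega) hray''
  have hc' : 1 ≤ cP' := by omega
  have hkk : kP ≠ kP' := fun e => hwu (by rw [hw, hu, e])
  -- the hub's other letters: `P g = N₀ g = P′ g` off `σ`
  have hPN : ∀ g, g ≠ σ → dualCell 0 Z g = dualCell 0 q g := fun g hg => by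
    have := hagP g hg
    simpa [dualCell, dualCell_dualCell] using this
  have hP'N : ∀ g, g ≠ σ → dualCell 0 n g = dualCell 0 q g := fun g hg => by
    have := hagn g hg
    show dualPt 0 (n g) = dualPt 0 (q g)
    rw [this]
  obtain ⟨g, hg⟩ := hbare _ hN
  by_cases hgs : g = σ
  · subst hgs
    have hcN : 1 ≤ cN := by
      by_contra h0
      exact hg (hNσ ▸ (isApex_lineLetter_iff h cN kN).2 (by omega))
    rcases h3 with h3 | h3
    · omega
    rcases h3' with h3' | h3'
    · omega
    exact hkk (h3.symm.trans h3')
  · obtain ⟨cg, kg, -, hNg⟩ := hC.1 _ hN g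
    have hcg : 1 ≤ cg := by
      by_contra h0
      exact hg (hNg ▸ (isApex_lineLetter_iff h cg kg).2 (by omega))
    have e1 : kP = kg :=
      hcw _ (Finset.mem_union_right _ hP) σ g cP cg kP kg hPσ ((hPN g hgs).trans hNg) hc hcg
    have e2 : kP' = kg :=
      hcw _ (Finset.mem_union_right _ hP') σ g cP' cg kP' kg hP'σ ((hP'N g hgs).trans hNg) hc' hcg
    exact hkk (e1.trans e2.symm)

/-! ## §7 Probes (`decide`, `h = 6`): the closed forms compute as stated -/

section Probes

/-- apex `hI`, `h = 6`. -/
abbrev pA : BPoint := (6, 0, 0)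
/-- `4I + ℓ` (`α = 5`, charge 1, phase 0). -/
abbrev pL10 : BPoint := (5, 1, 0)
/-- charge 1, phase 1. -/
abbrev pL11 : BPoint := (5, 0, -1)
/-- charge 2, phase 0. -/
abbrev pL20 : BPoint := (4, 2, 0)
/-- charge 2, phase 2. -/
abbrev pL22 : BPoint := (4, -2, 0)
/-- `3ℓ` (top charge 3, phase 0). -/
abbrev pL30 : BPoint := (3, 3, 0)

/-- the probe letters are the LINE-6 letters they claim to be. -/
theorem letters_h6 : lineLetter 6 0 0 = pA ∧ lineLetter 6 1 0 = pL10 ∧ lineLetter 6 1 1 = pL11 ∧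
    lineLetter 6 2 0 = pL20 ∧ lineLetter 6 2 2 = pL22 ∧ lineLetter 6 3 0 = pL30 := by
  refine ⟨?_, ?_, ?_, ?_, ?_, ?_⟩ <;> decide

/-- the hub `N(3 ∣ apex³) = [3ℓ ∣ hI ∣ hI ∣ hI]`. -/
def cHub : MCell := mcellOf pL30 pA pA pA
/-- `P(3, 2₀ ∣ apex²)`. -/
def cP20 : MCell := mcellOf pL30 pL20 pA pA
/-- its sibling of phase 2: `P(3, 2₂ ∣ apex²)`. -/
def cP22 : MCell := mcellOf pL30 pL22 pA pA
/-- the shallower own-ray `N`-cell `N(3, 1₀ ∣ apex²)` (topmost-partner ∕ companion blocker). -/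
def cN10 : MCell := mcellOf pL30 pL10 pA pA
/-- `P(3, 1₀ ∣ apex²)`. -/
def cP10 : MCell := mcellOf pL30 pL10 pA pA
/-- the own-ray up-server `[hI ∣ ℓ₀… ]` of `cP10`'s factor 0: `N(1₀ ∣ apex³)` on factor 1. -/
def cN010 : MCell := mcellOf pA pL10 pA pA

/-- hub + head + sibling. -/
def cfgFire : MConfig := ⟨{cHub}, {cP20, cP22}⟩
/-- hub + head, no sibling. -/
def cfgNoSib : MConfig := ⟨{cHub}, {cP20}⟩
/-- hub + head + sibling + the shallower own-ray `N`-cell. -/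
def cfgBlocked : MConfig := ⟨{cHub, cN10}, {cP20, cP22}⟩

set_option synthInstance.maxSize 8192 in
set_option synthInstance.maxHeartbeats 2000000 in -- `Decidable` synthesis through the dual image, as in `Pad4TowerXresFamilies` §5
/-- §4 computes: the apex-demand `X+` clause fires with a sibling of another phase; closed without it; closed again once the charge-1
own-ray `N`-cell is present (it un-tops the hub for the phase-0 head and is a companion for the phase-2 head). [kernel, `decide`] -/
theorem xplus_probe : ¬ XPlusClosed cfgFire ∧ XPlusClosed cfgNoSib ∧ XPlusClosed cfgBlocked := by
  refine ⟨?_, ?_, ?_⟩ <;> decide +kernel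

/-- two phases of charge-1 `P`-letters below each apex factor of the hub. -/
def hubServers2 : Finset MCell :=
  {mcellOf pL30 pL10 pA pA, mcellOf pL30 pL11 pA pA, mcellOf pL30 pA pL10 pA, mcellOf pL30 pA pL11 pA,
   mcellOf pL30 pA pA pL10, mcellOf pL30 pA pA pL11}
/-- the same with a single phase below factor 3. -/
def hubServers1 : Finset MCell :=
  {mcellOf pL30 pL10 pA pA, mcellOf pL30 pL11 pA pA, mcellOf pL30 pA pL10 pA, mcellOf pL30 pA pL11 pA,
   mcellOf pL30 pA pA pL10}
/-- hub over `hubServers2`. -/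
def cfgHub2 : MConfig := ⟨{cHub}, hubServers2⟩
/-- hub over `hubServers1`. -/
def cfgHub1 : MConfig := ⟨{cHub}, hubServers1⟩

set_option synthInstance.maxSize 8192 in
set_option synthInstance.maxHeartbeats 2000000 in -- as above
/-- (RD-N1) computes at the top hub: RULE D holds with two phases below every apex factor and fails with one phase below factor 3.
[kernel, `decide`] -/
theorem hub_probe : RuleDMu4N cfgHub2 cHub ∧ ¬ RuleDMu4N cfgHub1 cHub := by
  constructor <;> decide +kernel

/-- `cP10` with its hub and its factor-0 up-server. -/
def cfgPok : MConfig := ⟨{cHub, cN010}, {cP10}⟩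
/-- … without the hub. -/
def cfgPnohub : MConfig := ⟨{cN010}, {cP10}⟩
/-- … without the factor-0 up-server. -/
def cfgPnoup : MConfig := ⟨{cHub}, {cP10}⟩

set_option synthInstance.maxSize 8192 in
set_option synthInstance.maxHeartbeats 2000000 in -- as above
/-- (RD-P) computes: `P(3, 1₀ ∣ apex²)` passes RULE D iff both the hub (factor-1 up-server) and an own-ray up-server of factor 0 are
present. [kernel, `decide`] -/
theorem pcell_probe : RuleDMu4P cfgPok cP10 ∧ ¬ RuleDMu4P cfgPnohub cP10 ∧ ¬ RuleDMu4P cfgPnoup cP10 := by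
  refine ⟨?_, ?_, ?_⟩ <;> decide +kernel

end Probes


/-! ## §9 Two separating configurations (kernel): symmetry cannot be dropped, and WITHOUT PHASE MIXING THE STATICS ARE INERT -/

section Separating

/-! ### §9.1 `Sep6` (LINE-6, 5 cells): RULE-D-closed, all four families closed, and a MULTIPLY CHARGED `P`-cell — so `SibClosed`
cannot be dropped from `line_inertia` -/

/-- `N(1₀ ∣ apex³)` on factor 0. -/
def sH0 : MCell := mcellOf pL10 pA pA pA
/-- the multiply charged `P(1₀, 1₀ ∣ apex²)`. -/
def sX : MCell := mcellOf pL10 pL10 pA pA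
/-- the tower `P(3₀ ∣ apex³)` on factor 1. -/
def sT1 : MCell := mcellOf pA pL30 pA pA
/-- **Sep6** = `{N(1₀∣A³)@0, N(1₀∣A³)@1 ; P(1₀,1₀∣A²), P(3₀∣A³)@0, P(3₀∣A³)@1}` (`cN010`, `cHub` from §7). -/
def Sep6 : MConfig := ⟨{sH0, cN010}, {sX, cHub, sT1}⟩

/-- the letters of `Sep6`. -/
theorem sep6_letters : ∀ X ∈ Sep6.lower ∪ Sep6.upper, ∀ f, X f ∈ ({pA, pL10, pL30} : Finset BPoint) := by decide

/-- they are effective LINE-6 letters. -/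
theorem isLL_sep6 {x : BPoint} (hx : x ∈ ({pA, pL10, pL30} : Finset BPoint)) : IsLL 6 x := by
  simp only [Finset.mem_insert, Finset.mem_singleton] at hx
  rcases hx with rfl | rfl | rfl
  · exact ⟨0, 0, by norm_num, by decide⟩
  · exact ⟨1, 0, by norm_num, by decide⟩
  · exact ⟨3, 0, by norm_num, by decide⟩

/-- `Sep6` is an effective LINE-6 support. -/
theorem sep6_lsupport : LSupport 6 Sep6 :=
  ⟨fun Z hZ f => isLL_sep6 (sep6_letters Z (Finset.mem_union_left _ hZ) f),
   fun P hP f => isLL_sep6 (sep6_letters P (Finset.mem_union_right _ hP) f)⟩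

set_option synthInstance.maxSize 16384 in
set_option synthInstance.maxHeartbeats 4000000 in
/-- RULE D holds at every cell of `Sep6`. [kernel, `decide`] -/
theorem sep6_ruleD_cells : RuleDMu4N Sep6 sH0 ∧ RuleDMu4N Sep6 cN010 ∧ RuleDMu4P Sep6 sX ∧ RuleDMu4P Sep6 cHub ∧
    RuleDMu4P Sep6 sT1 := by
  refine ⟨?_, ?_, ?_, ?_, ?_⟩ <;> decide +kernel

/-- `Sep6` is RULE-D-closed. -/
theorem sep6_ruleD : RuleDMu4Closed Sep6 := by
  obtain ⟨h1, h2, h3, h4, h5⟩ := sep6_ruleD_cells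
  refine ⟨fun Z hZ => ?_, fun P hP => ?_⟩
  · have : Z = sH0 ∨ Z = cN010 := by simpa [Sep6] using hZ
    rcases this with rfl | rfl <;> assumption
  · have : P = sX ∨ P = cHub ∨ P = sT1 := by simpa [Sep6] using hP
    rcases this with rfl | rfl | rfl <;> assumption

set_option synthInstance.maxSize 16384 in
set_option synthInstance.maxHeartbeats 4000000 in
/-- `Sep6` is `X+`-closed. [kernel, `decide`] -/
theorem sep6_xplus : XPlusClosed Sep6 := by decide +kernel

/-- **`Sep6` IS STATIC-CLOSED** (RULE D and all four instance families). -/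
theorem sep6_static : RuleDMu4Closed Sep6 ∧ XresFourClosed Sep6 :=
  ⟨sep6_ruleD, (xresFour_iff_xplus sep6_lsupport).2 sep6_xplus⟩

/-- … and carries the multiply charged `P(1₀, 1₀ ∣ apex²)`; by `line_inertia` it is therefore NOT sibling-closed (indeed the sibling
`P(1₁, 1₀ ∣ apex²)` is absent): the symmetry hypothesis of the LINE INERTIA THEOREM cannot be dropped. -/
theorem sep6_separates : sX ∈ Sep6.upper ∧ MultCharged sX ∧ ¬ SibClosed 6 Sep6 := by
  have hX : sX ∈ Sep6.upper := by simp [Sep6]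
  have hm : MultCharged sX := ⟨0, 1, by decide, by decide, by decide⟩
  exact ⟨hX, hm, fun hS => line_inertia sep6_lsupport sep6_static.1 sep6_xplus hS sX (Finset.mem_union_right _ hX) hm⟩

/-! ### §9.2 `FC8` (LINE-8, 59 cells, ONE PHASE): the RULE-D closure of the FULLY CHARGED `P`-cell `[6I+ℓ]⁴` — RULE-D-closed and all
four families closed. Without phase mixing the H₁-static rules do not exclude fully charged cells on the LINE. -/

/-- apex `8I`. -/
abbrev qA : BPoint := (8, 0, 0)

/-- the LINE-8 letter of charge 1, phase 0: `α = 7`, i.e. `6I + ℓ`. -/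
abbrev qL1 : BPoint := (7, 1, 0)

/-- the LINE-8 letter of charge 2, phase 0: `α = 6`, i.e. `4I + 2ℓ`. -/
abbrev qL2 : BPoint := (6, 2, 0)

/-- the LINE-8 letter of charge 3, phase 0: `α = 5`, i.e. `2I + 3ℓ`. -/
abbrev qL3 : BPoint := (5, 3, 0)

/-- the LINE-8 letter of charge 4, phase 0: `α = 4`, i.e. `4ℓ`. -/
abbrev qL4 : BPoint := (4, 4, 0)

/-- `P`-cell, charges (0, 0, 0, 4), phase 0. -/
def u0004 : MCell := mcellOf qA qA qA qL4

/-- `P`-cell, charges (0, 0, 1, 3), phase 0. -/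
def u0013 : MCell := mcellOf qA qA qL1 qL3

/-- `P`-cell, charges (0, 0, 2, 2), phase 0. -/
def u0022 : MCell := mcellOf qA qA qL2 qL2

/-- `P`-cell, charges (0, 0, 3, 1), phase 0. -/
def u0031 : MCell := mcellOf qA qA qL3 qL1

/-- `P`-cell, charges (0, 0, 4, 0), phase 0. -/
def u0040 : MCell := mcellOf qA qA qL4 qA

/-- `P`-cell, charges (0, 1, 0, 3), phase 0. -/
def u0103 : MCell := mcellOf qA qL1 qA qL3

/-- `P`-cell, charges (0, 1, 1, 2), phase 0. -/
def u0112 : MCell := mcellOf qA qL1 qL1 qL2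

/-- `P`-cell, charges (0, 1, 2, 1), phase 0. -/
def u0121 : MCell := mcellOf qA qL1 qL2 qL1

/-- `P`-cell, charges (0, 1, 3, 0), phase 0. -/
def u0130 : MCell := mcellOf qA qL1 qL3 qA

/-- `P`-cell, charges (0, 2, 0, 2), phase 0. -/
def u0202 : MCell := mcellOf qA qL2 qA qL2

/-- `P`-cell, charges (0, 2, 1, 1), phase 0. -/
def u0211 : MCell := mcellOf qA qL2 qL1 qL1

/-- `P`-cell, charges (0, 2, 2, 0), phase 0. -/
def u0220 : MCell := mcellOf qA qL2 qL2 qA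

/-- `P`-cell, charges (0, 3, 0, 1), phase 0. -/
def u0301 : MCell := mcellOf qA qL3 qA qL1

/-- `P`-cell, charges (0, 3, 1, 0), phase 0. -/
def u0310 : MCell := mcellOf qA qL3 qL1 qA

/-- `P`-cell, charges (0, 4, 0, 0), phase 0. -/
def u0400 : MCell := mcellOf qA qL4 qA qA

/-- `P`-cell, charges (1, 0, 0, 3), phase 0. -/
def u1003 : MCell := mcellOf qL1 qA qA qL3

/-- `P`-cell, charges (1, 0, 1, 2), phase 0. -/
def u1012 : MCell := mcellOf qL1 qA qL1 qL2

/-- `P`-cell, charges (1, 0, 2, 1), phase 0. -/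
def u1021 : MCell := mcellOf qL1 qA qL2 qL1

/-- `P`-cell, charges (1, 0, 3, 0), phase 0. -/
def u1030 : MCell := mcellOf qL1 qA qL3 qA

/-- `P`-cell, charges (1, 1, 0, 2), phase 0. -/
def u1102 : MCell := mcellOf qL1 qL1 qA qL2

/-- `P`-cell, charges (1, 1, 1, 1), phase 0. -/
def u1111 : MCell := mcellOf qL1 qL1 qL1 qL1

/-- `P`-cell, charges (1, 1, 2, 0), phase 0. -/
def u1120 : MCell := mcellOf qL1 qL1 qL2 qA

/-- `P`-cell, charges (1, 2, 0, 1), phase 0. -/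
def u1201 : MCell := mcellOf qL1 qL2 qA qL1

/-- `P`-cell, charges (1, 2, 1, 0), phase 0. -/
def u1210 : MCell := mcellOf qL1 qL2 qL1 qA

/-- `P`-cell, charges (1, 3, 0, 0), phase 0. -/
def u1300 : MCell := mcellOf qL1 qL3 qA qA

/-- `P`-cell, charges (2, 0, 0, 2), phase 0. -/
def u2002 : MCell := mcellOf qL2 qA qA qL2

/-- `P`-cell, charges (2, 0, 1, 1), phase 0. -/
def u2011 : MCell := mcellOf qL2 qA qL1 qL1

/-- `P`-cell, charges (2, 0, 2, 0), phase 0. -/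
def u2020 : MCell := mcellOf qL2 qA qL2 qA

/-- `P`-cell, charges (2, 1, 0, 1), phase 0. -/
def u2101 : MCell := mcellOf qL2 qL1 qA qL1

/-- `P`-cell, charges (2, 1, 1, 0), phase 0. -/
def u2110 : MCell := mcellOf qL2 qL1 qL1 qA

/-- `P`-cell, charges (2, 2, 0, 0), phase 0. -/
def u2200 : MCell := mcellOf qL2 qL2 qA qA

/-- `P`-cell, charges (3, 0, 0, 1), phase 0. -/
def u3001 : MCell := mcellOf qL3 qA qA qL1

/-- `P`-cell, charges (3, 0, 1, 0), phase 0. -/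
def u3010 : MCell := mcellOf qL3 qA qL1 qA

/-- `P`-cell, charges (3, 1, 0, 0), phase 0. -/
def u3100 : MCell := mcellOf qL3 qL1 qA qA

/-- `P`-cell, charges (4, 0, 0, 0), phase 0. -/
def u4000 : MCell := mcellOf qL4 qA qA qA

/-- `N`-cell, charges (0, 0, 0, 2), phase 0. -/
def d0002 : MCell := mcellOf qA qA qA qL2

/-- `N`-cell, charges (0, 0, 0, 3), phase 0. -/
def d0003 : MCell := mcellOf qA qA qA qL3

/-- `N`-cell, charges (0, 0, 1, 2), phase 0. -/
def d0012 : MCell := mcellOf qA qA qL1 qL2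

/-- `N`-cell, charges (0, 0, 2, 0), phase 0. -/
def d0020 : MCell := mcellOf qA qA qL2 qA

/-- `N`-cell, charges (0, 0, 2, 1), phase 0. -/
def d0021 : MCell := mcellOf qA qA qL2 qL1

/-- `N`-cell, charges (0, 0, 3, 0), phase 0. -/
def d0030 : MCell := mcellOf qA qA qL3 qA

/-- `N`-cell, charges (0, 1, 0, 2), phase 0. -/
def d0102 : MCell := mcellOf qA qL1 qA qL2

/-- `N`-cell, charges (0, 1, 1, 1), phase 0. -/
def d0111 : MCell := mcellOf qA qL1 qL1 qL1

/-- `N`-cell, charges (0, 1, 2, 0), phase 0. -/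
def d0120 : MCell := mcellOf qA qL1 qL2 qA

/-- `N`-cell, charges (0, 2, 0, 0), phase 0. -/
def d0200 : MCell := mcellOf qA qL2 qA qA

/-- `N`-cell, charges (0, 2, 0, 1), phase 0. -/
def d0201 : MCell := mcellOf qA qL2 qA qL1

/-- `N`-cell, charges (0, 2, 1, 0), phase 0. -/
def d0210 : MCell := mcellOf qA qL2 qL1 qA

/-- `N`-cell, charges (0, 3, 0, 0), phase 0. -/
def d0300 : MCell := mcellOf qA qL3 qA qA

/-- `N`-cell, charges (1, 0, 0, 2), phase 0. -/
def d1002 : MCell := mcellOf qL1 qA qA qL2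

/-- `N`-cell, charges (1, 0, 1, 1), phase 0. -/
def d1011 : MCell := mcellOf qL1 qA qL1 qL1

/-- `N`-cell, charges (1, 0, 2, 0), phase 0. -/
def d1020 : MCell := mcellOf qL1 qA qL2 qA

/-- `N`-cell, charges (1, 1, 0, 1), phase 0. -/
def d1101 : MCell := mcellOf qL1 qL1 qA qL1

/-- `N`-cell, charges (1, 1, 1, 0), phase 0. -/
def d1110 : MCell := mcellOf qL1 qL1 qL1 qA

/-- `N`-cell, charges (1, 2, 0, 0), phase 0. -/
def d1200 : MCell := mcellOf qL1 qL2 qA qA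

/-- `N`-cell, charges (2, 0, 0, 0), phase 0. -/
def d2000 : MCell := mcellOf qL2 qA qA qA

/-- `N`-cell, charges (2, 0, 0, 1), phase 0. -/
def d2001 : MCell := mcellOf qL2 qA qA qL1

/-- `N`-cell, charges (2, 0, 1, 0), phase 0. -/
def d2010 : MCell := mcellOf qL2 qA qL1 qA

/-- `N`-cell, charges (2, 1, 0, 0), phase 0. -/
def d2100 : MCell := mcellOf qL2 qL1 qA qA

/-- `N`-cell, charges (3, 0, 0, 0), phase 0. -/
def d3000 : MCell := mcellOf qL3 qA qA qA

/-- the 24 `N`-cells of `FC8`. -/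
def FC8N : Finset MCell :=
  {d0002, d0003, d0012, d0020, d0021, d0030, d0102, d0111, d0120, d0200, d0201, d0210, d0300, d1002, d1011, d1020, d1101, d1110, d1200, d2000, d2001, d2010, d2100, d3000}

/-- the 35 `P`-cells of `FC8`. -/
def FC8P : Finset MCell :=
  {u0004, u0013, u0022, u0031, u0040, u0103, u0112, u0121, u0130, u0202, u0211, u0220, u0301, u0310, u0400, u1003, u1012, u1021, u1030, u1102, u1111, u1120, u1201, u1210, u1300, u2002, u2011, u2020, u2101, u2110, u2200, u3001, u3010, u3100, u4000}

/-- **FC8**: the phase-pure RULE-D closure on LINE-8 of the fully charged `P`-cell `u1111 = [6I+ℓ ∣ 6I+ℓ ∣ 6I+ℓ ∣ 6I+ℓ]` (`α = 7` on every factor). -/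
def FC8 : MConfig := ⟨FC8N, FC8P⟩

set_option maxRecDepth 8192 in
/-- the letters of `FC8`. [kernel, `decide`] -/
theorem fc8_letters : ∀ X ∈ FC8.lower ∪ FC8.upper, ∀ f, X f ∈ ({qA, qL1, qL2, qL3, qL4} : Finset BPoint) := by
  decide +kernel

/-- they are effective LINE-8 letters … -/
theorem isLL_fc8 {x : BPoint} (hx : x ∈ ({qA, qL1, qL2, qL3, qL4} : Finset BPoint)) : IsLL 8 x := by
  simp only [Finset.mem_insert, Finset.mem_singleton] at hx
  rcases hx with rfl | rfl | rfl | rfl | rfl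
  · exact ⟨0, 0, by norm_num, by decide⟩
  · exact ⟨1, 0, by norm_num, by decide⟩
  · exact ⟨2, 0, by norm_num, by decide⟩
  · exact ⟨3, 0, by norm_num, by decide⟩
  · exact ⟨4, 0, by norm_num, by decide⟩

/-- … of phase `0` when charged. -/
theorem phase0_fc8 {x : BPoint} (hx : x ∈ ({qA, qL1, qL2, qL3, qL4} : Finset BPoint)) {c : ℕ} {k : Fin 4}
    (e : x = lineLetter 8 c k) (hc : 1 ≤ c) : k = 0 := by
  simp only [Finset.mem_insert, Finset.mem_singleton] at hx
  rcases hx with rfl | rfl | rfl | rfl | rfl <;> fin_cases k <;> simp [lineLetter, Prod.ext_iff] at e ⊢ <;> omega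

/-- `FC8` is an effective LINE-8 support … -/
theorem fc8_lsupport : LSupport 8 FC8 :=
  ⟨fun Z hZ f => isLL_fc8 (fc8_letters Z (Finset.mem_union_left _ hZ) f),
   fun P hP f => isLL_fc8 (fc8_letters P (Finset.mem_union_right _ hP) f)⟩

/-- … with one phase. -/
theorem fc8_pure : ∀ X ∈ FC8.lower ∪ FC8.upper, ∀ f, ∀ c : ℕ, ∀ k : Fin 4, X f = lineLetter 8 c k → 1 ≤ c → k = 0 :=
  fun X hX f _ _ e hc => phase0_fc8 (fc8_letters X hX f) e hc


set_option synthInstance.maxSize 16384 in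
set_option synthInstance.maxHeartbeats 4000000 in
/-- RULE D holds at `d0002` in `FC8`. [kernel, `decide`] -/
theorem rd_d0002 : RuleDMu4N FC8 d0002 := by decide +kernel

set_option synthInstance.maxSize 16384 in
set_option synthInstance.maxHeartbeats 4000000 in
/-- RULE D holds at `d0003` in `FC8`. [kernel, `decide`] -/
theorem rd_d0003 : RuleDMu4N FC8 d0003 := by decide +kernel

set_option synthInstance.maxSize 16384 in
set_option synthInstance.maxHeartbeats 4000000 in
/-- RULE D holds at `d0012` in `FC8`. [kernel, `decide`] -/
theorem rd_d0012 : RuleDMu4N FC8 d0012 := by decide +kernel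

set_option synthInstance.maxSize 16384 in
set_option synthInstance.maxHeartbeats 4000000 in
/-- RULE D holds at `d0020` in `FC8`. [kernel, `decide`] -/
theorem rd_d0020 : RuleDMu4N FC8 d0020 := by decide +kernel

set_option synthInstance.maxSize 16384 in
set_option synthInstance.maxHeartbeats 4000000 in
/-- RULE D holds at `d0021` in `FC8`. [kernel, `decide`] -/
theorem rd_d0021 : RuleDMu4N FC8 d0021 := by decide +kernel

set_option synthInstance.maxSize 16384 in
set_option synthInstance.maxHeartbeats 4000000 in
/-- RULE D holds at `d0030` in `FC8`. [kernel, `decide`] -/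
theorem rd_d0030 : RuleDMu4N FC8 d0030 := by decide +kernel

set_option synthInstance.maxSize 16384 in
set_option synthInstance.maxHeartbeats 4000000 in
/-- RULE D holds at `d0102` in `FC8`. [kernel, `decide`] -/
theorem rd_d0102 : RuleDMu4N FC8 d0102 := by decide +kernel

set_option synthInstance.maxSize 16384 in
set_option synthInstance.maxHeartbeats 4000000 in
/-- RULE D holds at `d0111` in `FC8`. [kernel, `decide`] -/
theorem rd_d0111 : RuleDMu4N FC8 d0111 := by decide +kernel

set_option synthInstance.maxSize 16384 in
set_option synthInstance.maxHeartbeats 4000000 in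
/-- RULE D holds at `d0120` in `FC8`. [kernel, `decide`] -/
theorem rd_d0120 : RuleDMu4N FC8 d0120 := by decide +kernel

set_option synthInstance.maxSize 16384 in
set_option synthInstance.maxHeartbeats 4000000 in
/-- RULE D holds at `d0200` in `FC8`. [kernel, `decide`] -/
theorem rd_d0200 : RuleDMu4N FC8 d0200 := by decide +kernel

set_option synthInstance.maxSize 16384 in
set_option synthInstance.maxHeartbeats 4000000 in
/-- RULE D holds at `d0201` in `FC8`. [kernel, `decide`] -/
theorem rd_d0201 : RuleDMu4N FC8 d0201 := by decide +kernel

set_option synthInstance.maxSize 16384 in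
set_option synthInstance.maxHeartbeats 4000000 in
/-- RULE D holds at `d0210` in `FC8`. [kernel, `decide`] -/
theorem rd_d0210 : RuleDMu4N FC8 d0210 := by decide +kernel

set_option synthInstance.maxSize 16384 in
set_option synthInstance.maxHeartbeats 4000000 in
/-- RULE D holds at `d0300` in `FC8`. [kernel, `decide`] -/
theorem rd_d0300 : RuleDMu4N FC8 d0300 := by decide +kernel

set_option synthInstance.maxSize 16384 in
set_option synthInstance.maxHeartbeats 4000000 in
/-- RULE D holds at `d1002` in `FC8`. [kernel, `decide`] -/
theorem rd_d1002 : RuleDMu4N FC8 d1002 := by decide +kernel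

set_option synthInstance.maxSize 16384 in
set_option synthInstance.maxHeartbeats 4000000 in
/-- RULE D holds at `d1011` in `FC8`. [kernel, `decide`] -/
theorem rd_d1011 : RuleDMu4N FC8 d1011 := by decide +kernel

set_option synthInstance.maxSize 16384 in
set_option synthInstance.maxHeartbeats 4000000 in
/-- RULE D holds at `d1020` in `FC8`. [kernel, `decide`] -/
theorem rd_d1020 : RuleDMu4N FC8 d1020 := by decide +kernel

set_option synthInstance.maxSize 16384 in
set_option synthInstance.maxHeartbeats 4000000 in
/-- RULE D holds at `d1101` in `FC8`. [kernel, `decide`] -/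
theorem rd_d1101 : RuleDMu4N FC8 d1101 := by decide +kernel

set_option synthInstance.maxSize 16384 in
set_option synthInstance.maxHeartbeats 4000000 in
/-- RULE D holds at `d1110` in `FC8`. [kernel, `decide`] -/
theorem rd_d1110 : RuleDMu4N FC8 d1110 := by decide +kernel

set_option synthInstance.maxSize 16384 in
set_option synthInstance.maxHeartbeats 4000000 in
/-- RULE D holds at `d1200` in `FC8`. [kernel, `decide`] -/
theorem rd_d1200 : RuleDMu4N FC8 d1200 := by decide +kernel

set_option synthInstance.maxSize 16384 in
set_option synthInstance.maxHeartbeats 4000000 in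
/-- RULE D holds at `d2000` in `FC8`. [kernel, `decide`] -/
theorem rd_d2000 : RuleDMu4N FC8 d2000 := by decide +kernel

set_option synthInstance.maxSize 16384 in
set_option synthInstance.maxHeartbeats 4000000 in
/-- RULE D holds at `d2001` in `FC8`. [kernel, `decide`] -/
theorem rd_d2001 : RuleDMu4N FC8 d2001 := by decide +kernel

set_option synthInstance.maxSize 16384 in
set_option synthInstance.maxHeartbeats 4000000 in
/-- RULE D holds at `d2010` in `FC8`. [kernel, `decide`] -/
theorem rd_d2010 : RuleDMu4N FC8 d2010 := by decide +kernel

set_option synthInstance.maxSize 16384 in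
set_option synthInstance.maxHeartbeats 4000000 in
/-- RULE D holds at `d2100` in `FC8`. [kernel, `decide`] -/
theorem rd_d2100 : RuleDMu4N FC8 d2100 := by decide +kernel

set_option synthInstance.maxSize 16384 in
set_option synthInstance.maxHeartbeats 4000000 in
/-- RULE D holds at `d3000` in `FC8`. [kernel, `decide`] -/
theorem rd_d3000 : RuleDMu4N FC8 d3000 := by decide +kernel

set_option synthInstance.maxSize 16384 in
set_option synthInstance.maxHeartbeats 4000000 in
/-- RULE D holds at `u0004` in `FC8`. [kernel, `decide`] -/
theorem rd_u0004 : RuleDMu4P FC8 u0004 := by decide +kernel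

set_option synthInstance.maxSize 16384 in
set_option synthInstance.maxHeartbeats 4000000 in
/-- RULE D holds at `u0013` in `FC8`. [kernel, `decide`] -/
theorem rd_u0013 : RuleDMu4P FC8 u0013 := by decide +kernel

set_option synthInstance.maxSize 16384 in
set_option synthInstance.maxHeartbeats 4000000 in
/-- RULE D holds at `u0022` in `FC8`. [kernel, `decide`] -/
theorem rd_u0022 : RuleDMu4P FC8 u0022 := by decide +kernel

set_option synthInstance.maxSize 16384 in
set_option synthInstance.maxHeartbeats 4000000 in
/-- RULE D holds at `u0031` in `FC8`. [kernel, `decide`] -/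
theorem rd_u0031 : RuleDMu4P FC8 u0031 := by decide +kernel

set_option synthInstance.maxSize 16384 in
set_option synthInstance.maxHeartbeats 4000000 in
/-- RULE D holds at `u0040` in `FC8`. [kernel, `decide`] -/
theorem rd_u0040 : RuleDMu4P FC8 u0040 := by decide +kernel

set_option synthInstance.maxSize 16384 in
set_option synthInstance.maxHeartbeats 4000000 in
/-- RULE D holds at `u0103` in `FC8`. [kernel, `decide`] -/
theorem rd_u0103 : RuleDMu4P FC8 u0103 := by decide +kernel

set_option synthInstance.maxSize 16384 in
set_option synthInstance.maxHeartbeats 4000000 in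
/-- RULE D holds at `u0112` in `FC8`. [kernel, `decide`] -/
theorem rd_u0112 : RuleDMu4P FC8 u0112 := by decide +kernel

set_option synthInstance.maxSize 16384 in
set_option synthInstance.maxHeartbeats 4000000 in
/-- RULE D holds at `u0121` in `FC8`. [kernel, `decide`] -/
theorem rd_u0121 : RuleDMu4P FC8 u0121 := by decide +kernel

set_option synthInstance.maxSize 16384 in
set_option synthInstance.maxHeartbeats 4000000 in
/-- RULE D holds at `u0130` in `FC8`. [kernel, `decide`] -/
theorem rd_u0130 : RuleDMu4P FC8 u0130 := by decide +kernel

set_option synthInstance.maxSize 16384 in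
set_option synthInstance.maxHeartbeats 4000000 in
/-- RULE D holds at `u0202` in `FC8`. [kernel, `decide`] -/
theorem rd_u0202 : RuleDMu4P FC8 u0202 := by decide +kernel

set_option synthInstance.maxSize 16384 in
set_option synthInstance.maxHeartbeats 4000000 in
/-- RULE D holds at `u0211` in `FC8`. [kernel, `decide`] -/
theorem rd_u0211 : RuleDMu4P FC8 u0211 := by decide +kernel

set_option synthInstance.maxSize 16384 in
set_option synthInstance.maxHeartbeats 4000000 in
/-- RULE D holds at `u0220` in `FC8`. [kernel, `decide`] -/
theorem rd_u0220 : RuleDMu4P FC8 u0220 := by decide +kernel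

set_option synthInstance.maxSize 16384 in
set_option synthInstance.maxHeartbeats 4000000 in
/-- RULE D holds at `u0301` in `FC8`. [kernel, `decide`] -/
theorem rd_u0301 : RuleDMu4P FC8 u0301 := by decide +kernel

set_option synthInstance.maxSize 16384 in
set_option synthInstance.maxHeartbeats 4000000 in
/-- RULE D holds at `u0310` in `FC8`. [kernel, `decide`] -/
theorem rd_u0310 : RuleDMu4P FC8 u0310 := by decide +kernel

set_option synthInstance.maxSize 16384 in
set_option synthInstance.maxHeartbeats 4000000 in
/-- RULE D holds at `u0400` in `FC8`. [kernel, `decide`] -/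
theorem rd_u0400 : RuleDMu4P FC8 u0400 := by decide +kernel

set_option synthInstance.maxSize 16384 in
set_option synthInstance.maxHeartbeats 4000000 in
/-- RULE D holds at `u1003` in `FC8`. [kernel, `decide`] -/
theorem rd_u1003 : RuleDMu4P FC8 u1003 := by decide +kernel

set_option synthInstance.maxSize 16384 in
set_option synthInstance.maxHeartbeats 4000000 in
/-- RULE D holds at `u1012` in `FC8`. [kernel, `decide`] -/
theorem rd_u1012 : RuleDMu4P FC8 u1012 := by decide +kernel

set_option synthInstance.maxSize 16384 in
set_option synthInstance.maxHeartbeats 4000000 in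
/-- RULE D holds at `u1021` in `FC8`. [kernel, `decide`] -/
theorem rd_u1021 : RuleDMu4P FC8 u1021 := by decide +kernel

set_option synthInstance.maxSize 16384 in
set_option synthInstance.maxHeartbeats 4000000 in
/-- RULE D holds at `u1030` in `FC8`. [kernel, `decide`] -/
theorem rd_u1030 : RuleDMu4P FC8 u1030 := by decide +kernel

set_option synthInstance.maxSize 16384 in
set_option synthInstance.maxHeartbeats 4000000 in
/-- RULE D holds at `u1102` in `FC8`. [kernel, `decide`] -/
theorem rd_u1102 : RuleDMu4P FC8 u1102 := by decide +kernel

set_option synthInstance.maxSize 16384 in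
set_option synthInstance.maxHeartbeats 4000000 in
/-- RULE D holds at `u1111` in `FC8`. [kernel, `decide`] -/
theorem rd_u1111 : RuleDMu4P FC8 u1111 := by decide +kernel

set_option synthInstance.maxSize 16384 in
set_option synthInstance.maxHeartbeats 4000000 in
/-- RULE D holds at `u1120` in `FC8`. [kernel, `decide`] -/
theorem rd_u1120 : RuleDMu4P FC8 u1120 := by decide +kernel

set_option synthInstance.maxSize 16384 in
set_option synthInstance.maxHeartbeats 4000000 in
/-- RULE D holds at `u1201` in `FC8`. [kernel, `decide`] -/
theorem rd_u1201 : RuleDMu4P FC8 u1201 := by decide +kernel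

set_option synthInstance.maxSize 16384 in
set_option synthInstance.maxHeartbeats 4000000 in
/-- RULE D holds at `u1210` in `FC8`. [kernel, `decide`] -/
theorem rd_u1210 : RuleDMu4P FC8 u1210 := by decide +kernel

set_option synthInstance.maxSize 16384 in
set_option synthInstance.maxHeartbeats 4000000 in
/-- RULE D holds at `u1300` in `FC8`. [kernel, `decide`] -/
theorem rd_u1300 : RuleDMu4P FC8 u1300 := by decide +kernel

set_option synthInstance.maxSize 16384 in
set_option synthInstance.maxHeartbeats 4000000 in
/-- RULE D holds at `u2002` in `FC8`. [kernel, `decide`] -/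
theorem rd_u2002 : RuleDMu4P FC8 u2002 := by decide +kernel

set_option synthInstance.maxSize 16384 in
set_option synthInstance.maxHeartbeats 4000000 in
/-- RULE D holds at `u2011` in `FC8`. [kernel, `decide`] -/
theorem rd_u2011 : RuleDMu4P FC8 u2011 := by decide +kernel

set_option synthInstance.maxSize 16384 in
set_option synthInstance.maxHeartbeats 4000000 in
/-- RULE D holds at `u2020` in `FC8`. [kernel, `decide`] -/
theorem rd_u2020 : RuleDMu4P FC8 u2020 := by decide +kernel

set_option synthInstance.maxSize 16384 in
set_option synthInstance.maxHeartbeats 4000000 in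
/-- RULE D holds at `u2101` in `FC8`. [kernel, `decide`] -/
theorem rd_u2101 : RuleDMu4P FC8 u2101 := by decide +kernel

set_option synthInstance.maxSize 16384 in
set_option synthInstance.maxHeartbeats 4000000 in
/-- RULE D holds at `u2110` in `FC8`. [kernel, `decide`] -/
theorem rd_u2110 : RuleDMu4P FC8 u2110 := by decide +kernel

set_option synthInstance.maxSize 16384 in
set_option synthInstance.maxHeartbeats 4000000 in
/-- RULE D holds at `u2200` in `FC8`. [kernel, `decide`] -/
theorem rd_u2200 : RuleDMu4P FC8 u2200 := by decide +kernel

set_option synthInstance.maxSize 16384 in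
set_option synthInstance.maxHeartbeats 4000000 in
/-- RULE D holds at `u3001` in `FC8`. [kernel, `decide`] -/
theorem rd_u3001 : RuleDMu4P FC8 u3001 := by decide +kernel

set_option synthInstance.maxSize 16384 in
set_option synthInstance.maxHeartbeats 4000000 in
/-- RULE D holds at `u3010` in `FC8`. [kernel, `decide`] -/
theorem rd_u3010 : RuleDMu4P FC8 u3010 := by decide +kernel

set_option synthInstance.maxSize 16384 in
set_option synthInstance.maxHeartbeats 4000000 in
/-- RULE D holds at `u3100` in `FC8`. [kernel, `decide`] -/
theorem rd_u3100 : RuleDMu4P FC8 u3100 := by decide +kernel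

set_option synthInstance.maxSize 16384 in
set_option synthInstance.maxHeartbeats 4000000 in
/-- RULE D holds at `u4000` in `FC8`. [kernel, `decide`] -/
theorem rd_u4000 : RuleDMu4P FC8 u4000 := by decide +kernel

/-- **`FC8` IS RULE-D-CLOSED.** -/
theorem fc8_ruleD : RuleDMu4Closed FC8 := by
  refine ⟨fun Z hZ => ?_, fun P hP => ?_⟩
  · have : Z = d0002 ∨ Z = d0003 ∨ Z = d0012 ∨ Z = d0020 ∨ Z = d0021 ∨ Z = d0030 ∨ Z = d0102 ∨ Z = d0111 ∨ Z = d0120 ∨ Z = d0200 ∨ Z = d0201 ∨ Z = d0210 ∨ Z = d0300 ∨ Z = d1002 ∨ Z = d1011 ∨ Z = d1020 ∨ Z = d1101 ∨ Z = d1110 ∨ Z = d1200 ∨ Z = d2000 ∨ Z = d2001 ∨ Z = d2010 ∨ Z = d2100 ∨ Z = d3000 := by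
      simpa [FC8, FC8N] using hZ
    rcases this with rfl | rfl | rfl | rfl | rfl | rfl | rfl | rfl | rfl | rfl | rfl | rfl | rfl | rfl | rfl | rfl | rfl | rfl | rfl | rfl | rfl | rfl | rfl | rfl
    exacts [rd_d0002, rd_d0003, rd_d0012, rd_d0020, rd_d0021, rd_d0030, rd_d0102, rd_d0111, rd_d0120, rd_d0200, rd_d0201, rd_d0210, rd_d0300, rd_d1002, rd_d1011, rd_d1020, rd_d1101, rd_d1110, rd_d1200, rd_d2000, rd_d2001, rd_d2010, rd_d2100, rd_d3000]
  · have : P = u0004 ∨ P = u0013 ∨ P = u0022 ∨ P = u0031 ∨ P = u0040 ∨ P = u0103 ∨ P = u0112 ∨ P = u0121 ∨ P = u0130 ∨ P = u0202 ∨ P = u0211 ∨ P = u0220 ∨ P = u0301 ∨ P = u0310 ∨ P = u0400 ∨ P = u1003 ∨ P = u1012 ∨ P = u1021 ∨ P = u1030 ∨ P = u1102 ∨ P = u1111 ∨ P = u1120 ∨ P = u1201 ∨ P = u1210 ∨ P = u1300 ∨ P = u2002 ∨ P = u2011 ∨ P = u2020 ∨ P = u2101 ∨ P = u2110 ∨ P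 = u2200 ∨ P = u3001 ∨ P = u3010 ∨ P = u3100 ∨ P = u4000 := by
      simpa [FC8, FC8P] using hP
    rcases this with rfl | rfl | rfl | rfl | rfl | rfl | rfl | rfl | rfl | rfl | rfl | rfl | rfl | rfl | rfl | rfl | rfl | rfl | rfl | rfl | rfl | rfl | rfl | rfl | rfl | rfl | rfl | rfl | rfl | rfl | rfl | rfl | rfl | rfl | rfl
    exacts [rd_u0004, rd_u0013, rd_u0022, rd_u0031, rd_u0040, rd_u0103, rd_u0112, rd_u0121, rd_u0130, rd_u0202, rd_u0211, rd_u0220, rd_u0301, rd_u0310, rd_u0400, rd_u1003, rd_u1012, rd_u1021, rd_u1030, rd_u1102, rd_u1111, rd_u1120, rd_u1201, rd_u1210, rd_u1300, rd_u2002, rd_u2011, rd_u2020, rd_u2101, rd_u2110, rd_u2200, rd_u3001, rd_u3010, rd_u3100, rd_u4000]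

/-- **`FC8` IS STATIC-CLOSED** (RULE D, `X−`, `X+`, `A2I−`, `A2I+`): `X+` by `xplus_of_phasePure`, the other three by vacuity. -/
theorem fc8_static : RuleDMu4Closed FC8 ∧ XresFourClosed FC8 :=
  ⟨fc8_ruleD, (xresFour_iff_xplus fc8_lsupport).2 (xplus_of_phasePure fc8_lsupport fc8_pure)⟩

/-- … and carries the FULLY CHARGED `P`-cell `[6I+ℓ]⁴` (`Π_f β_f ≠ 0`: a `μ`-relevant cell — the diagonal unit cell `[6I+ℓ_u]⁴` that
survives in bc5-plan's ◇₈-G₁ census (W) j310554); by `line_inertia` it is not sibling-closed —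
its `Σ ≡ 0` phase-shift closure is NOT static-closed. THE STATIC KILL OF FULLY CHARGED DESIGNS ON THE LINE IS A PHASE-MIXING PHENOMENON. -/
theorem fc8_separates : u1111 ∈ FC8.upper ∧ FCCell u1111 ∧ ¬ SibClosed 8 FC8 := by
  have hX : u1111 ∈ FC8.upper := by simp [FC8, FC8P]
  have hfc : FCCell u1111 := by decide
  have hm : MultCharged u1111 := ⟨0, 1, by decide, hfc 0, hfc 1⟩
  exact ⟨hX, hfc, fun hS => line_inertia fc8_lsupport fc8_ruleD (xplus_of_phasePure fc8_lsupport fc8_pure) hS u1111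
    (Finset.mem_union_right _ hX) hm⟩


/-! ### §9.3 `FC8G1` (LINE-8, 236 cells): the `⟨Δ⟩ × S₄`-orbit union of `FC8` is `G₁`-CLOSED, RULE-D-closed and four-family-closed, and
contains all four diagonal unit cells `[6I+ℓ_u]⁴` — the LINE-side twin of bc5-plan's ◇₈-`G₁` census (W) j310554. `G₁` does not mix
phases inside a cell; the `Σ ≡ 0` shifts do, and then `line_inertia` kills every multiply charged cell. -/

/-- the phase rotation `β ↦ i·β` (= `Pad4TowerDeltaWindow.deltaPt`, the generator `Δ` of `G₁ = ⟨Δ⟩ × S₄`). -/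
abbrev dPt (x : BPoint) : BPoint := (x.1, -x.2.2, x.2.1)

/-- … acting diagonally on cells (= `Pad4TowerDeltaWindow.MCell.delta`). -/
abbrev dCell (X : MCell) : MCell := fun f => dPt (X f)

/-- `Δ FC8`. -/
def FC8r1 : MConfig := ⟨FC8N.image dCell, FC8P.image dCell⟩

/-- `Δ² FC8`. -/
def FC8r2 : MConfig := ⟨FC8N.image (dCell ∘ dCell), FC8P.image (dCell ∘ dCell)⟩

/-- `Δ³ FC8`. -/
def FC8r3 : MConfig := ⟨FC8N.image (dCell ∘ dCell ∘ dCell), FC8P.image (dCell ∘ dCell ∘ dCell)⟩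

/-- the `N`-cells of **FC8G1** = `FC8 ∪ Δ FC8 ∪ Δ² FC8 ∪ Δ³ FC8` (96). -/
def FC8G1N : Finset MCell :=
  FC8N ∪ FC8N.image dCell ∪ FC8N.image (dCell ∘ dCell) ∪ FC8N.image (dCell ∘ dCell ∘ dCell)

/-- the `P`-cells of **FC8G1** (140). -/
def FC8G1P : Finset MCell :=
  FC8P ∪ FC8P.image dCell ∪ FC8P.image (dCell ∘ dCell) ∪ FC8P.image (dCell ∘ dCell ∘ dCell)

/-- **FC8G1** = the `⟨Δ⟩`-orbit union of `FC8` (which is already `S₄`-invariant): 96 `N`-cells, 140 `P`-cells. -/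
def FC8G1 : MConfig := ⟨FC8G1N, FC8G1P⟩

set_option synthInstance.maxSize 16384 in
set_option synthInstance.maxHeartbeats 4000000 in
/-- RULE D on the copy `Δ FC8`. [kernel, `decide`] -/
theorem fc8r1_ruleD : RuleDMu4Closed FC8r1 := by
  refine ⟨?_, ?_⟩ <;> decide +kernel

set_option synthInstance.maxSize 16384 in
set_option synthInstance.maxHeartbeats 4000000 in
/-- RULE D on the copy `Δ² FC8`. [kernel, `decide`] -/
theorem fc8r2_ruleD : RuleDMu4Closed FC8r2 := by
  refine ⟨?_, ?_⟩ <;> decide +kernel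

set_option synthInstance.maxSize 16384 in
set_option synthInstance.maxHeartbeats 4000000 in
/-- RULE D on the copy `Δ³ FC8`. [kernel, `decide`] -/
theorem fc8r3_ruleD : RuleDMu4Closed FC8r3 := by
  refine ⟨?_, ?_⟩ <;> decide +kernel

/-- `FC8 ⊆ FC8G1`. -/
theorem fc8_sub : FC8.sub FC8G1 :=
  ⟨fun x hx => by
    change x ∈ FC8N ∪ _ ∪ _ ∪ _; simp only [Finset.mem_union]; exact Or.inl (Or.inl (Or.inl hx)),
   fun x hx => by
    change x ∈ FC8P ∪ _ ∪ _ ∪ _; simp only [Finset.mem_union]; exact Or.inl (Or.inl (Or.inl hx))⟩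

/-- `Δ FC8 ⊆ FC8G1`. -/
theorem fc8r1_sub : FC8r1.sub FC8G1 :=
  ⟨fun x hx => by
    change x ∈ FC8N ∪ _ ∪ _ ∪ _; simp only [Finset.mem_union]; exact Or.inl (Or.inl (Or.inr hx)),
   fun x hx => by
    change x ∈ FC8P ∪ _ ∪ _ ∪ _; simp only [Finset.mem_union]; exact Or.inl (Or.inl (Or.inr hx))⟩

/-- `Δ² FC8 ⊆ FC8G1`. -/
theorem fc8r2_sub : FC8r2.sub FC8G1 :=
  ⟨fun x hx => by
    change x ∈ FC8N ∪ _ ∪ _ ∪ _; simp only [Finset.mem_union]; exact Or.inl (Or.inr hx),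
   fun x hx => by
    change x ∈ FC8P ∪ _ ∪ _ ∪ _; simp only [Finset.mem_union]; exact Or.inl (Or.inr hx)⟩

/-- `Δ³ FC8 ⊆ FC8G1`. -/
theorem fc8r3_sub : FC8r3.sub FC8G1 :=
  ⟨fun x hx => by
    change x ∈ FC8N ∪ _ ∪ _ ∪ _; simp only [Finset.mem_union]; exact Or.inr hx,
   fun x hx => by
    change x ∈ FC8P ∪ _ ∪ _ ∪ _; simp only [Finset.mem_union]; exact Or.inr hx⟩

/-- **`FC8G1` IS RULE-D-CLOSED** (RULE D on each copy, then monotonicity `Pad4TowerRuleDMu4Dual.ruleDMu4N_mono`). -/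
theorem fc8G1_ruleD : RuleDMu4Closed FC8G1 := by
  refine ⟨fun Z hZ => ?_, fun P hP => ?_⟩
  · change Z ∈ FC8N ∪ _ ∪ _ ∪ _ at hZ
    simp only [Finset.mem_union] at hZ
    rcases hZ with ((h0 | h1) | h2) | h3
    · exact ruleDMu4N_mono fc8_sub (fc8_ruleD.1 Z h0)
    · exact ruleDMu4N_mono fc8r1_sub (fc8r1_ruleD.1 Z h1)
    · exact ruleDMu4N_mono fc8r2_sub (fc8r2_ruleD.1 Z h2)
    · exact ruleDMu4N_mono fc8r3_sub (fc8r3_ruleD.1 Z h3)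
  · change P ∈ FC8P ∪ _ ∪ _ ∪ _ at hP
    simp only [Finset.mem_union] at hP
    rcases hP with ((h0 | h1) | h2) | h3
    · exact ruleDMu4P_mono fc8_sub (fc8_ruleD.2 P h0)
    · exact ruleDMu4P_mono fc8r1_sub (fc8r1_ruleD.2 P h1)
    · exact ruleDMu4P_mono fc8r2_sub (fc8r2_ruleD.2 P h2)
    · exact ruleDMu4P_mono fc8r3_sub (fc8r3_ruleD.2 P h3)

/-- the LINE-8 letters of phase `j` (with the apex). -/
def Lj (j : Fin 4) : Finset BPoint := {qA, lineLetter 8 1 j, lineLetter 8 2 j, lineLetter 8 3 j, lineLetter 8 4 j}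

/-- they are effective LINE-8 letters … -/
theorem isLL_Lj {j : Fin 4} {x : BPoint} (hx : x ∈ Lj j) : IsLL 8 x := by
  simp only [Lj, Finset.mem_insert, Finset.mem_singleton] at hx
  rcases hx with rfl | rfl | rfl | rfl | rfl
  · exact ⟨0, 0, by norm_num, by decide⟩
  · exact ⟨1, j, by norm_num, rfl⟩
  · exact ⟨2, j, by norm_num, rfl⟩
  · exact ⟨3, j, by norm_num, rfl⟩
  · exact ⟨4, j, by norm_num, rfl⟩

/-- … of phase `j` when charged. -/
theorem phase_Lj {j : Fin 4} {x : BPoint} (hx : x ∈ Lj j) {c : ℕ} {k : Fin 4} (e : x = lineLetter 8 c k) (hc : 1 ≤ c) :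
    k = j := by
  simp only [Lj, Finset.mem_insert, Finset.mem_singleton] at hx
  rcases hx with rfl | rfl | rfl | rfl | rfl <;> fin_cases j <;> fin_cases k <;>
    simp [lineLetter, Prod.ext_iff] at e ⊢ <;> omega

set_option maxRecDepth 16384 in
/-- every cell of `FC8G1` is phase-pure: its letters lie in one `Lj j`. [kernel, `decide`] -/
theorem fc8G1_letters : ∀ X ∈ FC8G1.lower ∪ FC8G1.upper, ∃ j : Fin 4, ∀ f, X f ∈ Lj j := by
  decide +kernel

/-- `FC8G1` is an effective LINE-8 support … -/
theorem fc8G1_lsupport : LSupport 8 FC8G1 :=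
  ⟨fun Z hZ f => by
    obtain ⟨j, hj⟩ := fc8G1_letters Z (Finset.mem_union_left _ hZ); exact isLL_Lj (hj f),
   fun P hP f => by
    obtain ⟨j, hj⟩ := fc8G1_letters P (Finset.mem_union_right _ hP); exact isLL_Lj (hj f)⟩

/-- … cellwise phase-pure … -/
theorem fc8G1_cellwise : ∀ X ∈ FC8G1.lower ∪ FC8G1.upper, ∀ f g : Fin 4, ∀ c c' : ℕ, ∀ k k' : Fin 4,
    X f = lineLetter 8 c k → X g = lineLetter 8 c' k' → 1 ≤ c → 1 ≤ c' → k = k' := by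
  intro X hX f g c c' k k' e e' hc hc'
  obtain ⟨j, hj⟩ := fc8G1_letters X hX
  rw [phase_Lj (hj f) e hc, phase_Lj (hj g) e' hc']

set_option maxRecDepth 16384 in
/-- … without the bare hub `N(apex⁴)`. [kernel, `decide`] -/
theorem fc8G1_bare : ∀ N ∈ FC8G1.lower, ∃ f, ¬ isApex (N f) := by
  decide +kernel

/-- **`FC8G1` IS STATIC-CLOSED** (RULE D, `X−`, `X+`, `A2I−`, `A2I+`). -/
theorem fc8G1_static : RuleDMu4Closed FC8G1 ∧ XresFourClosed FC8G1 :=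
  ⟨fc8G1_ruleD, (xresFour_iff_xplus fc8G1_lsupport).2 (xplus_of_cellwisePure fc8G1_lsupport fc8G1_cellwise fc8G1_bare)⟩

set_option maxRecDepth 16384 in
/-- **`FC8G1` IS `Δ`-CLOSED** (both levels). [kernel, `decide`] -/
theorem fc8G1_deltaClosed : (∀ X ∈ FC8G1.lower, dCell X ∈ FC8G1.lower) ∧ (∀ X ∈ FC8G1.upper, dCell X ∈ FC8G1.upper) := by
  refine ⟨?_, ?_⟩ <;> decide +kernel

/-- the factor transposition `(0 1)` … -/
abbrev t01 : Fin 4 → Fin 4 := ![1, 0, 2, 3]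
/-- … `(1 2)` … -/
abbrev t12 : Fin 4 → Fin 4 := ![0, 2, 1, 3]
/-- … `(2 3)` (together they generate `S₄`). -/
abbrev t23 : Fin 4 → Fin 4 := ![0, 1, 3, 2]

set_option maxRecDepth 16384 in
set_option maxHeartbeats 4000000 in
/-- **`FC8G1` IS `S₄`-CLOSED**: closed under the generating factor transpositions `(0 1)`, `(1 2)`, `(2 3)` (both levels).
[kernel, `decide`] -/
theorem fc8G1_permClosed :
    ((∀ X ∈ FC8G1.lower, (fun f => X (t01 f)) ∈ FC8G1.lower) ∧ (∀ X ∈ FC8G1.upper, (fun f => X (t01 f)) ∈ FC8G1.upper)) ∧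
    ((∀ X ∈ FC8G1.lower, (fun f => X (t12 f)) ∈ FC8G1.lower) ∧ (∀ X ∈ FC8G1.upper, (fun f => X (t12 f)) ∈ FC8G1.upper)) ∧
    ((∀ X ∈ FC8G1.lower, (fun f => X (t23 f)) ∈ FC8G1.lower) ∧ (∀ X ∈ FC8G1.upper, (fun f => X (t23 f)) ∈ FC8G1.upper)) := by
  refine ⟨⟨?_, ?_⟩, ⟨?_, ?_⟩, ⟨?_, ?_⟩⟩ <;> decide +kernel

set_option maxRecDepth 16384 in
/-- `FC8G1` contains all four diagonal unit cells `[6I+ℓ_u]⁴` as `P`-cells. [kernel, `decide`] -/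
theorem fc8G1_diag : ∀ u : Fin 4, (fun _ : Fin 4 => lineLetter 8 1 u) ∈ FC8G1.upper := by
  decide +kernel

/-- **THE `G₁` SEPARATION**: a `G₁ = ⟨Δ⟩ × S₄`-closed, RULE-D-closed, four-family-closed LINE-8 support containing fully charged cells
EXISTS — so no `G₁`-invariant static argument can kill the diagonal unit cells on the LINE (cf. census (W) j310554) — while by `line_inertia`
it is NOT sibling-closed: adjoining the `Σ ≡ 0` phase shifts (control's `G`) destroys static closure. -/
theorem fc8G1_separates : (∀ u : Fin 4, (fun _ : Fin 4 => lineLetter 8 1 u) ∈ FC8G1.upper ∧ FCCell (fun _ : Fin 4 => lineLetter 8 1 u)) ∧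
    ¬ SibClosed 8 FC8G1 := by
  have hfc : ∀ u : Fin 4, FCCell (fun _ : Fin 4 => lineLetter 8 1 u) := by decide
  refine ⟨fun u => ⟨fc8G1_diag u, hfc u⟩, fun hS => ?_⟩
  have hX : u1111 ∈ FC8G1.upper := fc8_sub.2 (by simp [FC8, FC8P])
  have hfc1 : FCCell u1111 := by decide
  exact line_inertia fc8G1_lsupport fc8G1_ruleD (xplus_of_cellwisePure fc8G1_lsupport fc8G1_cellwise fc8G1_bare) hS u1111
    (Finset.mem_union_right _ hX) ⟨0, 1, by decide, hfc1 0, hfc1 1⟩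

end Separating


/-! ## §10 The STATIC LINE SKELETON (the critic's Q-crit, l.8975): sibling-closed static-closed LINE supports are NOT apex-only —
the singly charged skeleton `{N(c∣apex³) : c ≤ n−1} ∪ {P(c∣apex³) : c = 0 or 2 ≤ c ≤ n}` (all phases, all factors; 2n classes) is
RULE-D-closed, four-family-closed and SIBLING-CLOSED (kernel at h = 6: 66 cells, h = 8: 98 cells = check-static-1 batch 59 rows 472a–d,
the hull fixed point S∞(h) ×2). So `line_inertia`'s class is non-trivial and its conclusion «no MULTIPLY charged cell» is the sharp one. -/

section Skeleton

/-- the phase ADVANCE `k ↦ k+1` on letters: `β ↦ −i·β` in the `(Re, Im)` coordinates of `lineLetter` (inverse of `dPt`). -/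
abbrev aPt (x : BPoint) : BPoint := (x.1, x.2.2, -x.2.1)

/-- `aPt` advances the phase of a LINE letter. -/
theorem aPt_lineLetter (h : ℤ) (c : ℕ) (k : Fin 4) : aPt (lineLetter h c k) = lineLetter h c (k + 1) := by
  fin_cases k <;> simp [aPt, lineLetter]

/-- a decidable sufficient condition for `SibClosed`: every `P`-cell's charged letters may be phase-advanced one at a time. -/
theorem sibClosed_of_advance {h : ℤ} {C : MConfig}
    (hadv : ∀ P ∈ C.upper, ∀ σ : Fin 4, ¬ isApex (P σ) → Function.update P σ (aPt (P σ)) ∈ C.upper) : SibClosed h C := by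
  intro P hP σ f _ _ c k hc e
  have hna : ¬ isApex (P σ) := by rw [e, isApex_lineLetter_iff]; omega
  have := hadv P hP σ hna
  rw [e, aPt_lineLetter] at this
  exact this

/-- **COMPANION-BLOCKED LINE SUPPORTS ARE `X+`-CLOSED**: if every charged `P`-letter `(c,k)` on a factor `σ` has `c ≥ 2` and the `N`-cell
`P(σ ↦ (1,k))` is present, no `X+` clause fires — over an apex hub letter the sibling head `N₀(σ ↦ (e,k″))`, `e ≥ 2`, has the
`w`-companion `N₀(σ ↦ (1,k″))` strictly between, so (H-d) fails; over a charged hub letter both heads carry its phase (`up_classify`). -/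
theorem xplus_of_companions {h : ℤ} {C : MConfig} (hC : LSupport h C)
    (hcomp : ∀ P ∈ C.upper, ∀ σ : Fin 4, ∀ c : ℕ, ∀ k : Fin 4, 2 * (c : ℤ) ≤ h → 1 ≤ c → P σ = lineLetter h c k →
      2 ≤ c ∧ Function.update P σ (lineLetter h 1 k) ∈ C.lower) : XPlusClosed C := by
  intro Z hZ q hq n hn σ u w f hF
  obtain ⟨hna, -, hZq, -, hwu, hsib, hnc, -⟩ := hF
  have hP : dualCell 0 Z ∈ C.upper := mem_dual_lower.mp hZ
  have hN : dualCell 0 q ∈ C.lower := mem_dual_upper.mp hq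
  have hP' : dualCell 0 n ∈ C.upper := mem_dual_lower.mp hn
  obtain ⟨cP, kP, hcP, hPσ⟩ := hC.2 _ hP σ
  obtain ⟨cN, kN, -, hNσ⟩ := hC.1 _ hN σ
  obtain ⟨cP', kP', hcP', hP'σ⟩ := hC.2 _ hP' σ
  have hZσ : Z σ = dualPt 0 (lineLetter h cP kP) := by rw [← hPσ]; exact eq_dualPt_dualCell Z σ
  have hc : 1 ≤ cP := by
    by_contra h0
    exact hna (hZσ ▸ (isApex_dual 0 _).2 ((isApex_lineLetter_iff h cP kP).2 (by omega)))
  rw [← dualCell_dualCell 0 Z, ← dualCell_dualCell 0 q] at hZq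
  obtain ⟨-, hlt, hray⟩ := (uPartner_dual 0 _ _ σ u).mp hZq
  simp only [dualCell] at hlt hray
  change (dualCell 0 Z σ).1 < (dualCell 0 q σ).1 at hlt
  change dualCell 0 q σ = ray (dualCell 0 Z σ) u ((dualCell 0 q σ).1 - (dualCell 0 Z σ).1) at hray
  rw [hPσ, hNσ] at hlt hray
  obtain ⟨hu, -, h3⟩ := up_classify (by omega) hray
  obtain ⟨hagn, hlt', hray'⟩ := hsib
  have hqσ : q σ = dualPt 0 (lineLetter h cN kN) := by rw [← hNσ]; exact eq_dualPt_dualCell q σ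
  have hnσ : n σ = dualPt 0 (lineLetter h cP' kP') := by rw [← hP'σ]; exact eq_dualPt_dualCell n σ
  rw [hqσ, hnσ] at hlt' hray'
  obtain ⟨hlt'', hray''⟩ := (ray_dual_iff 0 (lineLetter h cN kN) (lineLetter h cP' kP') w).mp ⟨hlt', hray'⟩
  obtain ⟨hw, h2', h3'⟩ := up_classify (by omega) hray''
  have hc' : 1 ≤ cP' := by omega
  have hkk : kP ≠ kP' := fun e => hwu (by rw [hw, hu, e])
  -- over a charged hub letter both heads carry its phase
  have hcN : cN = 0 := by
    rcases h3 with h3 | h3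
    · exact h3
    rcases h3' with h3' | h3'
    · exact h3'
    exact absurd (h3.symm.trans h3') hkk
  subst hcN
  -- the companion `N' = P'(σ ↦ (1, kP'))`
  obtain ⟨h2le, hN'⟩ := hcomp _ hP' σ cP' kP' hcP' hc' hP'σ
  set N' : MCell := Function.update (dualCell 0 n) σ (lineLetter h 1 kP') with hN'def
  have hmem : dualCell 0 N' ∈ (C.dual 0).upper := dualCell_mem_dual_upper hN'
  have hag : MAgree (dualCell 0 N') q σ := by
    intro g hg
    show dualPt 0 (N' g) = q g
    rw [hN'def, Function.update_of_ne hg]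
    show dualPt 0 (dualPt 0 (n g)) = q g
    rw [dualPt_dualPt]; exact hagn g hg
  have hN'σ : dualCell 0 N' σ = dualPt 0 (lineLetter h 1 kP') := by
    show dualPt 0 (N' σ) = _
    rw [hN'def, Function.update_self]
  have h1 : (q σ).1 < (dualCell 0 N' σ).1 := by
    rw [hqσ, hN'σ]; simp [lineLetter]
  have h2 : (dualCell 0 N' σ).1 < (n σ).1 := by
    rw [hnσ, hN'σ]; simp [lineLetter]; omega
  refine hnc _ hmem hag h1 h2 ?_
  rw [hN'σ, hqσ, lineLetter_zero, hw]
  have e1 := dual_lineLetter h 1 kP'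
  have hd : (dualPt 0 (lineLetter h 1 kP')).1 - (dualPt 0 ((h, 0, 0) : BPoint)).1 = 1 := by simp [lineLetter]
  rw [hd]; exact_mod_cast e1


/-- apex `6I`. -/
abbrev a6 : BPoint := (6, 0, 0)

/-- `N(apex⁴)` at `h = 6`. -/
def k6n0 : MCell := mcellOf a6 a6 a6 a6

/-- `P(apex⁴)` at `h = 6`. -/
def k6p0 : MCell := mcellOf a6 a6 a6 a6

/-- `N(1_0@0 ∣ apex³)` at `h = 6`. -/
def k6n100 : MCell := mcellOf (lineLetter 6 1 0) a6 a6 a6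

/-- `N(1_0@1 ∣ apex³)` at `h = 6`. -/
def k6n101 : MCell := mcellOf a6 (lineLetter 6 1 0) a6 a6

/-- `N(1_0@2 ∣ apex³)` at `h = 6`. -/
def k6n102 : MCell := mcellOf a6 a6 (lineLetter 6 1 0) a6

/-- `N(1_0@3 ∣ apex³)` at `h = 6`. -/
def k6n103 : MCell := mcellOf a6 a6 a6 (lineLetter 6 1 0)

/-- `N(1_1@0 ∣ apex³)` at `h = 6`. -/
def k6n110 : MCell := mcellOf (lineLetter 6 1 1) a6 a6 a6

/-- `N(1_1@1 ∣ apex³)` at `h = 6`. -/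
def k6n111 : MCell := mcellOf a6 (lineLetter 6 1 1) a6 a6

/-- `N(1_1@2 ∣ apex³)` at `h = 6`. -/
def k6n112 : MCell := mcellOf a6 a6 (lineLetter 6 1 1) a6

/-- `N(1_1@3 ∣ apex³)` at `h = 6`. -/
def k6n113 : MCell := mcellOf a6 a6 a6 (lineLetter 6 1 1)

/-- `N(1_2@0 ∣ apex³)` at `h = 6`. -/
def k6n120 : MCell := mcellOf (lineLetter 6 1 2) a6 a6 a6

/-- `N(1_2@1 ∣ apex³)` at `h = 6`. -/
def k6n121 : MCell := mcellOf a6 (lineLetter 6 1 2) a6 a6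

/-- `N(1_2@2 ∣ apex³)` at `h = 6`. -/
def k6n122 : MCell := mcellOf a6 a6 (lineLetter 6 1 2) a6

/-- `N(1_2@3 ∣ apex³)` at `h = 6`. -/
def k6n123 : MCell := mcellOf a6 a6 a6 (lineLetter 6 1 2)

/-- `N(1_3@0 ∣ apex³)` at `h = 6`. -/
def k6n130 : MCell := mcellOf (lineLetter 6 1 3) a6 a6 a6

/-- `N(1_3@1 ∣ apex³)` at `h = 6`. -/
def k6n131 : MCell := mcellOf a6 (lineLetter 6 1 3) a6 a6

/-- `N(1_3@2 ∣ apex³)` at `h = 6`. -/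
def k6n132 : MCell := mcellOf a6 a6 (lineLetter 6 1 3) a6

/-- `N(1_3@3 ∣ apex³)` at `h = 6`. -/
def k6n133 : MCell := mcellOf a6 a6 a6 (lineLetter 6 1 3)

/-- `N(2_0@0 ∣ apex³)` at `h = 6`. -/
def k6n200 : MCell := mcellOf (lineLetter 6 2 0) a6 a6 a6

/-- `N(2_0@1 ∣ apex³)` at `h = 6`. -/
def k6n201 : MCell := mcellOf a6 (lineLetter 6 2 0) a6 a6

/-- `N(2_0@2 ∣ apex³)` at `h = 6`. -/
def k6n202 : MCell := mcellOf a6 a6 (lineLetter 6 2 0) a6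

/-- `N(2_0@3 ∣ apex³)` at `h = 6`. -/
def k6n203 : MCell := mcellOf a6 a6 a6 (lineLetter 6 2 0)

/-- `N(2_1@0 ∣ apex³)` at `h = 6`. -/
def k6n210 : MCell := mcellOf (lineLetter 6 2 1) a6 a6 a6

/-- `N(2_1@1 ∣ apex³)` at `h = 6`. -/
def k6n211 : MCell := mcellOf a6 (lineLetter 6 2 1) a6 a6

/-- `N(2_1@2 ∣ apex³)` at `h = 6`. -/
def k6n212 : MCell := mcellOf a6 a6 (lineLetter 6 2 1) a6

/-- `N(2_1@3 ∣ apex³)` at `h = 6`. -/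
def k6n213 : MCell := mcellOf a6 a6 a6 (lineLetter 6 2 1)

/-- `N(2_2@0 ∣ apex³)` at `h = 6`. -/
def k6n220 : MCell := mcellOf (lineLetter 6 2 2) a6 a6 a6

/-- `N(2_2@1 ∣ apex³)` at `h = 6`. -/
def k6n221 : MCell := mcellOf a6 (lineLetter 6 2 2) a6 a6

/-- `N(2_2@2 ∣ apex³)` at `h = 6`. -/
def k6n222 : MCell := mcellOf a6 a6 (lineLetter 6 2 2) a6

/-- `N(2_2@3 ∣ apex³)` at `h = 6`. -/
def k6n223 : MCell := mcellOf a6 a6 a6 (lineLetter 6 2 2)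

/-- `N(2_3@0 ∣ apex³)` at `h = 6`. -/
def k6n230 : MCell := mcellOf (lineLetter 6 2 3) a6 a6 a6

/-- `N(2_3@1 ∣ apex³)` at `h = 6`. -/
def k6n231 : MCell := mcellOf a6 (lineLetter 6 2 3) a6 a6

/-- `N(2_3@2 ∣ apex³)` at `h = 6`. -/
def k6n232 : MCell := mcellOf a6 a6 (lineLetter 6 2 3) a6

/-- `N(2_3@3 ∣ apex³)` at `h = 6`. -/
def k6n233 : MCell := mcellOf a6 a6 a6 (lineLetter 6 2 3)

/-- `P(2_0@0 ∣ apex³)` at `h = 6`. -/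
def k6p200 : MCell := mcellOf (lineLetter 6 2 0) a6 a6 a6

/-- `P(2_0@1 ∣ apex³)` at `h = 6`. -/
def k6p201 : MCell := mcellOf a6 (lineLetter 6 2 0) a6 a6

/-- `P(2_0@2 ∣ apex³)` at `h = 6`. -/
def k6p202 : MCell := mcellOf a6 a6 (lineLetter 6 2 0) a6

/-- `P(2_0@3 ∣ apex³)` at `h = 6`. -/
def k6p203 : MCell := mcellOf a6 a6 a6 (lineLetter 6 2 0)

/-- `P(2_1@0 ∣ apex³)` at `h = 6`. -/
def k6p210 : MCell := mcellOf (lineLetter 6 2 1) a6 a6 a6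

/-- `P(2_1@1 ∣ apex³)` at `h = 6`. -/
def k6p211 : MCell := mcellOf a6 (lineLetter 6 2 1) a6 a6

/-- `P(2_1@2 ∣ apex³)` at `h = 6`. -/
def k6p212 : MCell := mcellOf a6 a6 (lineLetter 6 2 1) a6

/-- `P(2_1@3 ∣ apex³)` at `h = 6`. -/
def k6p213 : MCell := mcellOf a6 a6 a6 (lineLetter 6 2 1)

/-- `P(2_2@0 ∣ apex³)` at `h = 6`. -/
def k6p220 : MCell := mcellOf (lineLetter 6 2 2) a6 a6 a6

/-- `P(2_2@1 ∣ apex³)` at `h = 6`. -/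
def k6p221 : MCell := mcellOf a6 (lineLetter 6 2 2) a6 a6

/-- `P(2_2@2 ∣ apex³)` at `h = 6`. -/
def k6p222 : MCell := mcellOf a6 a6 (lineLetter 6 2 2) a6

/-- `P(2_2@3 ∣ apex³)` at `h = 6`. -/
def k6p223 : MCell := mcellOf a6 a6 a6 (lineLetter 6 2 2)

/-- `P(2_3@0 ∣ apex³)` at `h = 6`. -/
def k6p230 : MCell := mcellOf (lineLetter 6 2 3) a6 a6 a6

/-- `P(2_3@1 ∣ apex³)` at `h = 6`. -/
def k6p231 : MCell := mcellOf a6 (lineLetter 6 2 3) a6 a6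

/-- `P(2_3@2 ∣ apex³)` at `h = 6`. -/
def k6p232 : MCell := mcellOf a6 a6 (lineLetter 6 2 3) a6

/-- `P(2_3@3 ∣ apex³)` at `h = 6`. -/
def k6p233 : MCell := mcellOf a6 a6 a6 (lineLetter 6 2 3)

/-- `P(3_0@0 ∣ apex³)` at `h = 6`. -/
def k6p300 : MCell := mcellOf (lineLetter 6 3 0) a6 a6 a6

/-- `P(3_0@1 ∣ apex³)` at `h = 6`. -/
def k6p301 : MCell := mcellOf a6 (lineLetter 6 3 0) a6 a6

/-- `P(3_0@2 ∣ apex³)` at `h = 6`. -/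
def k6p302 : MCell := mcellOf a6 a6 (lineLetter 6 3 0) a6

/-- `P(3_0@3 ∣ apex³)` at `h = 6`. -/
def k6p303 : MCell := mcellOf a6 a6 a6 (lineLetter 6 3 0)

/-- `P(3_1@0 ∣ apex³)` at `h = 6`. -/
def k6p310 : MCell := mcellOf (lineLetter 6 3 1) a6 a6 a6

/-- `P(3_1@1 ∣ apex³)` at `h = 6`. -/
def k6p311 : MCell := mcellOf a6 (lineLetter 6 3 1) a6 a6

/-- `P(3_1@2 ∣ apex³)` at `h = 6`. -/
def k6p312 : MCell := mcellOf a6 a6 (lineLetter 6 3 1) a6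

/-- `P(3_1@3 ∣ apex³)` at `h = 6`. -/
def k6p313 : MCell := mcellOf a6 a6 a6 (lineLetter 6 3 1)

/-- `P(3_2@0 ∣ apex³)` at `h = 6`. -/
def k6p320 : MCell := mcellOf (lineLetter 6 3 2) a6 a6 a6

/-- `P(3_2@1 ∣ apex³)` at `h = 6`. -/
def k6p321 : MCell := mcellOf a6 (lineLetter 6 3 2) a6 a6

/-- `P(3_2@2 ∣ apex³)` at `h = 6`. -/
def k6p322 : MCell := mcellOf a6 a6 (lineLetter 6 3 2) a6

/-- `P(3_2@3 ∣ apex³)` at `h = 6`. -/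
def k6p323 : MCell := mcellOf a6 a6 a6 (lineLetter 6 3 2)

/-- `P(3_3@0 ∣ apex³)` at `h = 6`. -/
def k6p330 : MCell := mcellOf (lineLetter 6 3 3) a6 a6 a6

/-- `P(3_3@1 ∣ apex³)` at `h = 6`. -/
def k6p331 : MCell := mcellOf a6 (lineLetter 6 3 3) a6 a6

/-- `P(3_3@2 ∣ apex³)` at `h = 6`. -/
def k6p332 : MCell := mcellOf a6 a6 (lineLetter 6 3 3) a6

/-- `P(3_3@3 ∣ apex³)` at `h = 6`. -/
def k6p333 : MCell := mcellOf a6 a6 a6 (lineLetter 6 3 3)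

/-- the 33 `N`-cells of `Skel6`. -/
def Skel6N : Finset MCell :=
  {k6n0, k6n100, k6n101, k6n102, k6n103, k6n110, k6n111, k6n112, k6n113, k6n120, k6n121, k6n122, k6n123, k6n130, k6n131, k6n132, k6n133, k6n200, k6n201, k6n202, k6n203, k6n210, k6n211, k6n212, k6n213, k6n220, k6n221, k6n222, k6n223, k6n230, k6n231, k6n232, k6n233}

/-- the 33 `P`-cells of `Skel6`. -/
def Skel6P : Finset MCell :=
  {k6p0, k6p200, k6p201, k6p202, k6p203, k6p210, k6p211, k6p212, k6p213, k6p220, k6p221, k6p222, k6p223, k6p230, k6p231, k6p232, k6p233, k6p300, k6p301, k6p302, k6p303, k6p310, k6p311, k6p312, k6p313, k6p320, k6p321, k6p322, k6p323, k6p330, k6p331, k6p332, k6p333}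

/-- **Skel6**: the static LINE-6 skeleton (66 cells). -/
def Skel6 : MConfig := ⟨Skel6N, Skel6P⟩

set_option maxRecDepth 16384 in
/-- the letters of `Skel6` are LINE-6 letters of charge `≤ 3`. [kernel, `decide`] -/
theorem skel6_letters : ∀ X ∈ Skel6.lower ∪ Skel6.upper, ∀ f, ∃ c : Fin 4, ∃ k : Fin 4, X f = lineLetter 6 c k := by
  decide +kernel

/-- `Skel6` is an effective LINE-6 support. -/
theorem skel6_lsupport : LSupport 6 Skel6 :=
  ⟨fun Z hZ f => by
    obtain ⟨c, k, e⟩ := skel6_letters Z (Finset.mem_union_left _ hZ) f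
    exact ⟨c, k, by have := c.isLt; omega, e⟩,
   fun P hP f => by
    obtain ⟨c, k, e⟩ := skel6_letters P (Finset.mem_union_right _ hP) f
    exact ⟨c, k, by have := c.isLt; omega, e⟩⟩

set_option synthInstance.maxSize 16384 in
set_option synthInstance.maxHeartbeats 4000000 in
set_option maxRecDepth 16384 in
/-- **`Skel6` IS RULE-D-CLOSED.** [kernel, `decide`] -/
theorem skel6_ruleD : RuleDMu4Closed Skel6 := by
  refine ⟨?_, ?_⟩ <;> decide +kernel

set_option maxRecDepth 16384 in
/-- no `P`-cell of `Skel6` has a charge-1 letter … [kernel, `decide`] -/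
theorem skel6_noP1 : ∀ P ∈ Skel6.upper, ∀ σ : Fin 4, ∀ k : Fin 4, P σ ≠ lineLetter 6 1 k := by
  decide +kernel

set_option maxRecDepth 16384 in
/-- … and under every charged `P`-letter the charge-1 `N`-cell of the same phase is present. [kernel, `decide`] -/
theorem skel6_comp : ∀ P ∈ Skel6.upper, ∀ σ : Fin 4, ∀ c : Fin 4, ∀ k : Fin 4, 2 ≤ (c : ℕ) → P σ = lineLetter 6 c k →
    Function.update P σ (lineLetter 6 1 k) ∈ Skel6.lower := by
  decide +kernel

/-- `Skel6` is `X+`-closed (by `xplus_of_companions`). -/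
theorem skel6_xplus : XPlusClosed Skel6 := by
  refine xplus_of_companions skel6_lsupport fun P hP σ c k hch hc e => ?_
  have hcn : c ≤ 3 := by omega
  have h2 : 2 ≤ c := by
    by_contra h1
    exact skel6_noP1 P hP σ k (by rw [e]; congr 1; omega)
  exact ⟨h2, skel6_comp P hP σ ⟨c, by omega⟩ k h2 e⟩

set_option maxRecDepth 16384 in
/-- every charged `P`-letter of `Skel6` may be phase-advanced. [kernel, `decide`] -/
theorem skel6_adv : ∀ P ∈ Skel6.upper, ∀ σ : Fin 4, ¬ isApex (P σ) → Function.update P σ (aPt (P σ)) ∈ Skel6.upper := by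
  decide +kernel

set_option maxRecDepth 16384 in
/-- **`Skel6` IS STATIC-CLOSED AND SIBLING-CLOSED AND CARRIES CHARGED LETTERS** — the hypotheses of `line_inertia` have non-trivial
models; what they exclude is exactly the MULTIPLY charged cells. -/
theorem skel6_answer : LSupport 6 Skel6 ∧ RuleDMu4Closed Skel6 ∧ XresFourClosed Skel6 ∧ SibClosed 6 Skel6 ∧
    (∃ X ∈ Skel6.lower ∪ Skel6.upper, ∃ f, ¬ isApex (X f)) ∧ (∀ X ∈ Skel6.lower ∪ Skel6.upper, ¬ MultCharged X) :=
  ⟨skel6_lsupport, skel6_ruleD, (xresFour_iff_xplus skel6_lsupport).2 skel6_xplus, sibClosed_of_advance skel6_adv,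
   ⟨k6n100, by decide +kernel, 0, by decide⟩,
   line_inertia skel6_lsupport skel6_ruleD skel6_xplus (sibClosed_of_advance skel6_adv)⟩


/-- apex `8I`. -/
abbrev a8 : BPoint := (8, 0, 0)

/-- `N(apex⁴)` at `h = 8`. -/
def k8n0 : MCell := mcellOf a8 a8 a8 a8

/-- `P(apex⁴)` at `h = 8`. -/
def k8p0 : MCell := mcellOf a8 a8 a8 a8

/-- `N(1_0@0 ∣ apex³)` at `h = 8`. -/
def k8n100 : MCell := mcellOf (lineLetter 8 1 0) a8 a8 a8

/-- `N(1_0@1 ∣ apex³)` at `h = 8`. -/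
def k8n101 : MCell := mcellOf a8 (lineLetter 8 1 0) a8 a8

/-- `N(1_0@2 ∣ apex³)` at `h = 8`. -/
def k8n102 : MCell := mcellOf a8 a8 (lineLetter 8 1 0) a8

/-- `N(1_0@3 ∣ apex³)` at `h = 8`. -/
def k8n103 : MCell := mcellOf a8 a8 a8 (lineLetter 8 1 0)

/-- `N(1_1@0 ∣ apex³)` at `h = 8`. -/
def k8n110 : MCell := mcellOf (lineLetter 8 1 1) a8 a8 a8

/-- `N(1_1@1 ∣ apex³)` at `h = 8`. -/
def k8n111 : MCell := mcellOf a8 (lineLetter 8 1 1) a8 a8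

/-- `N(1_1@2 ∣ apex³)` at `h = 8`. -/
def k8n112 : MCell := mcellOf a8 a8 (lineLetter 8 1 1) a8

/-- `N(1_1@3 ∣ apex³)` at `h = 8`. -/
def k8n113 : MCell := mcellOf a8 a8 a8 (lineLetter 8 1 1)

/-- `N(1_2@0 ∣ apex³)` at `h = 8`. -/
def k8n120 : MCell := mcellOf (lineLetter 8 1 2) a8 a8 a8

/-- `N(1_2@1 ∣ apex³)` at `h = 8`. -/
def k8n121 : MCell := mcellOf a8 (lineLetter 8 1 2) a8 a8

/-- `N(1_2@2 ∣ apex³)` at `h = 8`. -/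
def k8n122 : MCell := mcellOf a8 a8 (lineLetter 8 1 2) a8

/-- `N(1_2@3 ∣ apex³)` at `h = 8`. -/
def k8n123 : MCell := mcellOf a8 a8 a8 (lineLetter 8 1 2)

/-- `N(1_3@0 ∣ apex³)` at `h = 8`. -/
def k8n130 : MCell := mcellOf (lineLetter 8 1 3) a8 a8 a8

/-- `N(1_3@1 ∣ apex³)` at `h = 8`. -/
def k8n131 : MCell := mcellOf a8 (lineLetter 8 1 3) a8 a8

/-- `N(1_3@2 ∣ apex³)` at `h = 8`. -/
def k8n132 : MCell := mcellOf a8 a8 (lineLetter 8 1 3) a8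

/-- `N(1_3@3 ∣ apex³)` at `h = 8`. -/
def k8n133 : MCell := mcellOf a8 a8 a8 (lineLetter 8 1 3)

/-- `N(2_0@0 ∣ apex³)` at `h = 8`. -/
def k8n200 : MCell := mcellOf (lineLetter 8 2 0) a8 a8 a8

/-- `N(2_0@1 ∣ apex³)` at `h = 8`. -/
def k8n201 : MCell := mcellOf a8 (lineLetter 8 2 0) a8 a8

/-- `N(2_0@2 ∣ apex³)` at `h = 8`. -/
def k8n202 : MCell := mcellOf a8 a8 (lineLetter 8 2 0) a8

/-- `N(2_0@3 ∣ apex³)` at `h = 8`. -/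
def k8n203 : MCell := mcellOf a8 a8 a8 (lineLetter 8 2 0)

/-- `N(2_1@0 ∣ apex³)` at `h = 8`. -/
def k8n210 : MCell := mcellOf (lineLetter 8 2 1) a8 a8 a8

/-- `N(2_1@1 ∣ apex³)` at `h = 8`. -/
def k8n211 : MCell := mcellOf a8 (lineLetter 8 2 1) a8 a8

/-- `N(2_1@2 ∣ apex³)` at `h = 8`. -/
def k8n212 : MCell := mcellOf a8 a8 (lineLetter 8 2 1) a8

/-- `N(2_1@3 ∣ apex³)` at `h = 8`. -/
def k8n213 : MCell := mcellOf a8 a8 a8 (lineLetter 8 2 1)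

/-- `N(2_2@0 ∣ apex³)` at `h = 8`. -/
def k8n220 : MCell := mcellOf (lineLetter 8 2 2) a8 a8 a8

/-- `N(2_2@1 ∣ apex³)` at `h = 8`. -/
def k8n221 : MCell := mcellOf a8 (lineLetter 8 2 2) a8 a8

/-- `N(2_2@2 ∣ apex³)` at `h = 8`. -/
def k8n222 : MCell := mcellOf a8 a8 (lineLetter 8 2 2) a8

/-- `N(2_2@3 ∣ apex³)` at `h = 8`. -/
def k8n223 : MCell := mcellOf a8 a8 a8 (lineLetter 8 2 2)

/-- `N(2_3@0 ∣ apex³)` at `h = 8`. -/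
def k8n230 : MCell := mcellOf (lineLetter 8 2 3) a8 a8 a8

/-- `N(2_3@1 ∣ apex³)` at `h = 8`. -/
def k8n231 : MCell := mcellOf a8 (lineLetter 8 2 3) a8 a8

/-- `N(2_3@2 ∣ apex³)` at `h = 8`. -/
def k8n232 : MCell := mcellOf a8 a8 (lineLetter 8 2 3) a8

/-- `N(2_3@3 ∣ apex³)` at `h = 8`. -/
def k8n233 : MCell := mcellOf a8 a8 a8 (lineLetter 8 2 3)

/-- `N(3_0@0 ∣ apex³)` at `h = 8`. -/
def k8n300 : MCell := mcellOf (lineLetter 8 3 0) a8 a8 a8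

/-- `N(3_0@1 ∣ apex³)` at `h = 8`. -/
def k8n301 : MCell := mcellOf a8 (lineLetter 8 3 0) a8 a8

/-- `N(3_0@2 ∣ apex³)` at `h = 8`. -/
def k8n302 : MCell := mcellOf a8 a8 (lineLetter 8 3 0) a8

/-- `N(3_0@3 ∣ apex³)` at `h = 8`. -/
def k8n303 : MCell := mcellOf a8 a8 a8 (lineLetter 8 3 0)

/-- `N(3_1@0 ∣ apex³)` at `h = 8`. -/
def k8n310 : MCell := mcellOf (lineLetter 8 3 1) a8 a8 a8

/-- `N(3_1@1 ∣ apex³)` at `h = 8`. -/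
def k8n311 : MCell := mcellOf a8 (lineLetter 8 3 1) a8 a8

/-- `N(3_1@2 ∣ apex³)` at `h = 8`. -/
def k8n312 : MCell := mcellOf a8 a8 (lineLetter 8 3 1) a8

/-- `N(3_1@3 ∣ apex³)` at `h = 8`. -/
def k8n313 : MCell := mcellOf a8 a8 a8 (lineLetter 8 3 1)

/-- `N(3_2@0 ∣ apex³)` at `h = 8`. -/
def k8n320 : MCell := mcellOf (lineLetter 8 3 2) a8 a8 a8

/-- `N(3_2@1 ∣ apex³)` at `h = 8`. -/
def k8n321 : MCell := mcellOf a8 (lineLetter 8 3 2) a8 a8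

/-- `N(3_2@2 ∣ apex³)` at `h = 8`. -/
def k8n322 : MCell := mcellOf a8 a8 (lineLetter 8 3 2) a8

/-- `N(3_2@3 ∣ apex³)` at `h = 8`. -/
def k8n323 : MCell := mcellOf a8 a8 a8 (lineLetter 8 3 2)

/-- `N(3_3@0 ∣ apex³)` at `h = 8`. -/
def k8n330 : MCell := mcellOf (lineLetter 8 3 3) a8 a8 a8

/-- `N(3_3@1 ∣ apex³)` at `h = 8`. -/
def k8n331 : MCell := mcellOf a8 (lineLetter 8 3 3) a8 a8

/-- `N(3_3@2 ∣ apex³)` at `h = 8`. -/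
def k8n332 : MCell := mcellOf a8 a8 (lineLetter 8 3 3) a8

/-- `N(3_3@3 ∣ apex³)` at `h = 8`. -/
def k8n333 : MCell := mcellOf a8 a8 a8 (lineLetter 8 3 3)

/-- `P(2_0@0 ∣ apex³)` at `h = 8`. -/
def k8p200 : MCell := mcellOf (lineLetter 8 2 0) a8 a8 a8

/-- `P(2_0@1 ∣ apex³)` at `h = 8`. -/
def k8p201 : MCell := mcellOf a8 (lineLetter 8 2 0) a8 a8

/-- `P(2_0@2 ∣ apex³)` at `h = 8`. -/
def k8p202 : MCell := mcellOf a8 a8 (lineLetter 8 2 0) a8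

/-- `P(2_0@3 ∣ apex³)` at `h = 8`. -/
def k8p203 : MCell := mcellOf a8 a8 a8 (lineLetter 8 2 0)

/-- `P(2_1@0 ∣ apex³)` at `h = 8`. -/
def k8p210 : MCell := mcellOf (lineLetter 8 2 1) a8 a8 a8

/-- `P(2_1@1 ∣ apex³)` at `h = 8`. -/
def k8p211 : MCell := mcellOf a8 (lineLetter 8 2 1) a8 a8

/-- `P(2_1@2 ∣ apex³)` at `h = 8`. -/
def k8p212 : MCell := mcellOf a8 a8 (lineLetter 8 2 1) a8

/-- `P(2_1@3 ∣ apex³)` at `h = 8`. -/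
def k8p213 : MCell := mcellOf a8 a8 a8 (lineLetter 8 2 1)

/-- `P(2_2@0 ∣ apex³)` at `h = 8`. -/
def k8p220 : MCell := mcellOf (lineLetter 8 2 2) a8 a8 a8

/-- `P(2_2@1 ∣ apex³)` at `h = 8`. -/
def k8p221 : MCell := mcellOf a8 (lineLetter 8 2 2) a8 a8

/-- `P(2_2@2 ∣ apex³)` at `h = 8`. -/
def k8p222 : MCell := mcellOf a8 a8 (lineLetter 8 2 2) a8

/-- `P(2_2@3 ∣ apex³)` at `h = 8`. -/
def k8p223 : MCell := mcellOf a8 a8 a8 (lineLetter 8 2 2)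

/-- `P(2_3@0 ∣ apex³)` at `h = 8`. -/
def k8p230 : MCell := mcellOf (lineLetter 8 2 3) a8 a8 a8

/-- `P(2_3@1 ∣ apex³)` at `h = 8`. -/
def k8p231 : MCell := mcellOf a8 (lineLetter 8 2 3) a8 a8

/-- `P(2_3@2 ∣ apex³)` at `h = 8`. -/
def k8p232 : MCell := mcellOf a8 a8 (lineLetter 8 2 3) a8

/-- `P(2_3@3 ∣ apex³)` at `h = 8`. -/
def k8p233 : MCell := mcellOf a8 a8 a8 (lineLetter 8 2 3)

/-- `P(3_0@0 ∣ apex³)` at `h = 8`. -/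
def k8p300 : MCell := mcellOf (lineLetter 8 3 0) a8 a8 a8

/-- `P(3_0@1 ∣ apex³)` at `h = 8`. -/
def k8p301 : MCell := mcellOf a8 (lineLetter 8 3 0) a8 a8

/-- `P(3_0@2 ∣ apex³)` at `h = 8`. -/
def k8p302 : MCell := mcellOf a8 a8 (lineLetter 8 3 0) a8

/-- `P(3_0@3 ∣ apex³)` at `h = 8`. -/
def k8p303 : MCell := mcellOf a8 a8 a8 (lineLetter 8 3 0)

/-- `P(3_1@0 ∣ apex³)` at `h = 8`. -/
def k8p310 : MCell := mcellOf (lineLetter 8 3 1) a8 a8 a8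

/-- `P(3_1@1 ∣ apex³)` at `h = 8`. -/
def k8p311 : MCell := mcellOf a8 (lineLetter 8 3 1) a8 a8

/-- `P(3_1@2 ∣ apex³)` at `h = 8`. -/
def k8p312 : MCell := mcellOf a8 a8 (lineLetter 8 3 1) a8

/-- `P(3_1@3 ∣ apex³)` at `h = 8`. -/
def k8p313 : MCell := mcellOf a8 a8 a8 (lineLetter 8 3 1)

/-- `P(3_2@0 ∣ apex³)` at `h = 8`. -/
def k8p320 : MCell := mcellOf (lineLetter 8 3 2) a8 a8 a8

/-- `P(3_2@1 ∣ apex³)` at `h = 8`. -/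
def k8p321 : MCell := mcellOf a8 (lineLetter 8 3 2) a8 a8

/-- `P(3_2@2 ∣ apex³)` at `h = 8`. -/
def k8p322 : MCell := mcellOf a8 a8 (lineLetter 8 3 2) a8

/-- `P(3_2@3 ∣ apex³)` at `h = 8`. -/
def k8p323 : MCell := mcellOf a8 a8 a8 (lineLetter 8 3 2)

/-- `P(3_3@0 ∣ apex³)` at `h = 8`. -/
def k8p330 : MCell := mcellOf (lineLetter 8 3 3) a8 a8 a8

/-- `P(3_3@1 ∣ apex³)` at `h = 8`. -/
def k8p331 : MCell := mcellOf a8 (lineLetter 8 3 3) a8 a8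

/-- `P(3_3@2 ∣ apex³)` at `h = 8`. -/
def k8p332 : MCell := mcellOf a8 a8 (lineLetter 8 3 3) a8

/-- `P(3_3@3 ∣ apex³)` at `h = 8`. -/
def k8p333 : MCell := mcellOf a8 a8 a8 (lineLetter 8 3 3)

/-- `P(4_0@0 ∣ apex³)` at `h = 8`. -/
def k8p400 : MCell := mcellOf (lineLetter 8 4 0) a8 a8 a8

/-- `P(4_0@1 ∣ apex³)` at `h = 8`. -/
def k8p401 : MCell := mcellOf a8 (lineLetter 8 4 0) a8 a8

/-- `P(4_0@2 ∣ apex³)` at `h = 8`. -/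
def k8p402 : MCell := mcellOf a8 a8 (lineLetter 8 4 0) a8

/-- `P(4_0@3 ∣ apex³)` at `h = 8`. -/
def k8p403 : MCell := mcellOf a8 a8 a8 (lineLetter 8 4 0)

/-- `P(4_1@0 ∣ apex³)` at `h = 8`. -/
def k8p410 : MCell := mcellOf (lineLetter 8 4 1) a8 a8 a8

/-- `P(4_1@1 ∣ apex³)` at `h = 8`. -/
def k8p411 : MCell := mcellOf a8 (lineLetter 8 4 1) a8 a8

/-- `P(4_1@2 ∣ apex³)` at `h = 8`. -/
def k8p412 : MCell := mcellOf a8 a8 (lineLetter 8 4 1) a8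

/-- `P(4_1@3 ∣ apex³)` at `h = 8`. -/
def k8p413 : MCell := mcellOf a8 a8 a8 (lineLetter 8 4 1)

/-- `P(4_2@0 ∣ apex³)` at `h = 8`. -/
def k8p420 : MCell := mcellOf (lineLetter 8 4 2) a8 a8 a8

/-- `P(4_2@1 ∣ apex³)` at `h = 8`. -/
def k8p421 : MCell := mcellOf a8 (lineLetter 8 4 2) a8 a8

/-- `P(4_2@2 ∣ apex³)` at `h = 8`. -/
def k8p422 : MCell := mcellOf a8 a8 (lineLetter 8 4 2) a8

/-- `P(4_2@3 ∣ apex³)` at `h = 8`. -/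
def k8p423 : MCell := mcellOf a8 a8 a8 (lineLetter 8 4 2)

/-- `P(4_3@0 ∣ apex³)` at `h = 8`. -/
def k8p430 : MCell := mcellOf (lineLetter 8 4 3) a8 a8 a8

/-- `P(4_3@1 ∣ apex³)` at `h = 8`. -/
def k8p431 : MCell := mcellOf a8 (lineLetter 8 4 3) a8 a8

/-- `P(4_3@2 ∣ apex³)` at `h = 8`. -/
def k8p432 : MCell := mcellOf a8 a8 (lineLetter 8 4 3) a8

/-- `P(4_3@3 ∣ apex³)` at `h = 8`. -/
def k8p433 : MCell := mcellOf a8 a8 a8 (lineLetter 8 4 3)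

/-- the 49 `N`-cells of `Skel8`. -/
def Skel8N : Finset MCell :=
  {k8n0, k8n100, k8n101, k8n102, k8n103, k8n110, k8n111, k8n112, k8n113, k8n120, k8n121, k8n122, k8n123, k8n130, k8n131, k8n132, k8n133, k8n200, k8n201, k8n202, k8n203, k8n210, k8n211, k8n212, k8n213, k8n220, k8n221, k8n222, k8n223, k8n230, k8n231, k8n232, k8n233, k8n300, k8n301, k8n302, k8n303, k8n310, k8n311, k8n312, k8n313, k8n320, k8n321, k8n322, k8n323, k8n330, k8n331, k8n332, k8n333}

/-- the 49 `P`-cells of `Skel8`. -/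
def Skel8P : Finset MCell :=
  {k8p0, k8p200, k8p201, k8p202, k8p203, k8p210, k8p211, k8p212, k8p213, k8p220, k8p221, k8p222, k8p223, k8p230, k8p231, k8p232, k8p233, k8p300, k8p301, k8p302, k8p303, k8p310, k8p311, k8p312, k8p313, k8p320, k8p321, k8p322, k8p323, k8p330, k8p331, k8p332, k8p333, k8p400, k8p401, k8p402, k8p403, k8p410, k8p411, k8p412, k8p413, k8p420, k8p421, k8p422, k8p423, k8p430, k8p431, k8p432, k8p433}

/-- **Skel8**: the static LINE-8 skeleton (98 cells). -/
def Skel8 : MConfig := ⟨Skel8N, Skel8P⟩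

set_option maxRecDepth 16384 in
/-- the letters of `Skel8` are LINE-8 letters of charge `≤ 4`. [kernel, `decide`] -/
theorem skel8_letters : ∀ X ∈ Skel8.lower ∪ Skel8.upper, ∀ f, ∃ c : Fin 5, ∃ k : Fin 4, X f = lineLetter 8 c k := by
  decide +kernel

/-- `Skel8` is an effective LINE-8 support. -/
theorem skel8_lsupport : LSupport 8 Skel8 :=
  ⟨fun Z hZ f => by
    obtain ⟨c, k, e⟩ := skel8_letters Z (Finset.mem_union_left _ hZ) f
    exact ⟨c, k, by have := c.isLt; omega, e⟩,
   fun P hP f => by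
    obtain ⟨c, k, e⟩ := skel8_letters P (Finset.mem_union_right _ hP) f
    exact ⟨c, k, by have := c.isLt; omega, e⟩⟩

set_option synthInstance.maxSize 16384 in
set_option synthInstance.maxHeartbeats 4000000 in
set_option maxRecDepth 16384 in
/-- **`Skel8` IS RULE-D-CLOSED.** [kernel, `decide`] -/
theorem skel8_ruleD : RuleDMu4Closed Skel8 := by
  refine ⟨?_, ?_⟩ <;> decide +kernel

set_option maxRecDepth 16384 in
/-- no `P`-cell of `Skel8` has a charge-1 letter … [kernel, `decide`] -/
theorem skel8_noP1 : ∀ P ∈ Skel8.upper, ∀ σ : Fin 4, ∀ k : Fin 4, P σ ≠ lineLetter 8 1 k := by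
  decide +kernel

set_option maxRecDepth 16384 in
/-- … and under every charged `P`-letter the charge-1 `N`-cell of the same phase is present. [kernel, `decide`] -/
theorem skel8_comp : ∀ P ∈ Skel8.upper, ∀ σ : Fin 4, ∀ c : Fin 5, ∀ k : Fin 4, 2 ≤ (c : ℕ) → P σ = lineLetter 8 c k →
    Function.update P σ (lineLetter 8 1 k) ∈ Skel8.lower := by
  decide +kernel

/-- `Skel8` is `X+`-closed (by `xplus_of_companions`). -/
theorem skel8_xplus : XPlusClosed Skel8 := by
  refine xplus_of_companions skel8_lsupport fun P hP σ c k hch hc e => ?_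
  have hcn : c ≤ 4 := by omega
  have h2 : 2 ≤ c := by
    by_contra h1
    exact skel8_noP1 P hP σ k (by rw [e]; congr 1; omega)
  exact ⟨h2, skel8_comp P hP σ ⟨c, by omega⟩ k h2 e⟩

set_option maxRecDepth 16384 in
/-- every charged `P`-letter of `Skel8` may be phase-advanced. [kernel, `decide`] -/
theorem skel8_adv : ∀ P ∈ Skel8.upper, ∀ σ : Fin 4, ¬ isApex (P σ) → Function.update P σ (aPt (P σ)) ∈ Skel8.upper := by
  decide +kernel

set_option maxRecDepth 16384 in
/-- **`Skel8` IS STATIC-CLOSED AND SIBLING-CLOSED AND CARRIES CHARGED LETTERS** — the hypotheses of `line_inertia` have non-trivial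
models; what they exclude is exactly the MULTIPLY charged cells. -/
theorem skel8_answer : LSupport 8 Skel8 ∧ RuleDMu4Closed Skel8 ∧ XresFourClosed Skel8 ∧ SibClosed 8 Skel8 ∧
    (∃ X ∈ Skel8.lower ∪ Skel8.upper, ∃ f, ¬ isApex (X f)) ∧ (∀ X ∈ Skel8.lower ∪ Skel8.upper, ¬ MultCharged X) :=
  ⟨skel8_lsupport, skel8_ruleD, (xresFour_iff_xplus skel8_lsupport).2 skel8_xplus, sibClosed_of_advance skel8_adv,
   ⟨k8n100, by decide +kernel, 0, by decide⟩,
   line_inertia skel8_lsupport skel8_ruleD skel8_xplus (sibClosed_of_advance skel8_adv)⟩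


end Skeleton

/-! ## §11 Translation along the apex axis (kernel, h-uniform): RULE D is translation invariant, so `FC8G1` translated up by
`h − 8` is, for EVERY `h ≥ 8`, a `G₁`-closed, RULE-D-closed, four-family-closed effective LINE-`h` support around the fully charged
diagonal unit cells `[(h−2)I+ℓ_u]⁴` — the h-UNIFORM `G₁` SEPARATION `fcLine_uniform`. -/

section Translation

/-- translation of a letter along the `α`-axis. -/
abbrev tPt (t : ℤ) (x : BPoint) : BPoint := (x.1 + t, x.2.1, x.2.2)

/-- … of a cell, factorwise. -/
abbrev tCell (t : ℤ) (X : MCell) : MCell := fun f => tPt t (X f)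

/-- … of a configuration. -/
abbrev transC (t : ℤ) (C : MConfig) : MConfig := ⟨C.lower.image (tCell t), C.upper.image (tCell t)⟩

theorem tPt_inj {t : ℤ} {x y : BPoint} : tPt t x = tPt t y ↔ x = y := by
  obtain ⟨a, b, c⟩ := x
  obtain ⟨a', b', c'⟩ := y
  simp [tPt, Prod.ext_iff]

theorem tCell_inj {t : ℤ} {X Y : MCell} : tCell t X = tCell t Y ↔ X = Y := by
  constructor
  · intro e; funext f; exact tPt_inj.mp (congrFun e f)
  · rintro rfl; rfl

theorem ray_tPt (t : ℤ) (x : BPoint) (k : Fin 4) (e : ℤ) : ray (tPt t x) k e = tPt t (ray x k e) := by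
  obtain ⟨a, b, c⟩ := x
  simp [ray, tPt, add_right_comm]

theorem coord_tPt (t : ℤ) (x : BPoint) (k : Fin 4) : coord (tPt t x) k = coord x k + t := by
  obtain ⟨a, b, c⟩ := x
  fin_cases k <;> simp [coord] <;> ring

theorem mAgree_trans {t : ℤ} {P Z : MCell} {σ : Fin 4} : MAgree (tCell t P) (tCell t Z) σ ↔ MAgree P Z σ := by
  simp only [MAgree, tCell, tPt_inj]

theorem mAgree2_trans {t : ℤ} {P Z : MCell} {g j : Fin 4} : MAgree2 (tCell t P) (tCell t Z) g j ↔ MAgree2 P Z g j := by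
  simp only [MAgree2, tCell, tPt_inj]

/-- a ray relation between letters is translation invariant. -/
theorem rayRel_trans (t : ℤ) (x y : BPoint) (k : Fin 4) :
    ((tPt t x).1 < (tPt t y).1 ∧ tPt t y = ray (tPt t x) k ((tPt t y).1 - (tPt t x).1)) ↔
      (x.1 < y.1 ∧ y = ray x k (y.1 - x.1)) := by
  have e1 : (tPt t y).1 - (tPt t x).1 = y.1 - x.1 := by show (y.1 + t) - (x.1 + t) = y.1 - x.1; ring
  rw [e1, ray_tPt, tPt_inj]
  show x.1 + t < y.1 + t ∧ _ ↔ _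
  constructor
  · rintro ⟨h1, h2⟩; exact ⟨by linarith, h2⟩
  · rintro ⟨h1, h2⟩; exact ⟨by linarith, h2⟩

theorem uPartner_trans {t : ℤ} {Z q : MCell} {σ k : Fin 4} : UPartner (tCell t Z) (tCell t q) σ k ↔ UPartner Z q σ k := by
  simp only [UPartner, mAgree_trans]
  exact and_congr_right fun _ => rayRel_trans t (q σ) (Z σ) k

theorem settledBelow_trans (t : ℤ) {C : MConfig} {Z : MCell} {f k : Fin 4} (h : SettledBelow C Z f k) :
    SettledBelow (transC t C) (tCell t Z) f k := by
  obtain ⟨r, hr, P, hP, hU⟩ := h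
  exact ⟨r, hr, tCell t P, Finset.mem_image_of_mem _ hP, uPartner_trans.2 hU⟩

theorem settledAbove_trans (t : ℤ) {C : MConfig} {P : MCell} {f k : Fin 4} (h : SettledAbove C P f k) :
    SettledAbove (transC t C) (tCell t P) f k := by
  obtain ⟨r, hr, N, hN, hU⟩ := h
  exact ⟨r, hr, tCell t N, Finset.mem_image_of_mem _ hN, uPartner_trans.2 hU⟩

theorem coveredBelow_trans (t : ℤ) {C : MConfig} {Z : MCell} {g k j k' : Fin 4} (h : CoveredBelow C Z g k j k') :
    CoveredBelow (transC t C) (tCell t Z) g k j k' := by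
  obtain ⟨a, b, hda, hdb, P, hP, hag, h1, h2, h3, h4⟩ := h
  refine ⟨a, b, hda, hdb, tCell t P, Finset.mem_image_of_mem _ hP, mAgree2_trans.2 hag, ?_⟩
  have hg := (rayRel_trans t (P g) (Z g) a).2 ⟨h1, h2⟩
  have hj := (rayRel_trans t (P j) (Z j) b).2 ⟨h3, h4⟩
  exact ⟨hg.1, hg.2, hj.1, hj.2⟩

theorem coveredAbove_trans (t : ℤ) {C : MConfig} {P : MCell} {g k j k' : Fin 4} (h : CoveredAbove C P g k j k') :
    CoveredAbove (transC t C) (tCell t P) g k j k' := by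
  obtain ⟨a, b, hda, hdb, N, hN, hag, h1, h2, h3, h4⟩ := h
  refine ⟨a, b, hda, hdb, tCell t N, Finset.mem_image_of_mem _ hN, mAgree2_trans.2 hag, ?_⟩
  have hg := (rayRel_trans t (P g) (N g) a).2 ⟨h1, h2⟩
  have hj := (rayRel_trans t (P j) (N j) b).2 ⟨h3, h4⟩
  exact ⟨hg.1, hg.2, hj.1, hj.2⟩

/-- **RULE D IS TRANSLATION INVARIANT** (`N`-cells) … -/
theorem ruleDMu4N_trans (t : ℤ) {C : MConfig} {Z : MCell} (hZ : RuleDMu4N C Z) : RuleDMu4N (transC t C) (tCell t Z) := by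
  intro g j hgj k k' hag haj hne
  have hne0 : coord (Z g) k ≠ coord (Z j) k' := by
    intro e; apply hne
    show coord (tPt t (Z g)) k = coord (tPt t (Z j)) k'
    rw [coord_tPt, coord_tPt, e]
  rcases hZ g j hgj k k' hag haj hne0 with h1 | h2 | h3
  · exact Or.inl (settledBelow_trans t h1)
  · exact Or.inr (Or.inl (settledBelow_trans t h2))
  · exact Or.inr (Or.inr (coveredBelow_trans t h3))

/-- … (`P`-cells). -/
theorem ruleDMu4P_trans (t : ℤ) {C : MConfig} {P : MCell} (hP : RuleDMu4P C P) : RuleDMu4P (transC t C) (tCell t P) := by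
  intro g j hgj k k' hag haj hne
  have hne0 : coord (P g) k ≠ coord (P j) k' := by
    intro e; apply hne
    show coord (tPt t (P g)) k = coord (tPt t (P j)) k'
    rw [coord_tPt, coord_tPt, e]
  rcases hP g j hgj k k' hag haj hne0 with h1 | h2 | h3
  · exact Or.inl (settledAbove_trans t h1)
  · exact Or.inr (Or.inl (settledAbove_trans t h2))
  · exact Or.inr (Or.inr (coveredAbove_trans t h3))

/-- **a RULE-D-closed configuration stays RULE-D-closed under translation along the apex axis.** -/
theorem ruleDMu4Closed_trans (t : ℤ) {C : MConfig} (h : RuleDMu4Closed C) : RuleDMu4Closed (transC t C) := by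
  refine ⟨fun Z hZ => ?_, fun P hP => ?_⟩
  · obtain ⟨Z₀, hZ₀, rfl⟩ := Finset.mem_image.mp hZ
    exact ruleDMu4N_trans t (h.1 Z₀ hZ₀)
  · obtain ⟨P₀, hP₀, rfl⟩ := Finset.mem_image.mp hP
    exact ruleDMu4P_trans t (h.2 P₀ hP₀)

/-- translation carries LINE-`h₀` letters to LINE-`(h₀ + t)` letters of the same charge and phase. -/
theorem tPt_lineLetter (t h₀ : ℤ) (c : ℕ) (k : Fin 4) : tPt t (lineLetter h₀ c k) = lineLetter (h₀ + t) c k := by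
  fin_cases k <;> simp [tPt, lineLetter] <;> ring

/-- an effective LINE-`h₀` support translated UP by `t ≥ 0` is an effective LINE-`(h₀ + t)` support. -/
theorem lsupport_trans {h₀ t : ℤ} (ht : 0 ≤ t) {C : MConfig} (hC : LSupport h₀ C) : LSupport (h₀ + t) (transC t C) := by
  refine ⟨fun Z hZ f => ?_, fun P hP f => ?_⟩
  · obtain ⟨Z₀, hZ₀, rfl⟩ := Finset.mem_image.mp hZ
    obtain ⟨c, k, hc, e⟩ := hC.1 Z₀ hZ₀ f
    exact ⟨c, k, by omega, by show tPt t (Z₀ f) = _; rw [e, tPt_lineLetter]⟩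
  · obtain ⟨P₀, hP₀, rfl⟩ := Finset.mem_image.mp hP
    obtain ⟨c, k, hc, e⟩ := hC.2 P₀ hP₀ f
    exact ⟨c, k, by omega, by show tPt t (P₀ f) = _; rw [e, tPt_lineLetter]⟩

/-- cellwise phase purity is translation invariant. -/
theorem cellwise_trans {h₀ t : ℤ} {C : MConfig}
    (hcw : ∀ X ∈ C.lower ∪ C.upper, ∀ f g : Fin 4, ∀ c c' : ℕ, ∀ k k' : Fin 4,
      X f = lineLetter h₀ c k → X g = lineLetter h₀ c' k' → 1 ≤ c → 1 ≤ c' → k = k') :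
    ∀ X ∈ (transC t C).lower ∪ (transC t C).upper, ∀ f g : Fin 4, ∀ c c' : ℕ, ∀ k k' : Fin 4,
      X f = lineLetter (h₀ + t) c k → X g = lineLetter (h₀ + t) c' k' → 1 ≤ c → 1 ≤ c' → k = k' := by
  intro X hX f g c c' k k' e e' hc hc'
  have hX' : ∃ X₀ ∈ C.lower ∪ C.upper, tCell t X₀ = X := by
    rcases Finset.mem_union.mp hX with hX | hX
    · obtain ⟨X₀, h₀, e₀⟩ := Finset.mem_image.mp hX; exact ⟨X₀, Finset.mem_union_left _ h₀, e₀⟩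
    · obtain ⟨X₀, h₀, e₀⟩ := Finset.mem_image.mp hX; exact ⟨X₀, Finset.mem_union_right _ h₀, e₀⟩
  obtain ⟨X₀, hX₀, rfl⟩ := hX'
  rw [← tPt_lineLetter] at e e'
  exact hcw X₀ hX₀ f g c c' k k' (tPt_inj.mp e) (tPt_inj.mp e') hc hc'

/-- «no bare hub» is translation invariant. -/
theorem bare_trans {t : ℤ} {C : MConfig} (hb : ∀ N ∈ C.lower, ∃ f, ¬ isApex (N f)) :
    ∀ N ∈ (transC t C).lower, ∃ f, ¬ isApex (N f) := by
  intro N hN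
  obtain ⟨N₀, hN₀, rfl⟩ := Finset.mem_image.mp hN
  obtain ⟨f, hf⟩ := hb N₀ hN₀
  exact ⟨f, hf⟩

/-- `Δ`-closure is translation invariant (translation commutes with `Δ`). -/
theorem deltaClosed_trans {t : ℤ} {S : Finset MCell} (hS : ∀ X ∈ S, dCell X ∈ S) : ∀ X ∈ S.image (tCell t), dCell X ∈ S.image (tCell t) := by
  intro X hX
  obtain ⟨X₀, hX₀, rfl⟩ := Finset.mem_image.mp hX
  exact Finset.mem_image.mpr ⟨dCell X₀, hS X₀ hX₀, by funext f; rfl⟩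

/-- closure under a factor permutation is translation invariant. -/
theorem permClosed_trans {t : ℤ} {S : Finset MCell} (π : Fin 4 → Fin 4) (hS : ∀ X ∈ S, (fun f => X (π f)) ∈ S) :
    ∀ X ∈ S.image (tCell t), (fun f => X (π f)) ∈ S.image (tCell t) := by
  intro X hX
  obtain ⟨X₀, hX₀, rfl⟩ := Finset.mem_image.mp hX
  exact Finset.mem_image.mpr ⟨fun f => X₀ (π f), hS X₀ hX₀, by funext f; rfl⟩

/-- **FCLine h** := `FC8G1` translated up by `h − 8`: a `G₁`-closed LINE-`h` configuration around the diagonal unit cells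
`[(h−2)I + ℓ_u]⁴`. -/
abbrev FCLine (h : ℤ) : MConfig := transC (h - 8) FC8G1

/-- **THE h-UNIFORM `G₁` SEPARATION (kernel, every `h ≥ 8`)**: `FCLine h` is an effective LINE-`h` support, `G₁ = ⟨Δ⟩ × S₄`-closed,
RULE-D-closed and closed for all four instance families, contains the four FULLY CHARGED diagonal unit cells `[(h−2)I+ℓ_u]⁴`, and is
NOT sibling-closed. So at EVERY height the H₁-static rules under `G₁` leave the ceiling-line diagonal unit cells alive; only the
`Σ ≡ 0` phase shifts (`line_inertia`) kill them. -/
theorem fcLine_uniform (h : ℤ) (hh : 8 ≤ h) :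
    LSupport h (FCLine h) ∧
    ((∀ X ∈ (FCLine h).lower, dCell X ∈ (FCLine h).lower) ∧ (∀ X ∈ (FCLine h).upper, dCell X ∈ (FCLine h).upper)) ∧
    ((∀ X ∈ (FCLine h).lower, (fun f => X (t01 f)) ∈ (FCLine h).lower) ∧ (∀ X ∈ (FCLine h).upper, (fun f => X (t01 f)) ∈ (FCLine h).upper) ∧
     (∀ X ∈ (FCLine h).lower, (fun f => X (t12 f)) ∈ (FCLine h).lower) ∧ (∀ X ∈ (FCLine h).upper, (fun f => X (t12 f)) ∈ (FCLine h).upper) ∧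
     (∀ X ∈ (FCLine h).lower, (fun f => X (t23 f)) ∈ (FCLine h).lower) ∧ (∀ X ∈ (FCLine h).upper, (fun f => X (t23 f)) ∈ (FCLine h).upper)) ∧
    RuleDMu4Closed (FCLine h) ∧ XresFourClosed (FCLine h) ∧
    (∀ u : Fin 4, (fun _ : Fin 4 => lineLetter h 1 u) ∈ (FCLine h).upper ∧ FCCell (fun _ : Fin 4 => lineLetter h 1 u)) ∧
    ¬ SibClosed h (FCLine h) := by
  have e8 : (8 : ℤ) + (h - 8) = h := by ring
  have hL : LSupport h (FCLine h) := by
    have := lsupport_trans (h₀ := 8) (t := h - 8) (by omega) fc8G1_lsupport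
    rwa [e8] at this
  have hcw := cellwise_trans (h₀ := 8) (t := h - 8) (C := FC8G1) fc8G1_cellwise
  rw [e8] at hcw
  have hX : XPlusClosed (FCLine h) := xplus_of_cellwisePure hL hcw (bare_trans fc8G1_bare)
  have hD : RuleDMu4Closed (FCLine h) := ruleDMu4Closed_trans _ fc8G1_ruleD
  have hdiag : ∀ u : Fin 4, (fun _ : Fin 4 => lineLetter h 1 u) ∈ (FCLine h).upper := fun u =>
    Finset.mem_image.mpr ⟨fun _ => lineLetter 8 1 u, fc8G1_diag u, by funext f; show tPt (h-8) (lineLetter 8 1 u) = _; rw [tPt_lineLetter, e8]⟩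
  have hfc : ∀ u : Fin 4, FCCell (fun _ : Fin 4 => lineLetter h 1 u) := fun u f => by
    rw [isApex_lineLetter_iff]; omega
  obtain ⟨⟨p1, p2⟩, ⟨p3, p4⟩, ⟨p5, p6⟩⟩ := fc8G1_permClosed
  refine ⟨hL, ⟨deltaClosed_trans fc8G1_deltaClosed.1, deltaClosed_trans fc8G1_deltaClosed.2⟩,
    ⟨permClosed_trans t01 p1, permClosed_trans t01 p2, permClosed_trans t12 p3, permClosed_trans t12 p4,
     permClosed_trans t23 p5, permClosed_trans t23 p6⟩,
    hD, (xresFour_iff_xplus hL).2 hX, fun u => ⟨hdiag u, hfc u⟩, fun hS => ?_⟩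
  exact line_inertia hL hD hX hS _ (Finset.mem_union_right _ (hdiag 0)) ⟨0, 1, by decide, hfc 0 0, hfc 0 1⟩

end Translation


/-! ## §12 The FC threshold (kernel, no symmetry): at `h = 6` the H₁-statics ALONE exclude fully charged LINE cells — the kernel
twin of check-static-1 b59 «LINE-6 FC UNSAT» — while from `h = 8` on they do not (`fcLine_uniform`): the least height at which a
RULE-D-closed, `X+`-closed effective LINE support can contain a fully charged cell is exactly `8`. -/

section Threshold

/-- core of `no_fc_line6`: the chain `1 → 2 → 3` — an FC `P`-cell's factor-0 hub is down-served on factor 1 by a charge-2 letter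
(charge 3 would be a top letter next to a charged factor), whose factor-2 hub is down-served on factor 1 by a charge-3 = top letter next
to the charged factor 3: contradiction with the TOP-LAYER LAW; an FC `N`-cell's down-server is an FC `P`-cell. (The three closed forms
enter as hypotheses; `no_fc_line6` instantiates them.) -/
theorem no_fc_line6_core {C : MConfig} (hC : LSupport 6 C)
    (top2 : ∀ P ∈ C.upper, ∀ s g u : Fin 4, g ≠ s → P s = lineLetter 6 3 u → isApex (P g))
    (pup : ∀ P ∈ C.upper, ∀ g : Fin 4, ∀ c : ℕ, ∀ k : Fin 4, P g = lineLetter 6 c k → 1 ≤ c →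
      ∃ N ∈ C.lower, ∃ c' : ℕ, c' < c ∧ N = Function.update P g (lineLetter 6 c' k))
    (ndown : ∀ Z ∈ C.lower, ∀ g j : Fin 4, g ≠ j → ∀ c cj : ℕ, ∀ k kj : Fin 4,
      Z g = lineLetter 6 c k → 1 ≤ c → Z j = lineLetter 6 cj kj → 1 ≤ cj →
      ∃ P ∈ C.upper, ∃ c' : ℕ, c < c' ∧ 2 * (c' : ℤ) ≤ 6 ∧ P = Function.update Z g (lineLetter 6 c' k)) :
    ∀ X ∈ C.lower ∪ C.upper, ¬ FCCell X := by
  -- charged letters of cells, with their charge ≥ 1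
  have chP : ∀ P ∈ C.upper, ∀ f, ¬ isApex (P f) → ∃ c : ℕ, ∃ k : Fin 4, 1 ≤ c ∧ P f = lineLetter 6 c k := by
    intro P hP f hna
    obtain ⟨c, k, -, e⟩ := hC.2 P hP f
    refine ⟨c, k, ?_, e⟩
    by_contra h0
    exact hna (e ▸ (isApex_lineLetter_iff 6 c k).2 (by omega))
  have chN : ∀ Z ∈ C.lower, ∀ f, ¬ isApex (Z f) → ∃ c : ℕ, ∃ k : Fin 4, 1 ≤ c ∧ Z f = lineLetter 6 c k := by
    intro Z hZ f hna
    obtain ⟨c, k, -, e⟩ := hC.1 Z hZ f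
    refine ⟨c, k, ?_, e⟩
    by_contra h0
    exact hna (e ▸ (isApex_lineLetter_iff 6 c k).2 (by omega))
  -- (1) no fully charged `P`-cell
  have noP : ∀ X ∈ C.upper, ¬ FCCell X := by
    intro X hX hfc
    obtain ⟨c0, k0, hc0, e0⟩ := chP X hX 0 (hfc 0)
    obtain ⟨c1, k1, hc1, e1⟩ := chP X hX 1 (hfc 1)
    obtain ⟨c2, k2, hc2, e2⟩ := chP X hX 2 (hfc 2)
    obtain ⟨c3, k3, hc3, e3⟩ := chP X hX 3 (hfc 3)
    -- up-server of factor 0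
    obtain ⟨N, hN, c', -, rfl⟩ := pup X hX 0 c0 k0 e0 hc0
    have hN1 : Function.update X 0 (lineLetter 6 c' k0) 1 = lineLetter 6 c1 k1 := by
      rw [Function.update_of_ne (by decide)]; exact e1
    have hN2 : Function.update X 0 (lineLetter 6 c' k0) 2 = lineLetter 6 c2 k2 := by
      rw [Function.update_of_ne (by decide)]; exact e2
    have hN3 : Function.update X 0 (lineLetter 6 c' k0) 3 = lineLetter 6 c3 k3 := by
      rw [Function.update_of_ne (by decide)]; exact e3
    -- down-server of N on factor 1 (factor 2 is also charged)
    obtain ⟨P', hP', c'', hlt, hle, rfl⟩ := ndown _ hN 1 2 (by decide) c1 c2 k1 k2 hN1 hc1 hN2 hc2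
    set N := Function.update X 0 (lineLetter 6 c' k0) with hNdef
    have hP'1 : Function.update N 1 (lineLetter 6 c'' k1) 1 = lineLetter 6 c'' k1 := Function.update_self ..
    have hP'2 : Function.update N 1 (lineLetter 6 c'' k1) 2 = lineLetter 6 c2 k2 := by
      rw [Function.update_of_ne (by decide)]; exact hN2
    have hP'3 : Function.update N 1 (lineLetter 6 c'' k1) 3 = lineLetter 6 c3 k3 := by
      rw [Function.update_of_ne (by decide)]; exact hN3
    -- `c'' = 3` is a top letter next to the charged factor 2: excluded
    have hc'' : c'' = 2 := by
      rcases (show c'' = 2 ∨ c'' = 3 by omega) with h | h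
      · exact h
      · exfalso
        subst h
        have := top2 _ hP' 1 2 k1 (by decide) hP'1
        rw [hP'2, isApex_lineLetter_iff] at this
        omega
    subst hc''
    -- up-server of P' on factor 2
    obtain ⟨N', hN', c3', -, rfl⟩ := pup _ hP' 2 c2 k2 hP'2 hc2
    set P' := Function.update N 1 (lineLetter 6 2 k1) with hP'def
    have hN'1 : Function.update P' 2 (lineLetter 6 c3' k2) 1 = lineLetter 6 2 k1 := by
      rw [Function.update_of_ne (by decide)]; exact hP'1
    have hN'3 : Function.update P' 2 (lineLetter 6 c3' k2) 3 = lineLetter 6 c3 k3 := by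
      rw [Function.update_of_ne (by decide)]; exact hP'3
    -- down-server of N' on factor 1 (factor 3 charged): its charge exceeds 2, so it is a top letter next to factor 3
    obtain ⟨P'', hP'', c4, hlt4, hle4, rfl⟩ := ndown _ hN' 1 3 (by decide) 2 c3 k1 k3 hN'1 (by norm_num) hN'3 hc3
    have hc4 : c4 = 3 := by omega
    subst hc4
    set N' := Function.update P' 2 (lineLetter 6 c3' k2) with hN'def
    have h1 : Function.update N' 1 (lineLetter 6 3 k1) 1 = lineLetter 6 3 k1 := Function.update_self ..
    have h3 : Function.update N' 1 (lineLetter 6 3 k1) 3 = lineLetter 6 c3 k3 := by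
      rw [Function.update_of_ne (by decide)]; exact hN'3
    have := top2 _ hP'' 1 3 k1 (by decide) h1
    rw [h3, isApex_lineLetter_iff] at this
    omega
  -- (2) no fully charged `N`-cell: its down-server on factor 0 would be a fully charged `P`-cell
  intro X hX hfc
  rcases Finset.mem_union.mp hX with hXN | hXP
  · obtain ⟨c0, k0, hc0, e0⟩ := chN X hXN 0 (hfc 0)
    obtain ⟨c1, k1, hc1, e1⟩ := chN X hXN 1 (hfc 1)
    obtain ⟨P, hP, c', hlt, -, rfl⟩ := ndown X hXN 0 1 (by decide) c0 c1 k0 k1 e0 hc0 e1 hc1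
    refine noP _ hP fun f => ?_
    by_cases hf : f = 0
    · subst hf; rw [Function.update_self, isApex_lineLetter_iff]; omega
    · rw [Function.update_of_ne hf]; exact hfc f
  · exact noP X hXP hfc


/-- **NO FULLY CHARGED LINE CELL AT h = 6** (kernel, no symmetry assumed): a RULE-D-closed, `X+`-closed configuration of effective
LINE-6 cells contains no fully charged cell at either level. With `fcLine_uniform` (FC cells inside `G₁`-closed static-closed LINE-`h`
supports for every `h ≥ 8`) this pins the FC THRESHOLD of the H₁-statics on the LINE at exactly `h = 8` — the kernel form of the census
pair «◇₆: no FC» (j309860) ∕ «◇₈: FC under G₁» ((W) j310554), restricted to the LINE alphabet. -/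
theorem no_fc_line6 {C : MConfig} (hC : LSupport 6 C) (hD : RuleDMu4Closed C) (hX : XPlusClosed C) :
    ∀ X ∈ C.lower ∪ C.upper, ¬ FCCell X := by
  have e : (2 * ((3 : ℕ) : ℤ)) = (6 : ℤ) := by norm_num
  have hC' : LSupport (2 * ((3 : ℕ) : ℤ)) C := by rw [e]; exact hC
  have top := (top_layer (n := 3) (by norm_num) hC' hD hX).2
  rw [e] at top
  exact no_fc_line6_core hC top
    (fun P hP g c k hg hc => p_up_server hC.1 (hC.2 P hP) (hD.2 P hP) hg hc)
    (fun Z hZ g j hgj c cj k kj hg hc hj hcj => n_down_server hC.2 (hD.1 Z hZ) hgj hg hc hj hcj)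

/-- the FC THRESHOLD in one statement: no FC cell in any static-closed effective LINE-6 support, an FC cell in a `G₁`-closed
static-closed effective LINE-`h` support for every `h ≥ 8`. -/
theorem fc_threshold :
    (∀ C : MConfig, LSupport 6 C → RuleDMu4Closed C → XPlusClosed C → ∀ X ∈ C.lower ∪ C.upper, ¬ FCCell X) ∧
    (∀ h : ℤ, 8 ≤ h → ∃ C : MConfig, LSupport h C ∧ RuleDMu4Closed C ∧ XresFourClosed C ∧
      (∀ X ∈ C.lower, dCell X ∈ C.lower) ∧ (∀ X ∈ C.upper, dCell X ∈ C.upper) ∧ ∃ X ∈ C.upper, FCCell X) :=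
  ⟨fun _ hC hD hX => no_fc_line6 hC hD hX, fun h hh => by
    obtain ⟨hL, ⟨hd1, hd2⟩, -, hD, hX4, hdiag, -⟩ := fcLine_uniform h hh
    exact ⟨FCLine h, hL, hD, hX4, hd1, hd2, _, (hdiag 0).1, (hdiag 0).2⟩⟩

end Threshold

/-! ## §13 Ψ₁ on the LINE and the Ψ₁ threshold (kernel): `Δ`-covariance of RULE D (structural); Ψ of a LINE cell = the product
of its charges; **FC + Ψ₁ impossible at h = 8** with NO symmetry (`no_fc_psi_line8`, twin of check-static-1 b59 row 473); the
LAYERED SIMPLEX `Simp10` and its `G₁`-orbit union, translated to every `h ≥ 10`: a `G₁`-closed, static-closed, Ψ₁-BALANCED effective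
LINE-`h` support with fully charged cells on both levels (`simpLine_uniform`) — the Ψ₁ threshold of the H₁-statics on the LINE is
exactly `h = 10` (`fc_psi_threshold`). -/

section PsiThreshold

/-- phase purity of a configuration of LINE-`h` cells: every charged letter has the phase `k₀`. -/
abbrev PhasePure (h : ℤ) (k₀ : Fin 4) (C : MConfig) : Prop :=
  ∀ X ∈ C.lower ∪ C.upper, ∀ f, ∀ c : ℕ, ∀ k : Fin 4, X f = lineLetter h c k → 1 ≤ c → k = k₀

/-- cellwise phase purity: the charged letters of each cell share one phase. -/
abbrev CellwisePure (h : ℤ) (C : MConfig) : Prop :=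
  ∀ X ∈ C.lower ∪ C.upper, ∀ f g : Fin 4, ∀ c c' : ℕ, ∀ k k' : Fin 4,
    X f = lineLetter h c k → X g = lineLetter h c' k' → 1 ≤ c → 1 ≤ c' → k = k'

/-- «no bare hub»: every `N`-cell has a charged letter. -/
abbrev NoBare (C : MConfig) : Prop := ∀ N ∈ C.lower, ∃ f, ¬ isApex (N f)

/-! ### §13.1 `Δ`-covariance of RULE D (structural): rotating every letter's phase (`β ↦ i·β`, `dPt`) shifts the frame index by
one (`coord (Δx) k = coord x (k+1)`, `Adapted (Δx) k ↔ Adapted x (k+1)`, rays `k ↦ k+3`), so partners, covers and settledness are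
carried along and `RuleDMu4Closed C → RuleDMu4Closed (Δ C)`. (This also re-derives §9's `fc8r*_ruleD` without `decide`.) -/

/-- the phase rotation of a configuration. -/
abbrev deltaC (C : MConfig) : MConfig := ⟨C.lower.image dCell, C.upper.image dCell⟩

theorem dPt_inj {x y : BPoint} : dPt x = dPt y ↔ x = y := by
  obtain ⟨a, b, c⟩ := x
  obtain ⟨a', b', c'⟩ := y
  simp [dPt, Prod.ext_iff, neg_inj]
  tauto

theorem fin4_r1 (r : Fin 4) : r + 3 + 1 = r := by revert r; decide
theorem fin4_r2 (r k : Fin 4) : r ≠ k + 1 + 2 → r + 3 ≠ k + 2 := by revert r k; decide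
theorem fin4_r3 (a k : Fin 4) : a = k + 1 → a + 3 = k := by revert a k; decide
theorem fin4_r4 (k : Fin 4) : k + 1 + 3 = k := by revert k; decide

theorem ray_dPt (x : BPoint) (k : Fin 4) (e : ℤ) : ray (dPt x) k e = dPt (ray x (k + 1) e) := by
  obtain ⟨a, b, c⟩ := x
  fin_cases k <;> simp [ray, dPt] <;> ring

theorem coord_dPt (x : BPoint) (k : Fin 4) : coord (dPt x) k = coord x (k + 1) := by
  obtain ⟨a, b, c⟩ := x
  fin_cases k <;> simp [coord]

theorem adapted_dPt (x : BPoint) (k : Fin 4) : Adapted (dPt x) k ↔ Adapted x (k + 1) := by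
  obtain ⟨a, b, c⟩ := x
  fin_cases k <;> simp [Adapted]

theorem isApex_dPt (x : BPoint) : isApex (dPt x) ↔ isApex x := by
  obtain ⟨a, b, c⟩ := x
  simp [isApex, and_comm]

theorem mAgree_delta {P Z : MCell} {σ : Fin 4} : MAgree (dCell P) (dCell Z) σ ↔ MAgree P Z σ := by
  simp only [MAgree, dCell, dPt_inj]

theorem mAgree2_delta {P Z : MCell} {g j : Fin 4} : MAgree2 (dCell P) (dCell Z) g j ↔ MAgree2 P Z g j := by
  simp only [MAgree2, dCell, dPt_inj]

/-- a ray relation in direction `a + 3` between rotated letters is the ray relation in direction `a` between the letters. -/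
theorem rayRel_delta (x y : BPoint) (a : Fin 4) :
    ((dPt x).1 < (dPt y).1 ∧ dPt y = ray (dPt x) (a + 3) ((dPt y).1 - (dPt x).1)) ↔ (x.1 < y.1 ∧ y = ray x a (y.1 - x.1)) := by
  rw [ray_dPt, fin4_r1, dPt_inj]

theorem uPartner_delta {Z q : MCell} {σ a : Fin 4} : UPartner (dCell Z) (dCell q) σ (a + 3) ↔ UPartner Z q σ a := by
  simp only [UPartner, mAgree_delta]
  exact and_congr_right fun _ => rayRel_delta (q σ) (Z σ) a

theorem settledBelow_delta {C : MConfig} {Z : MCell} {f k : Fin 4} (h : SettledBelow C Z f (k + 1)) :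
    SettledBelow (deltaC C) (dCell Z) f k := by
  obtain ⟨r, hr, P, hP, hU⟩ := h
  refine ⟨r + 3, fin4_r2 r k hr, dCell P, Finset.mem_image_of_mem _ hP, ?_⟩
  exact uPartner_delta.2 hU

theorem settledAbove_delta {C : MConfig} {P : MCell} {f k : Fin 4} (h : SettledAbove C P f (k + 1)) :
    SettledAbove (deltaC C) (dCell P) f k := by
  obtain ⟨r, hr, N, hN, hU⟩ := h
  refine ⟨r + 3, fin4_r2 r k hr, dCell N, Finset.mem_image_of_mem _ hN, ?_⟩
  exact uPartner_delta.2 hU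

theorem dirOK_delta {x : BPoint} {k a : Fin 4} (h : DirOK x (k + 1) a) : DirOK (dPt x) k (a + 3) := by
  rcases h with h | ⟨hap, hne⟩
  · exact Or.inl (fin4_r3 a k h)
  · exact Or.inr ⟨(isApex_dPt x).2 hap, fin4_r2 a k hne⟩

theorem coveredBelow_delta {C : MConfig} {Z : MCell} {g k j k' : Fin 4} (h : CoveredBelow C Z g (k + 1) j (k' + 1)) :
    CoveredBelow (deltaC C) (dCell Z) g k j k' := by
  obtain ⟨a, b, hda, hdb, P, hP, hag, h1, h2, h3, h4⟩ := h
  refine ⟨a + 3, b + 3, dirOK_delta hda, dirOK_delta hdb, dCell P, Finset.mem_image_of_mem _ hP, mAgree2_delta.2 hag, ?_⟩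
  have hg := (rayRel_delta (P g) (Z g) a).2 ⟨h1, h2⟩
  have hj := (rayRel_delta (P j) (Z j) b).2 ⟨h3, h4⟩
  exact ⟨hg.1, hg.2, hj.1, hj.2⟩

theorem coveredAbove_delta {C : MConfig} {P : MCell} {g k j k' : Fin 4} (h : CoveredAbove C P g (k + 1) j (k' + 1)) :
    CoveredAbove (deltaC C) (dCell P) g k j k' := by
  obtain ⟨a, b, hda, hdb, N, hN, hag, h1, h2, h3, h4⟩ := h
  refine ⟨a + 3, b + 3, dirOK_delta hda, dirOK_delta hdb, dCell N, Finset.mem_image_of_mem _ hN, mAgree2_delta.2 hag, ?_⟩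
  have hg := (rayRel_delta (P g) (N g) a).2 ⟨h1, h2⟩
  have hj := (rayRel_delta (P j) (N j) b).2 ⟨h3, h4⟩
  exact ⟨hg.1, hg.2, hj.1, hj.2⟩

/-- **RULE D IS `Δ`-COVARIANT** (`N`-cells): the frame index shifts by one. -/
theorem ruleDMu4N_delta {C : MConfig} {Z : MCell} (hZ : RuleDMu4N C Z) : RuleDMu4N (deltaC C) (dCell Z) := by
  intro g j hgj k k' hag haj hne
  have hag' : Adapted (Z g) (k + 1) := (adapted_dPt _ _).1 hag
  have haj' : Adapted (Z j) (k' + 1) := (adapted_dPt _ _).1 haj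
  have hne' : coord (Z g) (k + 1) ≠ coord (Z j) (k' + 1) := by
    intro e; apply hne
    show coord (dPt (Z g)) k = coord (dPt (Z j)) k'
    rw [coord_dPt, coord_dPt, e]
  rcases hZ g j hgj (k + 1) (k' + 1) hag' haj' hne' with h1 | h2 | h3
  · exact Or.inl (settledBelow_delta h1)
  · exact Or.inr (Or.inl (settledBelow_delta h2))
  · exact Or.inr (Or.inr (coveredBelow_delta h3))

/-- … (`P`-cells). -/
theorem ruleDMu4P_delta {C : MConfig} {P : MCell} (hP : RuleDMu4P C P) : RuleDMu4P (deltaC C) (dCell P) := by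
  intro g j hgj k k' hag haj hne
  have hag' : Adapted (P g) (k + 1) := (adapted_dPt _ _).1 hag
  have haj' : Adapted (P j) (k' + 1) := (adapted_dPt _ _).1 haj
  have hne' : coord (P g) (k + 1) ≠ coord (P j) (k' + 1) := by
    intro e; apply hne
    show coord (dPt (P g)) k = coord (dPt (P j)) k'
    rw [coord_dPt, coord_dPt, e]
  rcases hP g j hgj (k + 1) (k' + 1) hag' haj' hne' with h1 | h2 | h3
  · exact Or.inl (settledAbove_delta h1)
  · exact Or.inr (Or.inl (settledAbove_delta h2))
  · exact Or.inr (Or.inr (coveredAbove_delta h3))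

/-- **a RULE-D-closed configuration stays RULE-D-closed under the phase rotation `Δ`.** -/
theorem ruleDMu4Closed_delta {C : MConfig} (h : RuleDMu4Closed C) : RuleDMu4Closed (deltaC C) := by
  refine ⟨fun Z hZ => ?_, fun P hP => ?_⟩
  · obtain ⟨Z₀, hZ₀, rfl⟩ := Finset.mem_image.mp hZ
    exact ruleDMu4N_delta (h.1 Z₀ hZ₀)
  · obtain ⟨P₀, hP₀, rfl⟩ := Finset.mem_image.mp hP
    exact ruleDMu4P_delta (h.2 P₀ hP₀)

/-- `Δ` maps LINE-`h` letters to LINE-`h` letters of the same charge (phase `k ↦ k + 3`). -/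
theorem dPt_lineLetter (h : ℤ) (c : ℕ) (k : Fin 4) : dPt (lineLetter h c k) = lineLetter h c (k + 3) := by
  fin_cases k <;> simp [dPt, lineLetter]

theorem lsupport_delta {h : ℤ} {C : MConfig} (hC : LSupport h C) : LSupport h (deltaC C) := by
  refine ⟨fun Z hZ f => ?_, fun P hP f => ?_⟩
  · obtain ⟨Z₀, hZ₀, rfl⟩ := Finset.mem_image.mp hZ
    obtain ⟨c, k, hc, e⟩ := hC.1 Z₀ hZ₀ f
    exact ⟨c, k + 3, hc, by show dPt (Z₀ f) = _; rw [e, dPt_lineLetter]⟩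
  · obtain ⟨P₀, hP₀, rfl⟩ := Finset.mem_image.mp hP
    obtain ⟨c, k, hc, e⟩ := hC.2 P₀ hP₀ f
    exact ⟨c, k + 3, hc, by show dPt (P₀ f) = _; rw [e, dPt_lineLetter]⟩

/-! ### §13.2 Ψ on the LINE: `Ψ(X) = ∏_f c_f` for a LINE cell (`A_{fg} = 2 c_f c_g`), so Ψ ≥ 0, Ψ > 0 ⟺ fully charged, and the
encoder's Ψ₁-clause `PsiClause` says on a LINE support: a fully charged `P`-cell is present iff a fully charged `N`-cell is. -/


theorem lineLetter_normSq (h : ℤ) (c : ℕ) (k : Fin 4) :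
    ((lineLetter h c k).2.1 : ℚ) ^ 2 + ((lineLetter h c k).2.2 : ℚ) ^ 2 = (c : ℚ) ^ 2 := by
  fin_cases k <;> simp [lineLetter]

/-- **Ψ OF A LINE CELL IS THE PRODUCT OF ITS CHARGES** (`A_{fg} = 2 c_f c_g` for every pair). -/
theorem psiQ_line {h : ℤ} {X : MCell} {c : Fin 4 → ℕ} {k : Fin 4 → Fin 4} (hX : ∀ f, X f = lineLetter h (c f) (k f)) :
    X.psiQ = (c 0 : ℚ) * c 1 * c 2 * c 3 := by
  have h1 : (fun f => ((X f).1 : ℚ)) = fun f => (h : ℚ) - (c f : ℚ) := by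
    funext f; rw [hX f, lineLetter_fst]; push_cast; ring
  have h2 : (fun f => ((X f).2.1 : ℚ) ^ 2 + ((X f).2.2 : ℚ) ^ 2) = fun f => (c f : ℚ) ^ 2 := by
    funext f; rw [hX f]; exact lineLetter_normSq h (c f) (k f)
  unfold MCell.psiQ
  rw [h1, h2]
  simp only [psiForm, pairTerm]
  ring

/-- hence Ψ ≥ 0 on LINE cells, and Ψ > 0 exactly on the fully charged ones. -/
theorem psiQ_line_nonneg {h : ℤ} {X : MCell} (hX : ∀ f, IsLL h (X f)) : 0 ≤ X.psiQ := by
  choose c k _ e using hX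
  rw [psiQ_line e]; positivity

theorem psiQ_line_pos_iff {h : ℤ} {X : MCell} (hX : ∀ f, IsLL h (X f)) : 0 < X.psiQ ↔ FCCell X := by
  choose c k _ e using hX
  rw [psiQ_line e]
  have hfc : FCCell X ↔ ∀ f, c f ≠ 0 := by
    simp only [FCCell]
    exact forall_congr' fun f => by rw [e f, isApex_lineLetter_iff]
  rw [hfc]
  constructor
  · intro hp f hf
    have : (c 0 : ℚ) * c 1 * c 2 * c 3 = 0 := by
      fin_cases f <;> simp_all
    rw [this] at hp; exact lt_irrefl _ hp
  · intro hc
    have h0 : (0 : ℚ) < c 0 := by exact_mod_cast Nat.pos_of_ne_zero (hc 0)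
    have h1 : (0 : ℚ) < c 1 := by exact_mod_cast Nat.pos_of_ne_zero (hc 1)
    have h2 : (0 : ℚ) < c 2 := by exact_mod_cast Nat.pos_of_ne_zero (hc 2)
    have h3 : (0 : ℚ) < c 3 := by exact_mod_cast Nat.pos_of_ne_zero (hc 3)
    exact mul_pos (mul_pos (mul_pos h0 h1) h2) h3

/-- on a LINE support, Ψ₁ (`PsiClause`) makes a fully charged `P`-cell force a fully charged `N`-cell. -/
theorem fcN_of_fcP_psi {h : ℤ} {C : MConfig} (hC : LSupport h C) (hΨ : C.PsiClause) {X : MCell} (hX : X ∈ C.upper)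
    (hfc : FCCell X) : ∃ Z ∈ C.lower, FCCell Z := by
  have hneg : C.HasPsiNeg := Or.inr ⟨X, hX, (psiQ_line_pos_iff (hC.2 X hX)).2 hfc⟩
  rcases hΨ.2 hneg with ⟨Z, hZ, hpos⟩ | ⟨P, hP, hlt⟩
  · exact ⟨Z, hZ, (psiQ_line_pos_iff (hC.1 Z hZ)).1 hpos⟩
  · exact absurd hlt (not_lt.2 (psiQ_line_nonneg (hC.2 P hP)))

/-- conversely fully charged cells on both levels make Ψ₁ hold. -/
theorem psiClause_of_fc {h : ℤ} {C : MConfig} (hC : LSupport h C) (hN : ∃ Z ∈ C.lower, FCCell Z) (hP : ∃ P ∈ C.upper, FCCell P) :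
    C.PsiClause := by
  obtain ⟨Z, hZ, hZf⟩ := hN
  obtain ⟨P, hPm, hPf⟩ := hP
  exact ⟨fun _ => Or.inr ⟨P, hPm, (psiQ_line_pos_iff (hC.2 P hPm)).2 hPf⟩,
    fun _ => Or.inl ⟨Z, hZ, (psiQ_line_pos_iff (hC.1 Z hZ)).2 hZf⟩⟩

/-! ### §13.3 FC + Ψ₁ is impossible at `h = 8` (no symmetry): kernel twin of check-static-1 b59 «LINE-8: FC + Ψ₁ UNSAT». -/

/-- core of `no_fc_psi_line8` (closed forms as hypotheses): the CLIMB `2 → 3 → 4` on factor `0` of a fully charged `N`-cell's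
down-server, keeping factors `2, 3` charged, ends in a top letter next to a charged factor. -/
theorem no_fcN_line8_core {C : MConfig} (hC : LSupport 8 C)
    (top2 : ∀ P ∈ C.upper, ∀ s g u : Fin 4, g ≠ s → P s = lineLetter 8 4 u → isApex (P g))
    (pup : ∀ P ∈ C.upper, ∀ g : Fin 4, ∀ c : ℕ, ∀ k : Fin 4, P g = lineLetter 8 c k → 1 ≤ c →
      ∃ N ∈ C.lower, ∃ c' : ℕ, c' < c ∧ N = Function.update P g (lineLetter 8 c' k))
    (ndown : ∀ Z ∈ C.lower, ∀ g j : Fin 4, g ≠ j → ∀ c cj : ℕ, ∀ k kj : Fin 4,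
      Z g = lineLetter 8 c k → 1 ≤ c → Z j = lineLetter 8 cj kj → 1 ≤ cj →
      ∃ P ∈ C.upper, ∃ c' : ℕ, c < c' ∧ 2 * (c' : ℤ) ≤ 8 ∧ P = Function.update Z g (lineLetter 8 c' k)) :
    ∀ Z ∈ C.lower, ¬ FCCell Z := by
  have chN : ∀ Z ∈ C.lower, ∀ f, ¬ isApex (Z f) → ∃ c : ℕ, ∃ k : Fin 4, 1 ≤ c ∧ Z f = lineLetter 8 c k := by
    intro Z hZ f hna
    obtain ⟨c, k, -, e⟩ := hC.1 Z hZ f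
    refine ⟨c, k, ?_, e⟩
    by_contra h0
    exact hna (e ▸ (isApex_lineLetter_iff 8 c k).2 (by omega))
  intro Z hZ hfc
  obtain ⟨c0, k0, hc0, e0⟩ := chN Z hZ 0 (hfc 0)
  obtain ⟨c1, k1, hc1, e1⟩ := chN Z hZ 1 (hfc 1)
  obtain ⟨c2, k2, hc2, e2⟩ := chN Z hZ 2 (hfc 2)
  obtain ⟨c3, k3, hc3, e3⟩ := chN Z hZ 3 (hfc 3)
  -- down-server of factor 0 (factor 1 charged): charge a ∈ {2,3,4} on factor 0
  obtain ⟨P₁, hP₁, a, hlt, hle, rfl⟩ := ndown Z hZ 0 1 (by decide) c0 c1 k0 k1 e0 hc0 e1 hc1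
  have q0 : Function.update Z 0 (lineLetter 8 a k0) 0 = lineLetter 8 a k0 := Function.update_self ..
  have q1 : Function.update Z 0 (lineLetter 8 a k0) 1 = lineLetter 8 c1 k1 := by rw [Function.update_of_ne (by decide)]; exact e1
  have q2 : Function.update Z 0 (lineLetter 8 a k0) 2 = lineLetter 8 c2 k2 := by rw [Function.update_of_ne (by decide)]; exact e2
  have q3 : Function.update Z 0 (lineLetter 8 a k0) 3 = lineLetter 8 c3 k3 := by rw [Function.update_of_ne (by decide)]; exact e3
  have ha4 : a ≠ 4 := by
    rintro rfl
    have := top2 _ hP₁ 0 1 k0 (by decide) q0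
    rw [q1, isApex_lineLetter_iff] at this; omega
  set P₁ := Function.update Z 0 (lineLetter 8 a k0) with hP₁def
  -- up-server on factor 1, then down-server of factor 0 (factor 2 charged): charge a' ∈ {a+1..4}
  obtain ⟨N₁, hN₁, c1', -, rfl⟩ := pup _ hP₁ 1 c1 k1 q1 hc1
  have r0 : Function.update P₁ 1 (lineLetter 8 c1' k1) 0 = lineLetter 8 a k0 := by rw [Function.update_of_ne (by decide)]; exact q0
  have r2 : Function.update P₁ 1 (lineLetter 8 c1' k1) 2 = lineLetter 8 c2 k2 := by rw [Function.update_of_ne (by decide)]; exact q2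
  have r3 : Function.update P₁ 1 (lineLetter 8 c1' k1) 3 = lineLetter 8 c3 k3 := by rw [Function.update_of_ne (by decide)]; exact q3
  obtain ⟨P₂, hP₂, a', hlt', hle', rfl⟩ := ndown _ hN₁ 0 2 (by decide) a c2 k0 k2 r0 (by omega) r2 hc2
  set N₁ := Function.update P₁ 1 (lineLetter 8 c1' k1) with hN₁def
  have s0 : Function.update N₁ 0 (lineLetter 8 a' k0) 0 = lineLetter 8 a' k0 := Function.update_self ..
  have s2 : Function.update N₁ 0 (lineLetter 8 a' k0) 2 = lineLetter 8 c2 k2 := by rw [Function.update_of_ne (by decide)]; exact r2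
  have s3 : Function.update N₁ 0 (lineLetter 8 a' k0) 3 = lineLetter 8 c3 k3 := by rw [Function.update_of_ne (by decide)]; exact r3
  have ha'4 : a' ≠ 4 := by
    rintro rfl
    have := top2 _ hP₂ 0 2 k0 (by decide) s0
    rw [s2, isApex_lineLetter_iff] at this; omega
  set P₂ := Function.update N₁ 0 (lineLetter 8 a' k0) with hP₂def
  -- up-server on factor 2, then down-server of factor 0 (factor 3 charged): charge a'' = 4 — a top letter next to factor 3
  obtain ⟨N₂, hN₂, c2', -, rfl⟩ := pup _ hP₂ 2 c2 k2 s2 hc2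
  have t0 : Function.update P₂ 2 (lineLetter 8 c2' k2) 0 = lineLetter 8 a' k0 := by rw [Function.update_of_ne (by decide)]; exact s0
  have t3 : Function.update P₂ 2 (lineLetter 8 c2' k2) 3 = lineLetter 8 c3 k3 := by rw [Function.update_of_ne (by decide)]; exact s3
  obtain ⟨P₃, hP₃, a'', hlt'', hle'', rfl⟩ := ndown _ hN₂ 0 3 (by decide) a' c3 k0 k3 t0 (by omega) t3 hc3
  have ha'' : a'' = 4 := by omega
  subst ha''
  set N₂ := Function.update P₂ 2 (lineLetter 8 c2' k2) with hN₂def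
  have w0 : Function.update N₂ 0 (lineLetter 8 4 k0) 0 = lineLetter 8 4 k0 := Function.update_self ..
  have w3 : Function.update N₂ 0 (lineLetter 8 4 k0) 3 = lineLetter 8 c3 k3 := by rw [Function.update_of_ne (by decide)]; exact t3
  have := top2 _ hP₃ 0 3 k0 (by decide) w0
  rw [w3, isApex_lineLetter_iff] at this
  omega


/-- **NO FULLY CHARGED LINE CELL AT h = 8 UNDER Ψ₁** (kernel, no symmetry assumed): a RULE-D-closed, `X+`-closed configuration of
effective LINE-8 cells satisfying the encoder's Ψ₁-clause contains no fully charged cell at either level (an FC `P`-cell forces an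
FC `N`-cell by Ψ₁ on the LINE; an FC `N`-cell's factor-0 down-server climbs `2 → 3 → 4` into the TOP-LAYER LAW). -/
theorem no_fc_psi_line8 {C : MConfig} (hC : LSupport 8 C) (hD : RuleDMu4Closed C) (hX : XPlusClosed C) (hΨ : C.PsiClause) :
    ∀ X ∈ C.lower ∪ C.upper, ¬ FCCell X := by
  have e : (2 * ((4 : ℕ) : ℤ)) = (8 : ℤ) := by norm_num
  have hC' : LSupport (2 * ((4 : ℕ) : ℤ)) C := by rw [e]; exact hC
  have top := (top_layer (n := 4) (by norm_num) hC' hD hX).2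
  rw [e] at top
  have noN := no_fcN_line8_core hC top
    (fun P hP g c k hg hc => p_up_server hC.1 (hC.2 P hP) (hD.2 P hP) hg hc)
    (fun Z hZ g j hgj c cj k kj hg hc hj hcj => n_down_server hC.2 (hD.1 Z hZ) hgj hg hc hj hcj)
  intro X hX hfc
  rcases Finset.mem_union.mp hX with hXN | hXP
  · exact noN X hXN hfc
  · obtain ⟨Z, hZ, hZf⟩ := fcN_of_fcP_psi hC hΨ hXP hfc
    exact noN Z hZ hZf

/-! ### §13.4 The layered simplex `Simp10` on LINE-10 (kernel, `decide`): `N`-cells = charge vectors of total charge 3 or 4,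
`P`-cells = total charge 4 or 5, one phase. It is RULE-D-closed, phase-pure (so `X+`-closed), `S₄`-invariant, has no bare hub,
and carries the fully charged cells `N[9I+ℓ]⁴` and `P[9I+ℓ]⁴` — so Ψ₁ (`PsiClause`) HOLDS on it. -/

/-- apex `10I`. -/
abbrev rA : BPoint := (10, 0, 0)

/-- LINE-10 letter of charge 1, phase 0: `8I + 1ℓ` = `(9, 1, 0)`. -/
abbrev rL1 : BPoint := (9, 1, 0)

/-- LINE-10 letter of charge 2, phase 0: `6I + 2ℓ` = `(8, 2, 0)`. -/
abbrev rL2 : BPoint := (8, 2, 0)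

/-- LINE-10 letter of charge 3, phase 0: `4I + 3ℓ` = `(7, 3, 0)`. -/
abbrev rL3 : BPoint := (7, 3, 0)

/-- LINE-10 letter of charge 4, phase 0: `2I + 4ℓ` = `(6, 4, 0)`. -/
abbrev rL4 : BPoint := (6, 4, 0)

/-- LINE-10 letter of charge 5, phase 0: `0I + 5ℓ` = `(5, 5, 0)`. -/
abbrev rL5 : BPoint := (5, 5, 0)

/-- `P` 0004. -/
def sp0004 : MCell := mcellOf rA rA rA rL4

/-- `P` 0005. -/
def sp0005 : MCell := mcellOf rA rA rA rL5

/-- `P` 0013. -/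
def sp0013 : MCell := mcellOf rA rA rL1 rL3

/-- `P` 0014. -/
def sp0014 : MCell := mcellOf rA rA rL1 rL4

/-- `P` 0022. -/
def sp0022 : MCell := mcellOf rA rA rL2 rL2

/-- `P` 0023. -/
def sp0023 : MCell := mcellOf rA rA rL2 rL3

/-- `P` 0031. -/
def sp0031 : MCell := mcellOf rA rA rL3 rL1

/-- `P` 0032. -/
def sp0032 : MCell := mcellOf rA rA rL3 rL2

/-- `P` 0040. -/
def sp0040 : MCell := mcellOf rA rA rL4 rA

/-- `P` 0041. -/
def sp0041 : MCell := mcellOf rA rA rL4 rL1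

/-- `P` 0050. -/
def sp0050 : MCell := mcellOf rA rA rL5 rA

/-- `P` 0103. -/
def sp0103 : MCell := mcellOf rA rL1 rA rL3

/-- `P` 0104. -/
def sp0104 : MCell := mcellOf rA rL1 rA rL4

/-- `P` 0112. -/
def sp0112 : MCell := mcellOf rA rL1 rL1 rL2

/-- `P` 0113. -/
def sp0113 : MCell := mcellOf rA rL1 rL1 rL3

/-- `P` 0121. -/
def sp0121 : MCell := mcellOf rA rL1 rL2 rL1

/-- `P` 0122. -/
def sp0122 : MCell := mcellOf rA rL1 rL2 rL2

/-- `P` 0130. -/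
def sp0130 : MCell := mcellOf rA rL1 rL3 rA

/-- `P` 0131. -/
def sp0131 : MCell := mcellOf rA rL1 rL3 rL1

/-- `P` 0140. -/
def sp0140 : MCell := mcellOf rA rL1 rL4 rA

/-- `P` 0202. -/
def sp0202 : MCell := mcellOf rA rL2 rA rL2

/-- `P` 0203. -/
def sp0203 : MCell := mcellOf rA rL2 rA rL3

/-- `P` 0211. -/
def sp0211 : MCell := mcellOf rA rL2 rL1 rL1

/-- `P` 0212. -/
def sp0212 : MCell := mcellOf rA rL2 rL1 rL2

/-- `P` 0220. -/
def sp0220 : MCell := mcellOf rA rL2 rL2 rA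

/-- `P` 0221. -/
def sp0221 : MCell := mcellOf rA rL2 rL2 rL1

/-- `P` 0230. -/
def sp0230 : MCell := mcellOf rA rL2 rL3 rA

/-- `P` 0301. -/
def sp0301 : MCell := mcellOf rA rL3 rA rL1

/-- `P` 0302. -/
def sp0302 : MCell := mcellOf rA rL3 rA rL2

/-- `P` 0310. -/
def sp0310 : MCell := mcellOf rA rL3 rL1 rA

/-- `P` 0311. -/
def sp0311 : MCell := mcellOf rA rL3 rL1 rL1

/-- `P` 0320. -/
def sp0320 : MCell := mcellOf rA rL3 rL2 rA

/-- `P` 0400. -/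
def sp0400 : MCell := mcellOf rA rL4 rA rA

/-- `P` 0401. -/
def sp0401 : MCell := mcellOf rA rL4 rA rL1

/-- `P` 0410. -/
def sp0410 : MCell := mcellOf rA rL4 rL1 rA

/-- `P` 0500. -/
def sp0500 : MCell := mcellOf rA rL5 rA rA

/-- `P` 1003. -/
def sp1003 : MCell := mcellOf rL1 rA rA rL3

/-- `P` 1004. -/
def sp1004 : MCell := mcellOf rL1 rA rA rL4

/-- `P` 1012. -/
def sp1012 : MCell := mcellOf rL1 rA rL1 rL2

/-- `P` 1013. -/
def sp1013 : MCell := mcellOf rL1 rA rL1 rL3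

/-- `P` 1021. -/
def sp1021 : MCell := mcellOf rL1 rA rL2 rL1

/-- `P` 1022. -/
def sp1022 : MCell := mcellOf rL1 rA rL2 rL2

/-- `P` 1030. -/
def sp1030 : MCell := mcellOf rL1 rA rL3 rA

/-- `P` 1031. -/
def sp1031 : MCell := mcellOf rL1 rA rL3 rL1

/-- `P` 1040. -/
def sp1040 : MCell := mcellOf rL1 rA rL4 rA

/-- `P` 1102. -/
def sp1102 : MCell := mcellOf rL1 rL1 rA rL2

/-- `P` 1103. -/
def sp1103 : MCell := mcellOf rL1 rL1 rA rL3

/-- `P` 1111. -/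
def sp1111 : MCell := mcellOf rL1 rL1 rL1 rL1

/-- `P` 1112. -/
def sp1112 : MCell := mcellOf rL1 rL1 rL1 rL2

/-- `P` 1120. -/
def sp1120 : MCell := mcellOf rL1 rL1 rL2 rA

/-- `P` 1121. -/
def sp1121 : MCell := mcellOf rL1 rL1 rL2 rL1

/-- `P` 1130. -/
def sp1130 : MCell := mcellOf rL1 rL1 rL3 rA

/-- `P` 1201. -/
def sp1201 : MCell := mcellOf rL1 rL2 rA rL1

/-- `P` 1202. -/
def sp1202 : MCell := mcellOf rL1 rL2 rA rL2

/-- `P` 1210. -/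
def sp1210 : MCell := mcellOf rL1 rL2 rL1 rA

/-- `P` 1211. -/
def sp1211 : MCell := mcellOf rL1 rL2 rL1 rL1

/-- `P` 1220. -/
def sp1220 : MCell := mcellOf rL1 rL2 rL2 rA

/-- `P` 1300. -/
def sp1300 : MCell := mcellOf rL1 rL3 rA rA

/-- `P` 1301. -/
def sp1301 : MCell := mcellOf rL1 rL3 rA rL1

/-- `P` 1310. -/
def sp1310 : MCell := mcellOf rL1 rL3 rL1 rA

/-- `P` 1400. -/
def sp1400 : MCell := mcellOf rL1 rL4 rA rA

/-- `P` 2002. -/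
def sp2002 : MCell := mcellOf rL2 rA rA rL2

/-- `P` 2003. -/
def sp2003 : MCell := mcellOf rL2 rA rA rL3

/-- `P` 2011. -/
def sp2011 : MCell := mcellOf rL2 rA rL1 rL1

/-- `P` 2012. -/
def sp2012 : MCell := mcellOf rL2 rA rL1 rL2

/-- `P` 2020. -/
def sp2020 : MCell := mcellOf rL2 rA rL2 rA

/-- `P` 2021. -/
def sp2021 : MCell := mcellOf rL2 rA rL2 rL1

/-- `P` 2030. -/
def sp2030 : MCell := mcellOf rL2 rA rL3 rA

/-- `P` 2101. -/
def sp2101 : MCell := mcellOf rL2 rL1 rA rL1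

/-- `P` 2102. -/
def sp2102 : MCell := mcellOf rL2 rL1 rA rL2

/-- `P` 2110. -/
def sp2110 : MCell := mcellOf rL2 rL1 rL1 rA

/-- `P` 2111. -/
def sp2111 : MCell := mcellOf rL2 rL1 rL1 rL1

/-- `P` 2120. -/
def sp2120 : MCell := mcellOf rL2 rL1 rL2 rA

/-- `P` 2200. -/
def sp2200 : MCell := mcellOf rL2 rL2 rA rA

/-- `P` 2201. -/
def sp2201 : MCell := mcellOf rL2 rL2 rA rL1

/-- `P` 2210. -/
def sp2210 : MCell := mcellOf rL2 rL2 rL1 rA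

/-- `P` 2300. -/
def sp2300 : MCell := mcellOf rL2 rL3 rA rA

/-- `P` 3001. -/
def sp3001 : MCell := mcellOf rL3 rA rA rL1

/-- `P` 3002. -/
def sp3002 : MCell := mcellOf rL3 rA rA rL2

/-- `P` 3010. -/
def sp3010 : MCell := mcellOf rL3 rA rL1 rA

/-- `P` 3011. -/
def sp3011 : MCell := mcellOf rL3 rA rL1 rL1

/-- `P` 3020. -/
def sp3020 : MCell := mcellOf rL3 rA rL2 rA

/-- `P` 3100. -/
def sp3100 : MCell := mcellOf rL3 rL1 rA rA

/-- `P` 3101. -/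
def sp3101 : MCell := mcellOf rL3 rL1 rA rL1

/-- `P` 3110. -/
def sp3110 : MCell := mcellOf rL3 rL1 rL1 rA

/-- `P` 3200. -/
def sp3200 : MCell := mcellOf rL3 rL2 rA rA

/-- `P` 4000. -/
def sp4000 : MCell := mcellOf rL4 rA rA rA

/-- `P` 4001. -/
def sp4001 : MCell := mcellOf rL4 rA rA rL1

/-- `P` 4010. -/
def sp4010 : MCell := mcellOf rL4 rA rL1 rA

/-- `P` 4100. -/
def sp4100 : MCell := mcellOf rL4 rL1 rA rA

/-- `P` 5000. -/
def sp5000 : MCell := mcellOf rL5 rA rA rA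

/-- `N` 0003. -/
def sn0003 : MCell := mcellOf rA rA rA rL3

/-- `N` 0004. -/
def sn0004 : MCell := mcellOf rA rA rA rL4

/-- `N` 0012. -/
def sn0012 : MCell := mcellOf rA rA rL1 rL2

/-- `N` 0013. -/
def sn0013 : MCell := mcellOf rA rA rL1 rL3

/-- `N` 0021. -/
def sn0021 : MCell := mcellOf rA rA rL2 rL1

/-- `N` 0022. -/
def sn0022 : MCell := mcellOf rA rA rL2 rL2

/-- `N` 0030. -/
def sn0030 : MCell := mcellOf rA rA rL3 rA

/-- `N` 0031. -/
def sn0031 : MCell := mcellOf rA rA rL3 rL1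

/-- `N` 0040. -/
def sn0040 : MCell := mcellOf rA rA rL4 rA

/-- `N` 0102. -/
def sn0102 : MCell := mcellOf rA rL1 rA rL2

/-- `N` 0103. -/
def sn0103 : MCell := mcellOf rA rL1 rA rL3

/-- `N` 0111. -/
def sn0111 : MCell := mcellOf rA rL1 rL1 rL1

/-- `N` 0112. -/
def sn0112 : MCell := mcellOf rA rL1 rL1 rL2

/-- `N` 0120. -/
def sn0120 : MCell := mcellOf rA rL1 rL2 rA

/-- `N` 0121. -/
def sn0121 : MCell := mcellOf rA rL1 rL2 rL1

/-- `N` 0130. -/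
def sn0130 : MCell := mcellOf rA rL1 rL3 rA

/-- `N` 0201. -/
def sn0201 : MCell := mcellOf rA rL2 rA rL1

/-- `N` 0202. -/
def sn0202 : MCell := mcellOf rA rL2 rA rL2

/-- `N` 0210. -/
def sn0210 : MCell := mcellOf rA rL2 rL1 rA

/-- `N` 0211. -/
def sn0211 : MCell := mcellOf rA rL2 rL1 rL1

/-- `N` 0220. -/
def sn0220 : MCell := mcellOf rA rL2 rL2 rA

/-- `N` 0300. -/
def sn0300 : MCell := mcellOf rA rL3 rA rA

/-- `N` 0301. -/
def sn0301 : MCell := mcellOf rA rL3 rA rL1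

/-- `N` 0310. -/
def sn0310 : MCell := mcellOf rA rL3 rL1 rA

/-- `N` 0400. -/
def sn0400 : MCell := mcellOf rA rL4 rA rA

/-- `N` 1002. -/
def sn1002 : MCell := mcellOf rL1 rA rA rL2

/-- `N` 1003. -/
def sn1003 : MCell := mcellOf rL1 rA rA rL3

/-- `N` 1011. -/
def sn1011 : MCell := mcellOf rL1 rA rL1 rL1

/-- `N` 1012. -/
def sn1012 : MCell := mcellOf rL1 rA rL1 rL2

/-- `N` 1020. -/
def sn1020 : MCell := mcellOf rL1 rA rL2 rA

/-- `N` 1021. -/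
def sn1021 : MCell := mcellOf rL1 rA rL2 rL1

/-- `N` 1030. -/
def sn1030 : MCell := mcellOf rL1 rA rL3 rA

/-- `N` 1101. -/
def sn1101 : MCell := mcellOf rL1 rL1 rA rL1

/-- `N` 1102. -/
def sn1102 : MCell := mcellOf rL1 rL1 rA rL2

/-- `N` 1110. -/
def sn1110 : MCell := mcellOf rL1 rL1 rL1 rA

/-- `N` 1111. -/
def sn1111 : MCell := mcellOf rL1 rL1 rL1 rL1

/-- `N` 1120. -/
def sn1120 : MCell := mcellOf rL1 rL1 rL2 rA

/-- `N` 1200. -/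
def sn1200 : MCell := mcellOf rL1 rL2 rA rA

/-- `N` 1201. -/
def sn1201 : MCell := mcellOf rL1 rL2 rA rL1

/-- `N` 1210. -/
def sn1210 : MCell := mcellOf rL1 rL2 rL1 rA

/-- `N` 1300. -/
def sn1300 : MCell := mcellOf rL1 rL3 rA rA

/-- `N` 2001. -/
def sn2001 : MCell := mcellOf rL2 rA rA rL1

/-- `N` 2002. -/
def sn2002 : MCell := mcellOf rL2 rA rA rL2

/-- `N` 2010. -/
def sn2010 : MCell := mcellOf rL2 rA rL1 rA

/-- `N` 2011. -/
def sn2011 : MCell := mcellOf rL2 rA rL1 rL1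

/-- `N` 2020. -/
def sn2020 : MCell := mcellOf rL2 rA rL2 rA

/-- `N` 2100. -/
def sn2100 : MCell := mcellOf rL2 rL1 rA rA

/-- `N` 2101. -/
def sn2101 : MCell := mcellOf rL2 rL1 rA rL1

/-- `N` 2110. -/
def sn2110 : MCell := mcellOf rL2 rL1 rL1 rA

/-- `N` 2200. -/
def sn2200 : MCell := mcellOf rL2 rL2 rA rA

/-- `N` 3000. -/
def sn3000 : MCell := mcellOf rL3 rA rA rA

/-- `N` 3001. -/
def sn3001 : MCell := mcellOf rL3 rA rA rL1

/-- `N` 3010. -/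
def sn3010 : MCell := mcellOf rL3 rA rL1 rA

/-- `N` 3100. -/
def sn3100 : MCell := mcellOf rL3 rL1 rA rA

/-- `N` 4000. -/
def sn4000 : MCell := mcellOf rL4 rA rA rA

/-- the 55 `N`-cells of `Simp10`: the charge vectors of total charge 3 or 4. -/
def Simp10N : Finset MCell :=
  {sn0003, sn0004, sn0012, sn0013, sn0021, sn0022, sn0030, sn0031, sn0040, sn0102, sn0103, sn0111, sn0112, sn0120, sn0121, sn0130, sn0201, sn0202, sn0210, sn0211, sn0220, sn0300, sn0301, sn0310, sn0400, sn1002, sn1003, sn1011, sn1012, sn1020, sn1021, sn1030, sn1101, sn1102, sn1110, sn1111, sn1120, sn1200, sn1201, sn1210, sn1300, sn2001, sn2002, sn2010, sn2011, sn2020, sn2100, sn2101, sn2110, sn2200, sn3000, sn3001, sn3010, sn3100, sn4000}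

/-- the 91 `P`-cells of `Simp10`: the charge vectors of total charge 4 or 5. -/
def Simp10P : Finset MCell :=
  {sp0004, sp0005, sp0013, sp0014, sp0022, sp0023, sp0031, sp0032, sp0040, sp0041, sp0050, sp0103, sp0104, sp0112, sp0113, sp0121, sp0122, sp0130, sp0131, sp0140, sp0202, sp0203, sp0211, sp0212, sp0220, sp0221, sp0230, sp0301, sp0302, sp0310, sp0311, sp0320, sp0400, sp0401, sp0410, sp0500, sp1003, sp1004, sp1012, sp1013, sp1021, sp1022, sp1030, sp1031, sp1040, sp1102, sp1103, sp1111, sp1112, sp1120, sp1121, sp1130, sp1201, sp1202, sp1210, sp1211, sp1220, sp1300, sp1301, sp1310, sp1400, sp2002, sp2003, sp2011, sp2012, sp2020, sp2021, sp2030, sp2101, sp2102, sp2110, sp2111, sp2120, sp2200, sp2201, sp2210, sp2300, sp3001, sp3002, sp3010, sp3011, sp3020, sp3100, sp3101, sp3110, sp3200, sp4000, sp4001, sp4010, sp4100, sp5000}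

/-- **Simp10** — THE LAYERED SIMPLEX on LINE-10 (146 cells, one phase): `N` = total charge `3 ∨ 4`, `P` = total charge `4 ∨ 5`;
every charged letter of a `P`-cell is up-served by lowering it by one, every charged letter of an `N`-cell is down-served by
raising it by one (legal: no `N`-letter reaches the top charge `5`, the only `P`-cells with a top letter are the towers `P(5|A³)`). -/
def Simp10 : MConfig := ⟨Simp10N, Simp10P⟩

set_option maxRecDepth 16384 in
/-- the letters of `Simp10`. [kernel, `decide`] -/
theorem simp10_letters : ∀ X ∈ Simp10.lower ∪ Simp10.upper, ∀ f, X f ∈ ({rA, rL1, rL2, rL3, rL4, rL5} : Finset BPoint) := by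
  decide +kernel

/-- they are effective LINE-10 letters … -/
theorem isLL_simp10 {x : BPoint} (hx : x ∈ ({rA, rL1, rL2, rL3, rL4, rL5} : Finset BPoint)) : IsLL 10 x := by
  simp only [Finset.mem_insert, Finset.mem_singleton] at hx
  rcases hx with rfl | rfl | rfl | rfl | rfl | rfl
  · exact ⟨0, 0, by norm_num, by decide⟩
  · exact ⟨1, 0, by norm_num, by decide⟩
  · exact ⟨2, 0, by norm_num, by decide⟩
  · exact ⟨3, 0, by norm_num, by decide⟩
  · exact ⟨4, 0, by norm_num, by decide⟩
  · exact ⟨5, 0, by norm_num, by decide⟩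

/-- … of phase `0` when charged. -/
theorem phase0_simp10 {x : BPoint} (hx : x ∈ ({rA, rL1, rL2, rL3, rL4, rL5} : Finset BPoint)) {c : ℕ} {k : Fin 4}
    (e : x = lineLetter 10 c k) (hc : 1 ≤ c) : k = 0 := by
  simp only [Finset.mem_insert, Finset.mem_singleton] at hx
  rcases hx with rfl | rfl | rfl | rfl | rfl | rfl <;> fin_cases k <;> simp [lineLetter, Prod.ext_iff] at e ⊢ <;> omega

/-- `Simp10` is an effective LINE-10 support … -/
theorem simp10_lsupport : LSupport 10 Simp10 :=
  ⟨fun Z hZ f => isLL_simp10 (simp10_letters Z (Finset.mem_union_left _ hZ) f),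
   fun P hP f => isLL_simp10 (simp10_letters P (Finset.mem_union_right _ hP) f)⟩

/-- … of phase `0`. -/
theorem simp10_pure : PhasePure 10 0 Simp10 :=
  fun X hX f _ _ e hc => phase0_simp10 (simp10_letters X hX f) e hc

set_option maxRecDepth 16384 in
/-- … without bare hubs. [kernel, `decide`] -/
theorem simp10_bare : NoBare Simp10 := by
  decide +kernel

set_option synthInstance.maxSize 16384 in
set_option synthInstance.maxHeartbeats 4000000 in
set_option maxRecDepth 16384 in
/-- **`Simp10` IS RULE-D-CLOSED.** [kernel, `decide`] -/
theorem simp10_ruleD : RuleDMu4Closed Simp10 := by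
  refine ⟨?_, ?_⟩ <;> decide +kernel

set_option maxRecDepth 16384 in
set_option maxHeartbeats 4000000 in
/-- **`Simp10` IS `S₄`-INVARIANT** (closed under the transpositions `(0 1)`, `(1 2)`, `(2 3)`, both levels). [kernel, `decide`] -/
theorem simp10_perm :
    ((∀ X ∈ Simp10.lower, (fun f => X (t01 f)) ∈ Simp10.lower) ∧ (∀ X ∈ Simp10.upper, (fun f => X (t01 f)) ∈ Simp10.upper)) ∧
    ((∀ X ∈ Simp10.lower, (fun f => X (t12 f)) ∈ Simp10.lower) ∧ (∀ X ∈ Simp10.upper, (fun f => X (t12 f)) ∈ Simp10.upper)) ∧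
    ((∀ X ∈ Simp10.lower, (fun f => X (t23 f)) ∈ Simp10.lower) ∧ (∀ X ∈ Simp10.upper, (fun f => X (t23 f)) ∈ Simp10.upper)) := by
  refine ⟨⟨?_, ?_⟩, ⟨?_, ?_⟩, ⟨?_, ?_⟩⟩ <;> decide +kernel

/-- the fully charged cells of `Simp10` on both levels. [kernel, `decide`] -/
theorem simp10_fc : (sn1111 ∈ Simp10.lower ∧ FCCell sn1111) ∧ (sp1111 ∈ Simp10.upper ∧ FCCell sp1111) := by
  refine ⟨⟨by decide +kernel, by decide⟩, ⟨by decide +kernel, by decide⟩⟩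

/-- **`Simp10` IS STATIC-CLOSED AND Ψ₁-BALANCED, WITH FULLY CHARGED CELLS.** -/
theorem simp10_static : RuleDMu4Closed Simp10 ∧ XresFourClosed Simp10 ∧ Simp10.PsiClause :=
  ⟨simp10_ruleD, (xresFour_iff_xplus simp10_lsupport).2 (xplus_of_phasePure simp10_lsupport simp10_pure),
    psiClause_of_fc simp10_lsupport ⟨_, simp10_fc.1.1, simp10_fc.1.2⟩ ⟨_, simp10_fc.2.1, simp10_fc.2.2⟩⟩

/-! ### §13.5 Its `G₁`-orbit union `Simp10G1 = Simp10 ∪ Δ Simp10 ∪ Δ² Simp10 ∪ Δ³ Simp10` (584 cells; structural from §13.1) -/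

/-- union of two configurations, levelwise. -/
abbrev cupC (A B : MConfig) : MConfig := ⟨A.lower ∪ B.lower, A.upper ∪ B.upper⟩

theorem sub_cupC_left (A B : MConfig) : A.sub (cupC A B) :=
  ⟨Finset.subset_union_left, Finset.subset_union_left⟩

theorem sub_cupC_right (A B : MConfig) : B.sub (cupC A B) :=
  ⟨Finset.subset_union_right, Finset.subset_union_right⟩

theorem sub_trans' {A B D : MConfig} (h1 : A.sub B) (h2 : B.sub D) : A.sub D :=
  ⟨h1.1.trans h2.1, h1.2.trans h2.2⟩

theorem mem_cupC_cells {A B : MConfig} {X : MCell} (hX : X ∈ (cupC A B).lower ∪ (cupC A B).upper) :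
    X ∈ A.lower ∪ A.upper ∨ X ∈ B.lower ∪ B.upper := by
  simp only [Finset.mem_union] at hX ⊢
  tauto

theorem ruleDMu4Closed_cupC {A B : MConfig} (hA : RuleDMu4Closed A) (hB : RuleDMu4Closed B) : RuleDMu4Closed (cupC A B) := by
  refine ⟨fun Z hZ => ?_, fun P hP => ?_⟩
  · rcases Finset.mem_union.mp hZ with h | h
    · exact ruleDMu4N_mono (sub_cupC_left A B) (hA.1 Z h)
    · exact ruleDMu4N_mono (sub_cupC_right A B) (hB.1 Z h)
  · rcases Finset.mem_union.mp hP with h | h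
    · exact ruleDMu4P_mono (sub_cupC_left A B) (hA.2 P h)
    · exact ruleDMu4P_mono (sub_cupC_right A B) (hB.2 P h)

theorem lsupport_cupC {h : ℤ} {A B : MConfig} (hA : LSupport h A) (hB : LSupport h B) : LSupport h (cupC A B) :=
  ⟨fun Z hZ f => by
    rcases Finset.mem_union.mp hZ with hz | hz
    · exact hA.1 Z hz f
    · exact hB.1 Z hz f,
   fun P hP f => by
    rcases Finset.mem_union.mp hP with hp | hp
    · exact hA.2 P hp f
    · exact hB.2 P hp f⟩

theorem cellwise_cupC {h : ℤ} {A B : MConfig} (hA : CellwisePure h A) (hB : CellwisePure h B) : CellwisePure h (cupC A B) := by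
  intro X hX
  rcases mem_cupC_cells hX with hX | hX
  · exact hA X hX
  · exact hB X hX

theorem bare_cupC {A B : MConfig} (hA : NoBare A) (hB : NoBare B) : NoBare (cupC A B) := by
  intro N hN
  rcases Finset.mem_union.mp hN with h | h
  · exact hA N h
  · exact hB N h

/-- a phase-pure configuration is cellwise pure. -/
theorem cellwise_of_pure {h : ℤ} {k₀ : Fin 4} {C : MConfig} (hp : PhasePure h k₀ C) : CellwisePure h C :=
  fun X hX f g c c' k k' e e' hc hc' => (hp X hX f c k e hc).trans (hp X hX g c' k' e' hc').symm

/-- `Δ` rotates the phase of a phase-pure configuration. -/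
theorem pure_delta {h : ℤ} {k₀ : Fin 4} {C : MConfig} (hp : PhasePure h k₀ C) : PhasePure h (k₀ + 3) (deltaC C) := by
  intro X hX f c k e hc
  have hX' : ∃ X₀ ∈ C.lower ∪ C.upper, dCell X₀ = X := by
    rcases Finset.mem_union.mp hX with hX | hX
    · obtain ⟨X₀, h₀, e₀⟩ := Finset.mem_image.mp hX; exact ⟨X₀, Finset.mem_union_left _ h₀, e₀⟩
    · obtain ⟨X₀, h₀, e₀⟩ := Finset.mem_image.mp hX; exact ⟨X₀, Finset.mem_union_right _ h₀, e₀⟩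
  obtain ⟨X₀, hX₀, rfl⟩ := hX'
  have e' : X₀ f = lineLetter h c (k + 1) := by
    apply dPt_inj.mp
    show dCell X₀ f = _
    rw [e, dPt_lineLetter, fin4_r4]
  have := hp X₀ hX₀ f c (k + 1) e' hc
  rw [← this, fin4_r4]

/-- `Δ` keeps «no bare hub». -/
theorem bare_delta {C : MConfig} (hb : NoBare C) : NoBare (deltaC C) := by
  intro N hN
  obtain ⟨N₀, hN₀, rfl⟩ := Finset.mem_image.mp hN
  obtain ⟨f, hf⟩ := hb N₀ hN₀
  exact ⟨f, fun h => hf ((isApex_dPt _).1 h)⟩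

/-- closure under a factor permutation passes to the rotated copy. -/
theorem permClosed_delta {S : Finset MCell} (π : Fin 4 → Fin 4) (hS : ∀ X ∈ S, (fun f => X (π f)) ∈ S) :
    ∀ X ∈ S.image dCell, (fun f => X (π f)) ∈ S.image dCell := by
  intro X hX
  obtain ⟨X₀, hX₀, rfl⟩ := Finset.mem_image.mp hX
  exact Finset.mem_image.mpr ⟨fun f => X₀ (π f), hS X₀ hX₀, by funext f; rfl⟩

theorem permClosed_union {S T : Finset MCell} (π : Fin 4 → Fin 4) (hS : ∀ X ∈ S, (fun f => X (π f)) ∈ S)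
    (hT : ∀ X ∈ T, (fun f => X (π f)) ∈ T) : ∀ X ∈ S ∪ T, (fun f => X (π f)) ∈ S ∪ T := by
  intro X hX
  rcases Finset.mem_union.mp hX with h | h
  · exact Finset.mem_union_left _ (hS X h)
  · exact Finset.mem_union_right _ (hT X h)

/-- `Δ⁴ = 1` on cells. -/
theorem dCell_pow4 (X : MCell) : dCell (dCell (dCell (dCell X))) = X := by
  funext f
  rcases hx : X f with ⟨a, b, c⟩
  simp [dCell, dPt, hx]

/-- `Δ Simp10`, `Δ² Simp10`, `Δ³ Simp10`. -/
abbrev Simp10r1 : MConfig := deltaC Simp10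
/-- … -/
abbrev Simp10r2 : MConfig := deltaC Simp10r1
/-- … -/
abbrev Simp10r3 : MConfig := deltaC Simp10r2

/-- **Simp10G1** := the `⟨Δ⟩`-orbit union of `Simp10` (4 × 146 = 584 cells). -/
abbrev Simp10G1 : MConfig := cupC (cupC (cupC Simp10 Simp10r1) Simp10r2) Simp10r3

/-- `Simp10G1` is an effective LINE-10 support, RULE-D-closed, cellwise pure, without bare hubs. -/
theorem simp10G1_basic : LSupport 10 Simp10G1 ∧ RuleDMu4Closed Simp10G1 ∧ CellwisePure 10 Simp10G1 ∧ NoBare Simp10G1 := by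
  have L0 := simp10_lsupport
  have L1 := lsupport_delta L0
  have L2 := lsupport_delta L1
  have L3 := lsupport_delta L2
  have D0 := simp10_ruleD
  have D1 := ruleDMu4Closed_delta D0
  have D2 := ruleDMu4Closed_delta D1
  have D3 := ruleDMu4Closed_delta D2
  have P0 := simp10_pure
  have P1 := pure_delta P0
  have P2 := pure_delta P1
  have P3 := pure_delta P2
  have B0 := simp10_bare
  have B1 := bare_delta B0
  have B2 := bare_delta B1
  have B3 := bare_delta B2
  exact ⟨lsupport_cupC (lsupport_cupC (lsupport_cupC L0 L1) L2) L3,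
    ruleDMu4Closed_cupC (ruleDMu4Closed_cupC (ruleDMu4Closed_cupC D0 D1) D2) D3,
    cellwise_cupC (cellwise_cupC (cellwise_cupC (cellwise_of_pure P0) (cellwise_of_pure P1)) (cellwise_of_pure P2))
      (cellwise_of_pure P3),
    bare_cupC (bare_cupC (bare_cupC B0 B1) B2) B3⟩

/-- `Simp10G1` is `Δ`-closed (both levels). -/
theorem simp10G1_deltaClosed :
    (∀ X ∈ Simp10G1.lower, dCell X ∈ Simp10G1.lower) ∧ (∀ X ∈ Simp10G1.upper, dCell X ∈ Simp10G1.upper) := by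
  refine ⟨fun X hX => ?_, fun X hX => ?_⟩
  · simp only [Finset.mem_union] at hX ⊢
    rcases hX with ((h0 | h1) | h2) | h3
    · exact Or.inl (Or.inl (Or.inr (Finset.mem_image_of_mem _ h0)))
    · exact Or.inl (Or.inr (Finset.mem_image_of_mem _ h1))
    · exact Or.inr (Finset.mem_image_of_mem _ h2)
    · obtain ⟨X₂, hX₂, rfl⟩ := Finset.mem_image.mp h3
      obtain ⟨X₁, hX₁, rfl⟩ := Finset.mem_image.mp hX₂
      obtain ⟨X₀, hX₀, rfl⟩ := Finset.mem_image.mp hX₁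
      rw [dCell_pow4]; exact Or.inl (Or.inl (Or.inl hX₀))
  · simp only [Finset.mem_union] at hX ⊢
    rcases hX with ((h0 | h1) | h2) | h3
    · exact Or.inl (Or.inl (Or.inr (Finset.mem_image_of_mem _ h0)))
    · exact Or.inl (Or.inr (Finset.mem_image_of_mem _ h1))
    · exact Or.inr (Finset.mem_image_of_mem _ h2)
    · obtain ⟨X₂, hX₂, rfl⟩ := Finset.mem_image.mp h3
      obtain ⟨X₁, hX₁, rfl⟩ := Finset.mem_image.mp hX₂
      obtain ⟨X₀, hX₀, rfl⟩ := Finset.mem_image.mp hX₁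
      rw [dCell_pow4]; exact Or.inl (Or.inl (Or.inl hX₀))

/-- `Simp10G1` is closed under the transpositions `(0 1)`, `(1 2)`, `(2 3)` (both levels) — with `Δ`: `G₁`-closed. -/
theorem simp10G1_permClosed :
    ((∀ X ∈ Simp10G1.lower, (fun f => X (t01 f)) ∈ Simp10G1.lower) ∧ (∀ X ∈ Simp10G1.upper, (fun f => X (t01 f)) ∈ Simp10G1.upper)) ∧
    ((∀ X ∈ Simp10G1.lower, (fun f => X (t12 f)) ∈ Simp10G1.lower) ∧ (∀ X ∈ Simp10G1.upper, (fun f => X (t12 f)) ∈ Simp10G1.upper)) ∧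
    ((∀ X ∈ Simp10G1.lower, (fun f => X (t23 f)) ∈ Simp10G1.lower) ∧ (∀ X ∈ Simp10G1.upper, (fun f => X (t23 f)) ∈ Simp10G1.upper)) := by
  obtain ⟨⟨a1, a2⟩, ⟨b1, b2⟩, ⟨c1, c2⟩⟩ := simp10_perm
  refine ⟨⟨?_, ?_⟩, ⟨?_, ?_⟩, ⟨?_, ?_⟩⟩
  · exact permClosed_union t01 (permClosed_union t01 (permClosed_union t01 a1 (permClosed_delta t01 a1))
      (permClosed_delta t01 (permClosed_delta t01 a1))) (permClosed_delta t01 (permClosed_delta t01 (permClosed_delta t01 a1)))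
  · exact permClosed_union t01 (permClosed_union t01 (permClosed_union t01 a2 (permClosed_delta t01 a2))
      (permClosed_delta t01 (permClosed_delta t01 a2))) (permClosed_delta t01 (permClosed_delta t01 (permClosed_delta t01 a2)))
  · exact permClosed_union t12 (permClosed_union t12 (permClosed_union t12 b1 (permClosed_delta t12 b1))
      (permClosed_delta t12 (permClosed_delta t12 b1))) (permClosed_delta t12 (permClosed_delta t12 (permClosed_delta t12 b1)))
  · exact permClosed_union t12 (permClosed_union t12 (permClosed_union t12 b2 (permClosed_delta t12 b2))
      (permClosed_delta t12 (permClosed_delta t12 b2))) (permClosed_delta t12 (permClosed_delta t12 (permClosed_delta t12 b2)))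
  · exact permClosed_union t23 (permClosed_union t23 (permClosed_union t23 c1 (permClosed_delta t23 c1))
      (permClosed_delta t23 (permClosed_delta t23 c1))) (permClosed_delta t23 (permClosed_delta t23 (permClosed_delta t23 c1)))
  · exact permClosed_union t23 (permClosed_union t23 (permClosed_union t23 c2 (permClosed_delta t23 c2))
      (permClosed_delta t23 (permClosed_delta t23 c2))) (permClosed_delta t23 (permClosed_delta t23 (permClosed_delta t23 c2)))

/-- the fully charged cells of `Simp10G1` on both levels. -/
theorem simp10G1_fc : (sn1111 ∈ Simp10G1.lower ∧ FCCell sn1111) ∧ (sp1111 ∈ Simp10G1.upper ∧ FCCell sp1111) :=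
  ⟨⟨by simp only [Finset.mem_union]; exact Or.inl (Or.inl (Or.inl simp10_fc.1.1)), simp10_fc.1.2⟩,
   ⟨by simp only [Finset.mem_union]; exact Or.inl (Or.inl (Or.inl simp10_fc.2.1)), simp10_fc.2.2⟩⟩

/-- **`Simp10G1` IS STATIC-CLOSED AND Ψ₁-BALANCED** (RULE D, the four families, `PsiClause`). -/
theorem simp10G1_static : RuleDMu4Closed Simp10G1 ∧ XresFourClosed Simp10G1 ∧ Simp10G1.PsiClause := by
  obtain ⟨hL, hD, hcw, hb⟩ := simp10G1_basic
  exact ⟨hD, (xresFour_iff_xplus hL).2 (xplus_of_cellwisePure hL hcw hb),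
    psiClause_of_fc hL ⟨_, simp10G1_fc.1.1, simp10G1_fc.1.2⟩ ⟨_, simp10G1_fc.2.1, simp10G1_fc.2.2⟩⟩

/-! ### §13.6 … translated to every height `h ≥ 10` (§11): the h-UNIFORM Ψ₁-BALANCED `G₁` SEPARATION -/

/-- **SimpLine h** := `Simp10G1` translated up by `h − 10`. -/
abbrev SimpLine (h : ℤ) : MConfig := transC (h - 10) Simp10G1

/-- fully charged is translation invariant. -/
theorem fcCell_tCell {t : ℤ} {X : MCell} : FCCell (tCell t X) ↔ FCCell X := Iff.rfl

/-- **THE h-UNIFORM Ψ₁-BALANCED `G₁` SEPARATION (kernel, every `h ≥ 10`)**: `SimpLine h` is an effective LINE-`h` support,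
`G₁ = ⟨Δ⟩ × S₄`-closed, RULE-D-closed, closed for all four instance families, SATISFIES Ψ₁ (`PsiClause`), and carries fully
charged cells on BOTH levels (`N[(h−1)I+ℓ]⁴`, `P[(h−1)I+ℓ]⁴`). So from `h = 10` on, the H₁-statics + Ψ₁ under `G₁` do not
exclude fully charged LINE cells; at `h = 8` they do (`no_fc_psi_line8`, no symmetry needed); at `h = 6` already RULE D + `X+` do
(`no_fc_line6`). Only the `Σ ≡ 0` shifts exclude them at every height (`line_inertia`). -/
theorem simpLine_uniform (h : ℤ) (hh : 10 ≤ h) :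
    LSupport h (SimpLine h) ∧
    ((∀ X ∈ (SimpLine h).lower, dCell X ∈ (SimpLine h).lower) ∧ (∀ X ∈ (SimpLine h).upper, dCell X ∈ (SimpLine h).upper)) ∧
    ((∀ X ∈ (SimpLine h).lower, (fun f => X (t01 f)) ∈ (SimpLine h).lower) ∧ (∀ X ∈ (SimpLine h).upper, (fun f => X (t01 f)) ∈ (SimpLine h).upper) ∧
     (∀ X ∈ (SimpLine h).lower, (fun f => X (t12 f)) ∈ (SimpLine h).lower) ∧ (∀ X ∈ (SimpLine h).upper, (fun f => X (t12 f)) ∈ (SimpLine h).upper) ∧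
     (∀ X ∈ (SimpLine h).lower, (fun f => X (t23 f)) ∈ (SimpLine h).lower) ∧ (∀ X ∈ (SimpLine h).upper, (fun f => X (t23 f)) ∈ (SimpLine h).upper)) ∧
    RuleDMu4Closed (SimpLine h) ∧ XresFourClosed (SimpLine h) ∧ (SimpLine h).PsiClause ∧
    (∃ Z ∈ (SimpLine h).lower, FCCell Z) ∧ (∃ P ∈ (SimpLine h).upper, FCCell P) := by
  have e10 : (10 : ℤ) + (h - 10) = h := by ring
  obtain ⟨hL0, hD0, hcw0, hb0⟩ := simp10G1_basic
  have hL : LSupport h (SimpLine h) := by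
    have := lsupport_trans (h₀ := 10) (t := h - 10) (by omega) hL0
    rwa [e10] at this
  have hcw := cellwise_trans (h₀ := 10) (t := h - 10) (C := Simp10G1) hcw0
  rw [e10] at hcw
  have hX : XPlusClosed (SimpLine h) := xplus_of_cellwisePure hL hcw (bare_trans hb0)
  have hD : RuleDMu4Closed (SimpLine h) := ruleDMu4Closed_trans _ hD0
  have hN : ∃ Z ∈ (SimpLine h).lower, FCCell Z :=
    ⟨tCell (h - 10) sn1111, Finset.mem_image_of_mem _ simp10G1_fc.1.1, fcCell_tCell.2 simp10G1_fc.1.2⟩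
  have hP : ∃ P ∈ (SimpLine h).upper, FCCell P :=
    ⟨tCell (h - 10) sp1111, Finset.mem_image_of_mem _ simp10G1_fc.2.1, fcCell_tCell.2 simp10G1_fc.2.2⟩
  obtain ⟨⟨p1, p2⟩, ⟨p3, p4⟩, ⟨p5, p6⟩⟩ := simp10G1_permClosed
  exact ⟨hL, ⟨deltaClosed_trans simp10G1_deltaClosed.1, deltaClosed_trans simp10G1_deltaClosed.2⟩,
    ⟨permClosed_trans t01 p1, permClosed_trans t01 p2, permClosed_trans t12 p3, permClosed_trans t12 p4,
     permClosed_trans t23 p5, permClosed_trans t23 p6⟩,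
    hD, (xresFour_iff_xplus hL).2 hX, psiClause_of_fc hL hN hP, hN, hP⟩

/-- **THE Ψ₁ THRESHOLD in one statement**: with Ψ₁, no fully charged cell in any static-closed effective LINE-8 support (no
symmetry assumed), but fully charged cells on both levels of a `Δ`-closed, static-closed, Ψ₁-balanced effective LINE-`h` support
for every `h ≥ 10`. -/
theorem fc_psi_threshold :
    (∀ C : MConfig, LSupport 8 C → RuleDMu4Closed C → XPlusClosed C → C.PsiClause → ∀ X ∈ C.lower ∪ C.upper, ¬ FCCell X) ∧
    (∀ h : ℤ, 10 ≤ h → ∃ C : MConfig, LSupport h C ∧ RuleDMu4Closed C ∧ XresFourClosed C ∧ C.PsiClause ∧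
      (∀ X ∈ C.lower, dCell X ∈ C.lower) ∧ (∀ X ∈ C.upper, dCell X ∈ C.upper) ∧
      (∃ Z ∈ C.lower, FCCell Z) ∧ ∃ P ∈ C.upper, FCCell P) :=
  ⟨fun _ hC hD hX hΨ => no_fc_psi_line8 hC hD hX hΨ, fun h hh => by
    obtain ⟨hL, ⟨hd1, hd2⟩, -, hD, hX4, hΨ, hN, hP⟩ := simpLine_uniform h hh
    exact ⟨SimpLine h, hL, hD, hX4, hΨ, hd1, hd2, hN, hP⟩⟩

end PsiThreshold

end Summit.HodgeConjecture.HodgeConjecture.Cruxes.BlochSeedDiscOne.LineInertia
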